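import Mathlib
import HarnessLib
import Literature.NumberTheory.LFunctions.ElliottShiftedDifferences
import Literature.NumberTheory.LFunctions.MertensTail

/-!
# The Turán–Kubilius inequality (Elliott 1985, Ch. 1, Lemma (1.5); Ch. 5, Lemma (5.2))

For a real additive arithmetic function `f` (`f(rs) = f(r) + f(s)` for coprime `r, s`; the
tree's `Literature.NumberTheory.LFunctions.Elliott1985.IsAdditiveArith`) put, following Elliott
(*Arithmetic Functions and Integer Products*, Grundlehren 272, Springer 1985, Ch. 1, p. 23),
`E(x) = ∑_{p^α ≤ x} f(p^α) p^{-α} (1 − 1/p)` and `D(x)² = ∑_{p^α ≤ x} |f(p^α)|² / p^α`.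
The **Turán–Kubilius inequality** is `∑_{n ≤ x} |f(n) − E(x)|² ≤ c₁ x D(x)²` with an absolute
constant `c₁` (Elliott, Remark after Lemma (1.4), p. 25: "the standard Turán–Kubilius
inequality"; it is the case `σ = 0` of his Lemma (1.5),
`∑_{n≤x} n^{-σ}|f(n) − E(x)|² ≪ x^{1−σ}D(x)²`, and the case `ρ = 1` of Lemma (1.3)). It is the
first tool of probabilistic number theory (Turán 1934 for `ω(n)`, Kubilius 1956 in general) and
the entry point of the "Basic Inequality" of Elliott's Chapter 10 (proof of Theorem (10.1),
p. 209, via Lemma (1.5)), on which Elliott's Theorems (14.1)/(14.3) on shifted differences rest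
(`Literature/NumberTheory/LFunctions/ElliottShiftedDifferences{,Proofs}.lean`).

## Main result

* `TuranKubilius.turanKubilius` : for every real additive `f` and every `N`,
  `∑_{n ≤ N} (f(n) − E(N))² ≤ 69 · N · D(N)²`, the sums `E`, `D²` running over the prime powers
  `q ≤ N` written with `q.minFac` for the prime below `q` (fully proved; constant not optimized).

## Also in this file (appended): arbitrary coefficients and the dual inequalities (Ch. 5)

* `TuranKubilius.turanKubilius_coeff` — the inequality for ARBITRARY real coefficients `g(q)`
  on the prime powers (the additive function with values `g` there,
  `isAdditiveArith_sum_primeFactors`, is fed to `turanKubilius`);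
* `TuranKubilius.turanKubilius_prime` — the strongly additive form
  `∑_{n ≤ N} (∑_{p ∣ n} g(p) − ∑_{p ≤ N} g(p)/p)² ≤ 278 N ∑_{p ≤ N} g(p)²/p`;
* `TuranKubilius.turanKubilius_centred` — the textbook centring at `A(N) = ∑_{q ≤ N} f(q)/q`:
  `∑_{n ≤ N} (f(n) − A(N))² ≤ 140 N D(N)²`;
* `TuranKubilius.duality` — Elliott's duality principle, Lemma (5.1) (real case);
* `TuranKubilius.turanKubilius_dual`, `TuranKubilius.turanKubilius_dual_prime` — the two dual
  Turán–Kubilius inequalities of Lemma (5.2) with `σ = 0`: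
  `∑_{q ≤ N} q |∑_{q ∥ n} a_n − q⁻¹(1 − 1/p) ∑ a_n|² ≤ 69 N ∑ a_n²` and
  `∑_{p ≤ N} p |∑_{p ∣ n} a_n − p⁻¹ ∑ a_n|² ≤ 278 N ∑ a_n²` — the first "will play an important
  part in our treatment of the differences of additive functions in Chapter 8" (Elliott, p. 81).
  [Elliott1985, Ch. 5, Lemmas (5.1)–(5.2), pp. 81–82]

## Proof (Turán's method, as in Elliott's proof of Lemma (1.5), pp. 25–27)

Cut at `y = ⌊√N⌋`. With `w(n) = ∑_{q ≤ y, q ∥ n} f(q)` and `W = ∑_{q ≤ y} f(q) q⁻¹(1 − 1/p)`: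
(i) `∑_n (w(n) − W)² ≤ 6 N D²` by expanding the square — the exact-divisor counts are
`#{n ≤ N : p^k ∥ n} = N p^{-k}(1 − 1/p) + O(1)` (`card_exact_sub_le_one`) and, for two different
primes, `N p^{-a}(1−1/p) r^{-b}(1−1/r) + O(2)` by inclusion–exclusion
(`card_exact_pair_sub_le_two`), two powers of the same prime never both divide exactly, the
same-prime part of the main term is a sum of squares (`sum_sum_ite_key_nonneg`), and the error
terms are absorbed by Cauchy–Schwarz with the crude bounds `∑_{q ≤ y} q ≤ y²`,
`∑_{q≤y} 1/q ≤ y` (`variance_abstract` is the bookkeeping);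
(ii) an `n ≤ N` has at most one exact prime-power divisor `> y`, so `∑_n (f(n) − w(n))² ≤ N D²`;
(iii) `(E(N) − W)² ≤ D² ∑_{y < q ≤ N} 1/q ≤ 16 D²` by Mertens' second theorem in a window (tree:
`MertensBound.sum_inv_prime_le`, `MertensBound.loglog_sub_loglog_le_sum_inv_prime`) and
`∑ 1/(p(p−1)) ≤ 1` (`MertensBound.sum_inv_prime_mul_pred_le_one`). Two-sided error bounds are used
throughout, so Elliott's preliminary reduction to `f ≥ 0` is not needed.

## Also in this file (appended): the weights `n^{-σ}`, `0 ≤ σ < 1` (Lemmas (1.5), (5.2) in full)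

* `TuranKubilius.turanKubilius_weighted` — Lemma (1.5): for `0 ≤ σ < 1` there is `C(σ)` with
  `∑_{n ≤ N} n^{-σ} (f(n) − E(N))² ≤ C(σ) N^{1−σ} D(N)²` for all real additive `f` and all `N`;
  derived here from the case `σ = 0` by dyadic blocks (`partialVariance_le`,
  `sum_inv_primePow_window_le`, `sum_Ioc_dyadic`) rather than by rerunning Turán's method with
  the weights; the constant is explicit and visibly bounded on `0 ≤ σ ≤ 1 − δ`;
* `TuranKubilius.turanKubilius_weighted_coeff`, `TuranKubilius.turanKubilius_weighted_dual` —
  arbitrary coefficients, and the first inequality of Lemma (5.2) for `0 ≤ σ < 1`: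
  `∑_{q ≤ N} q |∑_{q ∥ n} a_n n^{-σ} − q⁻¹(1 − 1/p) ∑ a_n n^{-σ}|² ≤ C(σ) N^{1−σ} ∑ a_n² n^{-σ}`;
* `TuranKubilius.turanKubilius_weighted_prime`, `TuranKubilius.turanKubilius_weighted_dual_prime`
  — the strongly additive form with weights and the second inequality of Lemma (5.2) for
  `0 ≤ σ < 1` (`sum_rpow_neg_le`: `(1 − σ) ∑_{n ≤ N} n^{-σ} ≤ N^{1−σ}`).

## Not here

The weight `ρ(n)` of Lemma (1.3); complex-valued `f` / coefficients (apply the theorems to real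
and imaginary parts); the sharp constants.

## Sources

* P. D. T. A. Elliott, *Arithmetic Functions and Integer Products*, Springer 1985, Ch. 1,
  pp. 23–27, Lemmas (1.3)–(1.5). [Elliott1985]
* P. Turán, J. London Math. Soc. 9 (1934) 274–276; J. Kubilius, Uspekhi Mat. Nauk 11 (1956)
  (history; not cited in tags).
-/

open Finset

namespace Literature.NumberTheory.LFunctions.TuranKubilius

open Literature.NumberTheory.LFunctions.Elliott1985 (IsAdditiveArith)

/-! ### Additive functions along the factorization -/

/-- An additive `f` is the sum of its values on the exact prime-power divisors:
`f(n) = ∑_{p ∣ n} f(p^{v_p(n)})` for `n ≥ 1`. [folklore] -/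
theorem eq_sum_primeFactors {f : ℕ → ℝ} (hf : IsAdditiveArith f) :
    ∀ {n : ℕ}, n ≠ 0 → f n = ∑ p ∈ n.primeFactors, f (p ^ n.factorization p) := by
  intro n
  induction n using Nat.recOnPosPrimePosCoprime with
  | prime_pow p k hp hk =>
    intro _
    rw [Nat.primeFactors_prime_pow hk.ne' hp, Finset.sum_singleton, Nat.Prime.factorization_pow hp,
      Finsupp.single_eq_same]
  | zero => intro h; exact absurd rfl h
  | one => intro _; simp [hf.map_one]
  | coprime m k hm hk hmk ihm ihk =>
    intro _
    have hm0 : m ≠ 0 := by omega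
    have hk0 : k ≠ 0 := by omega
    rw [hf m k (by omega) (by omega) hmk, ihm hm0, ihk hk0, Nat.Coprime.primeFactors_mul hmk,
      Finset.sum_union hmk.disjoint_primeFactors]
    congr 1
    · refine Finset.sum_congr rfl fun p hp => ?_
      rw [Nat.factorization_mul hm0 hk0, Finsupp.add_apply,
        Nat.factorization_eq_zero_of_not_dvd (n := k) (fun h => ?_), add_zero]
      have hpm : p ∣ m := Nat.dvd_of_mem_primeFactors hp
      have hpp : p.Prime := Nat.prime_of_mem_primeFactors hp
      exact hpp.one_lt.ne' (Nat.eq_one_of_dvd_coprimes hmk hpm h)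
    · refine Finset.sum_congr rfl fun p hp => ?_
      rw [Nat.factorization_mul hm0 hk0, Finsupp.add_apply,
        Nat.factorization_eq_zero_of_not_dvd (n := m) (fun h => ?_), zero_add]
      have hpk : p ∣ k := Nat.dvd_of_mem_primeFactors hp
      have hpp : p.Prime := Nat.prime_of_mem_primeFactors hp
      exact hpp.one_lt.ne' (Nat.eq_one_of_dvd_coprimes hmk h hpk)

/-! ### Prime powers, exact division, counting -/

/-- For a prime `p` and `n ≠ 0`: `v_p(n) = k` iff `p^k ∣ n` and `p^{k+1} ∤ n`.
[folklore] -/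
theorem factorization_eq_iff_dvd_not_dvd {p k n : ℕ} (hp : p.Prime) (hn : n ≠ 0) :
    n.factorization p = k ↔ p ^ k ∣ n ∧ ¬ p ^ (k + 1) ∣ n := by
  rw [hp.pow_dvd_iff_le_factorization hn, hp.pow_dvd_iff_le_factorization hn]
  omega

/-- Decomposition data of a prime power: `q = q.minFac ^ (q.factorization q.minFac)` with
positive exponent and prime base. [folklore] -/
theorem primePow_spec {q : ℕ} (hq : IsPrimePow q) :
    q.minFac.Prime ∧ 0 < q.factorization q.minFac ∧
      q.minFac ^ q.factorization q.minFac = q := by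
  refine ⟨Nat.minFac_prime hq.ne_one, ?_, hq.minFac_pow_factorization_eq⟩
  exact Nat.Prime.factorization_pos_of_dvd (Nat.minFac_prime hq.ne_one) hq.ne_zero
    (Nat.minFac_dvd q)

/-- The exact prime-power divisors of `n ≤ N` among the prime powers `≤ N` are exactly the
`p^{v_p(n)}`, `p ∣ n`. [folklore] -/
theorem filter_exact_eq_image {N n : ℕ} (hn : n ≠ 0) (hnN : n ≤ N) :
    ((Finset.Ioc 0 N).filter IsPrimePow).filter
        (fun q => n.factorization q.minFac = q.factorization q.minFac)
      = n.primeFactors.image (fun p => p ^ n.factorization p) := by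
  ext q
  simp only [Finset.mem_filter, Finset.mem_Ioc, Finset.mem_image]
  constructor
  · rintro ⟨⟨⟨hq0, hqN⟩, hq⟩, hv⟩
    obtain ⟨hp, hk, hpk⟩ := primePow_spec hq
    refine ⟨q.minFac, ?_, ?_⟩
    · rw [Nat.mem_primeFactors]
      refine ⟨hp, ?_, hn⟩
      exact Nat.dvd_of_factorization_pos (by rw [hv]; exact hk.ne')
    · rw [hv]; exact hpk
  · rintro ⟨p, hp, rfl⟩
    have hpp : p.Prime := Nat.prime_of_mem_primeFactors hp
    have hv : 0 < n.factorization p :=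
      hpp.factorization_pos_of_dvd hn (Nat.dvd_of_mem_primeFactors hp)
    have hmin : (p ^ n.factorization p).minFac = p := hpp.pow_minFac hv.ne'
    refine ⟨⟨⟨Nat.pos_of_ne_zero (pow_ne_zero _ hpp.ne_zero), ?_⟩, ?_⟩, ?_⟩
    · exact le_trans (Nat.ordProj_le p hn) hnN
    · exact ⟨p, n.factorization p, hpp.prime, hv, rfl⟩
    · rw [hmin, hpp.factorization_pow, Finsupp.single_eq_same]

/-- `p ↦ p^{v_p(n)}` is injective on the prime factors of `n`. [folklore] -/
theorem injOn_ordProj (n : ℕ) :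
    Set.InjOn (fun p => p ^ n.factorization p) (n.primeFactors : Set ℕ) := by
  intro p hp r hr h
  have hpp : p.Prime := Nat.prime_of_mem_primeFactors hp
  have hrr : r.Prime := Nat.prime_of_mem_primeFactors hr
  have hn : n ≠ 0 := (Nat.mem_primeFactors.mp hp).2.2
  have hvp : 0 < n.factorization p :=
    hpp.factorization_pos_of_dvd hn (Nat.dvd_of_mem_primeFactors hp)
  have hvr : 0 < n.factorization r :=
    hrr.factorization_pos_of_dvd hn (Nat.dvd_of_mem_primeFactors hr)
  have h1 : (p ^ n.factorization p).minFac = p := hpp.pow_minFac hvp.ne'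
  have h2 : (r ^ n.factorization r).minFac = r := hrr.pow_minFac hvr.ne'
  simp only at h
  rw [← h1, ← h2, h]

/-- Additive decomposition in indicator form: for `1 ≤ n ≤ N`,
`f(n) = ∑_{q ≤ N prime power, q ∥ n} f(q)`. [folklore] -/
theorem eq_sum_filter_exact {f : ℕ → ℝ} (hf : IsAdditiveArith f) {N n : ℕ} (hn : n ≠ 0)
    (hnN : n ≤ N) :
    f n = ∑ q ∈ ((Finset.Ioc 0 N).filter IsPrimePow).filter
        (fun q => n.factorization q.minFac = q.factorization q.minFac), f q := by
  rw [filter_exact_eq_image hn hnN, Finset.sum_image (injOn_ordProj n), eq_sum_primeFactors hf hn]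

/-- Floor division versus real division: `m/d − 1 < ⌊m/d⌋ ≤ m/d`. [folklore] -/
theorem natDiv_bounds (m : ℕ) {d : ℕ} (hd : 0 < d) :
    (m : ℝ) / d - 1 < ((m / d : ℕ) : ℝ) ∧ ((m / d : ℕ) : ℝ) ≤ (m : ℝ) / d := by
  refine ⟨?_, Nat.cast_div_le⟩
  have h := Nat.lt_div_mul_add hd (a := m)
  have hdR : (0 : ℝ) < d := by exact_mod_cast hd
  rw [div_sub_one hdR.ne', div_lt_iff₀ hdR]
  have : (m : ℝ) < ((m / d : ℕ) : ℝ) * d + d := by exact_mod_cast h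
  linarith

/-- Multiples of `d` in `(0, N]` versus `N/d`: `N/d − 1 < #{n ≤ N : d ∣ n} ≤ N/d`. [folklore] -/
theorem card_multiples_bounds (N : ℕ) {d : ℕ} (hd : 0 < d) :
    (N : ℝ) / d - 1 < (((Finset.Ioc 0 N).filter (d ∣ ·)).card : ℝ) ∧
      (((Finset.Ioc 0 N).filter (d ∣ ·)).card : ℝ) ≤ (N : ℝ) / d := by
  rw [Nat.Ioc_filter_dvd_card_eq_div]
  exact natDiv_bounds N hd

/-- **Exact prime-power divisors, one prime.** For a prime `p` and `k`:
`|#{n ≤ N : v_p(n) = k} − (N/p^k)(1 − 1/p)| ≤ 1`. [folklore] -/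
theorem card_exact_sub_le_one (N : ℕ) {p : ℕ} (hp : p.Prime) (k : ℕ) :
    |(((Finset.Ioc 0 N).filter (fun n => n.factorization p = k)).card : ℝ)
        - N * ((1 : ℝ) / p ^ k * (1 - 1 / p))| ≤ 1 := by
  classical
  set A := (Finset.Ioc 0 N).filter (fun n => p ^ k ∣ n) with hA
  set B := (Finset.Ioc 0 N).filter (fun n => p ^ (k + 1) ∣ n) with hB
  have hBA : B ⊆ A := by
    intro n hn
    simp only [hA, hB, Finset.mem_filter] at hn ⊢
    exact ⟨hn.1, (pow_dvd_pow p (Nat.le_succ k)).trans hn.2⟩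
  have hset : (Finset.Ioc 0 N).filter (fun n => n.factorization p = k) = A \ B := by
    ext n
    simp only [hA, hB, Finset.mem_sdiff, Finset.mem_filter, Finset.mem_Ioc]
    constructor
    · rintro ⟨hn, hv⟩
      have hn0 : n ≠ 0 := by omega
      have := (factorization_eq_iff_dvd_not_dvd hp hn0).mp hv
      exact ⟨⟨hn, this.1⟩, fun h => this.2 h.2⟩
    · rintro ⟨⟨hn, h1⟩, h2⟩
      have hn0 : n ≠ 0 := by omega
      exact ⟨hn, (factorization_eq_iff_dvd_not_dvd hp hn0).mpr ⟨h1, fun h => h2 ⟨hn, h⟩⟩⟩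
  rw [hset, Finset.card_sdiff_of_subset hBA, Nat.cast_sub (Finset.card_le_card hBA)]
  have hpk : 0 < p ^ k := pow_pos hp.pos k
  have hpk1 : 0 < p ^ (k + 1) := pow_pos hp.pos (k + 1)
  obtain ⟨hA1, hA2⟩ := card_multiples_bounds N hpk
  obtain ⟨hB1, hB2⟩ := card_multiples_bounds N hpk1
  have hpR : (0 : ℝ) < p := by exact_mod_cast hp.pos
  have hmain : (N : ℝ) * ((1 : ℝ) / p ^ k * (1 - 1 / p))
      = (N : ℝ) / (p ^ k : ℕ) - (N : ℝ) / (p ^ (k + 1) : ℕ) := by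
    push_cast
    field_simp
    ring
  rw [hmain, abs_le]
  constructor <;> linarith

/-- **Exact prime-power divisors, two primes.** For distinct primes `p ≠ r` and exponents `a, b`:
`|#{n ≤ N : v_p(n) = a, v_r(n) = b} − N (1/p^a)(1 − 1/p)(1/r^b)(1 − 1/r)| ≤ 2`
(inclusion–exclusion over the multiples of `p^a r^b`, `p^{a+1} r^b`, `p^a r^{b+1}`,
`p^{a+1} r^{b+1}`). [folklore] -/
theorem card_exact_pair_sub_le_two (N : ℕ) {p r : ℕ} (hp : p.Prime) (hr : r.Prime) (hpr : p ≠ r)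
    (a b : ℕ) :
    |(((Finset.Ioc 0 N).filter
          (fun n => n.factorization p = a ∧ n.factorization r = b)).card : ℝ)
        - N * ((1 : ℝ) / p ^ a * (1 - 1 / p)) * ((1 : ℝ) / r ^ b * (1 - 1 / r))| ≤ 2 := by
  classical
  have hcop : Nat.Coprime p r := (Nat.coprime_primes hp hr).mpr hpr
  -- the four divisor sets
  set D : ℕ → Finset ℕ := fun d => (Finset.Ioc 0 N).filter (d ∣ ·) with hD
  have hDmem : ∀ d n, n ∈ D d ↔ (0 < n ∧ n ≤ N) ∧ d ∣ n := fun d n => by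
    simp [hD, Finset.mem_filter, Finset.mem_Ioc]
  set d₀ := p ^ a * r ^ b with hd₀
  set d₁ := p ^ (a + 1) * r ^ b with hd₁
  set d₂ := p ^ a * r ^ (b + 1) with hd₂
  set d₃ := p ^ (a + 1) * r ^ (b + 1) with hd₃
  -- coprime products divide iff both factors divide
  have hmul : ∀ (i j n : ℕ), p ^ i * r ^ j ∣ n ↔ p ^ i ∣ n ∧ r ^ j ∣ n := by
    intro i j n
    constructor
    · intro h
      exact ⟨(Dvd.intro _ rfl).trans h, (Dvd.intro_left _ rfl).trans h⟩
    · rintro ⟨h1, h2⟩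
      exact Nat.Coprime.mul_dvd_of_dvd_of_dvd (Nat.Coprime.pow _ _ hcop) h1 h2
  have hset : (Finset.Ioc 0 N).filter (fun n => n.factorization p = a ∧ n.factorization r = b)
      = D d₀ \ (D d₁ ∪ D d₂) := by
    ext n
    simp only [Finset.mem_sdiff, Finset.mem_union, Finset.mem_filter, Finset.mem_Ioc, hDmem,
      hd₀, hd₁, hd₂, hmul]
    constructor
    · rintro ⟨hn, hvp, hvr⟩
      have hn0 : n ≠ 0 := by omega
      have h1 := (factorization_eq_iff_dvd_not_dvd hp hn0).mp hvp
      have h2 := (factorization_eq_iff_dvd_not_dvd hr hn0).mp hvr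
      refine ⟨⟨hn, h1.1, h2.1⟩, ?_⟩
      rintro (⟨-, h3, -⟩ | ⟨-, -, h4⟩)
      · exact h1.2 h3
      · exact h2.2 h4
    · rintro ⟨⟨hn, h1, h2⟩, h3⟩
      have hn0 : n ≠ 0 := by omega
      refine ⟨hn, (factorization_eq_iff_dvd_not_dvd hp hn0).mpr ⟨h1, fun h => ?_⟩,
        (factorization_eq_iff_dvd_not_dvd hr hn0).mpr ⟨h2, fun h => ?_⟩⟩
      · exact h3 (Or.inl ⟨hn, h, h2⟩)
      · exact h3 (Or.inr ⟨hn, h1, h⟩)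
  have hsub1 : D d₁ ∪ D d₂ ⊆ D d₀ := by
    intro n hn
    simp only [Finset.mem_union, hDmem, hd₀, hd₁, hd₂, hmul] at hn ⊢
    rcases hn with ⟨hn, h1, h2⟩ | ⟨hn, h1, h2⟩
    · exact ⟨hn, (pow_dvd_pow p (Nat.le_succ a)).trans h1, h2⟩
    · exact ⟨hn, h1, (pow_dvd_pow r (Nat.le_succ b)).trans h2⟩
  have hinter : D d₁ ∩ D d₂ = D d₃ := by
    ext n
    simp only [Finset.mem_inter, hDmem, hd₁, hd₂, hd₃, hmul]
    constructor
    · rintro ⟨⟨hn, h1, -⟩, ⟨-, -, h4⟩⟩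
      exact ⟨hn, h1, h4⟩
    · rintro ⟨hn, h1, h2⟩
      exact ⟨⟨hn, h1, (pow_dvd_pow r (Nat.le_succ b)).trans h2⟩,
        ⟨hn, (pow_dvd_pow p (Nat.le_succ a)).trans h1, h2⟩⟩
  have hcard : ((D d₀ \ (D d₁ ∪ D d₂)).card : ℝ)
      = (D d₀).card - (D d₁).card - (D d₂).card + (D d₃).card := by
    have h1 := Finset.card_sdiff_of_subset hsub1
    have h2 := Finset.card_union_add_card_inter (D d₁) (D d₂)
    rw [hinter] at h2
    have h3 := Finset.card_le_card hsub1
    have h4 : (D d₃).card ≤ (D d₁).card := by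
      rw [← hinter]; exact Finset.card_le_card Finset.inter_subset_left
    rw [h1, Nat.cast_sub h3]
    have : ((D d₁ ∪ D d₂).card : ℝ) = (D d₁).card + (D d₂).card - (D d₃).card := by
      have := congrArg (fun x : ℕ => (x : ℝ)) h2
      push_cast at this
      linarith
    rw [this]; ring
  rw [hset, hcard]
  have hp0 : 0 < p := hp.pos
  have hr0 : 0 < r := hr.pos
  obtain ⟨hA1, hA2⟩ := card_multiples_bounds N (show 0 < d₀ by positivity)
  obtain ⟨hB1, hB2⟩ := card_multiples_bounds N (show 0 < d₁ by positivity)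
  obtain ⟨hC1, hC2⟩ := card_multiples_bounds N (show 0 < d₂ by positivity)
  obtain ⟨hE1, hE2⟩ := card_multiples_bounds N (show 0 < d₃ by positivity)
  have hpR : (0 : ℝ) < p := by exact_mod_cast hp0
  have hrR : (0 : ℝ) < r := by exact_mod_cast hr0
  have hmain : (N : ℝ) * ((1 : ℝ) / p ^ a * (1 - 1 / p)) * ((1 : ℝ) / r ^ b * (1 - 1 / r))
      = (N : ℝ) / (d₀ : ℕ) - (N : ℝ) / (d₁ : ℕ) - (N : ℝ) / (d₂ : ℕ) + (N : ℝ) / (d₃ : ℕ) := by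
    simp only [hd₀, hd₁, hd₂, hd₃]
    push_cast
    field_simp
    ring
  rw [hmain, abs_le]
  constructor <;> linarith

/-! ### Reciprocal sums of prime powers (Chebyshev–Mertens input) -/

/-- The proper prime powers have bounded reciprocal sum:
`∑_{q ≤ N, q = p^k, k ≥ 2} 1/q ≤ ∑_{p ≤ N} 1/(p(p−1)) ≤ 1`. [folklore] -/
theorem sum_inv_properPrimePow_le_one (N : ℕ) :
    ∑ q ∈ ((Finset.Ioc 0 N).filter IsPrimePow).filter (fun q => ¬ q.Prime), (1 : ℝ) / q ≤ 1 := by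
  classical
  set T := ((Finset.Ioc 0 N).filter IsPrimePow).filter (fun q => ¬ q.Prime) with hT
  set φ : ℕ → ℕ × ℕ := fun q => (q.minFac, q.factorization q.minFac) with hφ
  set g : ℕ × ℕ → ℝ := fun x => ((1 : ℝ) / x.1) ^ x.2 with hg
  have hTmem : ∀ q ∈ T, IsPrimePow q ∧ ¬ q.Prime ∧ 0 < q ∧ q ≤ N := by
    intro q hq
    simp only [hT, Finset.mem_filter, Finset.mem_Ioc] at hq
    exact ⟨hq.1.2, hq.2, hq.1.1.1, hq.1.1.2⟩
  have hinj : Set.InjOn φ (T : Set ℕ) := by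
    intro q hq q' hq' h
    obtain ⟨-, -, e⟩ := primePow_spec (hTmem q hq).1
    obtain ⟨-, -, e'⟩ := primePow_spec (hTmem q' hq').1
    simp only [hφ, Prod.mk.injEq] at h
    obtain ⟨h1, h2⟩ := h
    rw [← e, ← e', h2, h1]
  have himage : T.image φ ⊆ Nat.primesLE N ×ˢ Finset.Icc 2 N := by
    intro x hx
    rw [Finset.mem_image] at hx
    obtain ⟨q, hq, rfl⟩ := hx
    obtain ⟨hpp, hnp, hq0, hqN⟩ := hTmem q hq
    obtain ⟨hp, hk, e⟩ := primePow_spec hpp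
    simp only [hφ, Finset.mem_product, Nat.mem_primesLE, Finset.mem_Icc]
    refine ⟨⟨(Nat.minFac_le hq0).trans hqN, hp⟩, ?_, ?_⟩
    · by_contra h
      have hk1 : q.factorization q.minFac = 1 := by omega
      rw [hk1, pow_one] at e
      exact hnp (e ▸ hp)
    · calc q.factorization q.minFac ≤ 2 ^ q.factorization q.minFac :=
            (Nat.lt_two_pow_self).le
        _ ≤ q.minFac ^ q.factorization q.minFac :=
            Nat.pow_le_pow_left hp.two_le _
        _ = q := e
        _ ≤ N := hqN
  have hsum : ∑ q ∈ T, (1 : ℝ) / q = ∑ q ∈ T, g (φ q) := by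
    refine Finset.sum_congr rfl fun q hq => ?_
    obtain ⟨-, -, e⟩ := primePow_spec (hTmem q hq).1
    simp only [hg, hφ]
    conv_lhs => rw [← e]
    push_cast
    rw [one_div_pow]
  have hg0 : ∀ x ∈ Nat.primesLE N ×ˢ Finset.Icc 2 N, 0 ≤ g x := fun x _ => by
    simp only [hg]; positivity
  calc ∑ q ∈ T, (1 : ℝ) / q = ∑ q ∈ T, g (φ q) := hsum
    _ = ∑ x ∈ T.image φ, g x := (Finset.sum_image hinj).symm
    _ ≤ ∑ x ∈ Nat.primesLE N ×ˢ Finset.Icc 2 N, g x :=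
        Finset.sum_le_sum_of_subset_of_nonneg himage fun x hx _ => hg0 x hx
    _ = ∑ p ∈ Nat.primesLE N, ∑ k ∈ Finset.Icc 2 N, ((1 : ℝ) / p) ^ k := by
        rw [Finset.sum_product]
    _ ≤ ∑ p ∈ Nat.primesLE N, (1 : ℝ) / (p * (p - 1)) := by
        refine Finset.sum_le_sum fun p hp => ?_
        have hp2 : (2 : ℝ) ≤ p := by exact_mod_cast Nat.two_le_of_mem_primesLE hp
        have h0 : (0 : ℝ) ≤ 1 / p := by positivity
        have h1 : (1 : ℝ) / p < 1 := by rw [div_lt_one (by linarith)]; linarith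
        calc ∑ k ∈ Finset.Icc 2 N, ((1 : ℝ) / p) ^ k
            = ∑ k ∈ Finset.Ico 2 (N + 1), ((1 : ℝ) / p) ^ k := by rfl
          _ ≤ ((1 : ℝ) / p) ^ 2 / (1 - 1 / p) := geom_sum_Ico_le_of_lt_one h0 h1
          _ = 1 / (p * (p - 1)) := by
              field_simp
    _ ≤ 1 := Literature.NumberTheory.LFunctions.MertensBound.sum_inv_prime_mul_pred_le_one N

/-- **The prime powers in `(√N, N]` have bounded reciprocal sum**:
`∑_{√N < q ≤ N, q prime power} 1/q ≤ 16` (Mertens' second theorem in a window, from the tree's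
`MertensBound.sum_inv_prime_le` and `MertensBound.loglog_sub_loglog_le_sum_inv_prime`, plus
`sum_inv_properPrimePow_le_one`). [folklore] -/
theorem sum_inv_primePow_large_le (N : ℕ) :
    ∑ q ∈ ((Finset.Ioc 0 N).filter IsPrimePow).filter (fun q => Nat.sqrt N < q), (1 : ℝ) / q
      ≤ 16 := by
  classical
  set S := ((Finset.Ioc 0 N).filter IsPrimePow).filter (fun q => Nat.sqrt N < q) with hS
  by_cases hN : N < 4
  · calc ∑ q ∈ S, (1 : ℝ) / q ≤ ∑ q ∈ S, (1 : ℝ) := by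
          refine Finset.sum_le_sum fun q hq => ?_
          simp only [hS, Finset.mem_filter, Finset.mem_Ioc] at hq
          have : (1 : ℝ) ≤ q := by exact_mod_cast hq.1.1.1
          exact (div_le_one (by linarith)).mpr this
      _ = S.card := by simp
      _ ≤ (Finset.Ioc 0 N).card := by
          exact_mod_cast Finset.card_le_card
            ((Finset.filter_subset _ _).trans (Finset.filter_subset _ _))
      _ ≤ 16 := by simp; omega
  push Not at hN
  set y := Nat.sqrt N with hy
  have hy2 : 2 ≤ y := by rw [hy, Nat.le_sqrt]; omega
  have hyR : (2 : ℝ) ≤ y := by exact_mod_cast hy2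
  have hN2 : 2 ≤ N := by omega
  -- split `S` into primes and proper prime powers
  rw [← Finset.sum_filter_add_sum_filter_not S Nat.Prime]
  have hB : ∑ q ∈ S.filter (fun q => ¬ q.Prime), (1 : ℝ) / q ≤ 1 := by
    refine le_trans (Finset.sum_le_sum_of_subset_of_nonneg ?_ fun q _ _ => by positivity)
      (sum_inv_properPrimePow_le_one N)
    intro q hq
    simp only [hS, Finset.mem_filter] at hq ⊢
    exact ⟨hq.1.1, hq.2⟩
  -- the primes of `S` are the primes in `(y, N]`
  have hA : ∑ q ∈ S.filter Nat.Prime, (1 : ℝ) / q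
      ≤ ∑ p ∈ Nat.primesLE N, (1 : ℝ) / p - ∑ p ∈ Nat.primesLE y, (1 : ℝ) / p := by
    have hsplit : Nat.primesLE N = Nat.primesLE y ∪ S.filter Nat.Prime := by
      ext p
      simp only [Finset.mem_union, Nat.mem_primesLE, hS, Finset.mem_filter, Finset.mem_Ioc]
      constructor
      · rintro ⟨hpN, hp⟩
        by_cases h : p ≤ y
        · exact Or.inl ⟨h, hp⟩
        · exact Or.inr ⟨⟨⟨⟨hp.pos, hpN⟩, hp.isPrimePow⟩, by omega⟩, hp⟩
      · rintro (⟨hpy, hp⟩ | ⟨⟨⟨⟨-, hpN⟩, -⟩, -⟩, hp⟩)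
        · exact ⟨hpy.trans (Nat.sqrt_le_self N), hp⟩
        · exact ⟨hpN, hp⟩
    have hdisj : Disjoint (Nat.primesLE y) (S.filter Nat.Prime) := by
      rw [Finset.disjoint_left]
      intro p hp hp'
      simp only [Nat.mem_primesLE] at hp
      simp only [hS, Finset.mem_filter] at hp'
      omega
    rw [hsplit, Finset.sum_union hdisj]
    linarith
  have hupper := Literature.NumberTheory.LFunctions.MertensBound.sum_inv_prime_le N hN2
  have hlower' :=
    Literature.NumberTheory.LFunctions.MertensBound.loglog_sub_loglog_le_sum_inv_prime
      (P := 2) (Q := (y : ℝ)) le_rfl hyR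
  have hlower : Real.log (Real.log y) - Real.log (Real.log 2) - 6 / Real.log 2
      ≤ ∑ p ∈ Nat.primesLE y, (1 : ℝ) / p := by
    refine hlower'.trans (Finset.sum_le_sum_of_subset_of_nonneg ?_ fun p _ _ => by positivity)
    intro p hp
    simp only [Finset.mem_filter, Finset.mem_Ioc, Nat.floor_natCast] at hp
    exact Nat.mem_primesLE.mpr ⟨hp.1.2, hp.2⟩
  -- `log log N ≤ log 4 + log log y` since `N < (y+1)² ≤ y⁴`
  have hylog : 0 < Real.log y := Real.log_pos (by linarith)
  have hNy4 : (N : ℝ) ≤ (y : ℝ) ^ 4 := by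
    have h1 : N < (y + 1) ^ 2 := hy ▸ Nat.lt_succ_sqrt' N
    have h2 : (y + 1) ^ 2 ≤ y ^ 4 := by
      have : y + 1 ≤ y ^ 2 := by nlinarith
      calc (y + 1) ^ 2 ≤ (y ^ 2) ^ 2 := Nat.pow_le_pow_left this 2
        _ = y ^ 4 := by ring
    exact_mod_cast (h1.le.trans h2)
  have hloglog : Real.log (Real.log N) ≤ Real.log 4 + Real.log (Real.log y) := by
    have hN0 : (0 : ℝ) < N := by exact_mod_cast (show 0 < N by omega)
    have h1 : Real.log N ≤ 4 * Real.log y := by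
      have := Real.log_le_log hN0 hNy4
      rwa [Real.log_pow, Nat.cast_ofNat] at this
    have hlogN : 0 < Real.log N := Real.log_pos (by exact_mod_cast (show 1 < N by omega))
    calc Real.log (Real.log N) ≤ Real.log (4 * Real.log y) := Real.log_le_log hlogN h1
      _ = Real.log 4 + Real.log (Real.log y) := Real.log_mul (by norm_num) hylog.ne'
  -- numerics
  have hlog2 : 0.6931471803 < Real.log 2 := Real.log_two_gt_d9
  have hlog2' : Real.log 2 < 0.6931471808 := Real.log_two_lt_d9
  have hlog4 : Real.log 4 = 2 * Real.log 2 := by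
    rw [show (4 : ℝ) = 2 ^ 2 by norm_num, Real.log_pow]; norm_num
  have hloglog2 : Real.log (Real.log 2) ≤ 0 := Real.log_nonpos (by linarith) (by linarith)
  have h6 : 6 / Real.log 2 < 8.7 := by rw [div_lt_iff₀ (by linarith)]; linarith
  linarith

/-! ### The variance computation (Turán's expansion), abstract form -/

/-- Fiberwise squares: `∑_{i,j : key i = key j} g_i g_j = ∑_k (∑_{key i = k} g_i)² ≥ 0`.
[folklore] -/
theorem sum_sum_ite_key_nonneg {ι κ : Type*} [DecidableEq κ] (P : Finset ι)
    (key : ι → κ) (g : ι → ℝ) :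
    0 ≤ ∑ i ∈ P, ∑ j ∈ P, (if key i = key j then g i * g j else 0) := by
  classical
  set G : κ → ℝ := fun k => ∑ j ∈ P with key j = k, g j with hG
  have h1 : ∀ i ∈ P, ∑ j ∈ P, (if key i = key j then g i * g j else 0) = g i * G (key i) := by
    intro i _
    rw [← Finset.sum_filter, hG, Finset.mul_sum]
    refine Finset.sum_congr ?_ fun _ _ => rfl
    ext j
    simp only [Finset.mem_filter, eq_comm]
  rw [Finset.sum_congr rfl h1,
    ← Finset.sum_fiberwise_of_maps_to (fun i hi => Finset.mem_image_of_mem key hi)]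
  refine Finset.sum_nonneg fun k _ => ?_
  have h2 : ∑ i ∈ P with key i = k, g i * G (key i) = (∑ i ∈ P with key i = k, g i) * G k := by
    rw [Finset.sum_mul]
    refine Finset.sum_congr rfl fun i hi => ?_
    rw [(Finset.mem_filter.mp hi).2]
  rw [h2]
  exact mul_self_nonneg _

/-- **Turán's variance expansion, abstract form.** Let `a, μ : ι → ℝ`, a "key"
map (the underlying prime), counts `c i` with `|c i − N μ i| ≤ 1`, and pair counts `c₂ i j` with
`c₂ i i = c i`, `c₂ i j = 0` for distinct `i, j` of the same key and `|c₂ i j − N μ i μ j| ≤ 2`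
for different keys. Then, with `W = ∑ a μ`,
`∑_{i,j} a_i a_j c₂(i,j) − 2W ∑ a_i c_i + N W² ≤ N ∑ a²μ + ∑ a² + 2(∑|a|)² + 2|W| ∑|a|`.
[cite: Elliott1985, Ch. 1, proof of Lemma (1.5)] -/
theorem variance_abstract {ι κ : Type*} [DecidableEq ι] [DecidableEq κ] (P : Finset ι)
    (a μ c : ι → ℝ) (c₂ : ι → ι → ℝ) (key : ι → κ) {Nr : ℝ} (hNr : 0 ≤ Nr)
    (h1 : ∀ i ∈ P, |c i - Nr * μ i| ≤ 1)
    (h2 : ∀ i ∈ P, ∀ j ∈ P, key i ≠ key j → |c₂ i j - Nr * μ i * μ j| ≤ 2)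
    (h3 : ∀ i ∈ P, ∀ j ∈ P, key i = key j → i ≠ j → c₂ i j = 0)
    (h4 : ∀ i ∈ P, c₂ i i = c i) :
    ∑ i ∈ P, ∑ j ∈ P, a i * a j * c₂ i j
        - 2 * (∑ i ∈ P, a i * μ i) * (∑ i ∈ P, a i * c i) + Nr * (∑ i ∈ P, a i * μ i) ^ 2
      ≤ Nr * ∑ i ∈ P, a i ^ 2 * μ i + ∑ i ∈ P, a i ^ 2 + 2 * (∑ i ∈ P, |a i|) ^ 2
        + 2 * |∑ i ∈ P, a i * μ i| * ∑ i ∈ P, |a i| := by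
  set W := ∑ i ∈ P, a i * μ i with hW
  -- termwise majorant of `a_i a_j c₂(i,j)`
  set T : ι → ι → ℝ := fun i j =>
    (if i = j then Nr * a i ^ 2 * μ i + a i ^ 2 else 0) + Nr * (a i * μ i) * (a j * μ j)
      - (if key i = key j then Nr * (a i * μ i) * (a j * μ j) else 0) + 2 * |a i| * |a j| with hT
  have hkey : ∀ i ∈ P, ∀ j ∈ P, a i * a j * c₂ i j ≤ T i j := by
    intro i hi j hj
    simp only [hT]
    by_cases hij : i = j
    · subst hij
      simp only [if_true]
      have hc : c i ≤ Nr * μ i + 1 := by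
        have := (abs_le.mp (h1 i hi)).2; linarith
      rw [h4 i hi]
      have ha2 : 0 ≤ a i ^ 2 := sq_nonneg _
      have hab : 0 ≤ 2 * |a i| * |a i| := by positivity
      nlinarith
    · rw [if_neg hij]
      by_cases hk : key i = key j
      · rw [if_pos hk, h3 i hi j hj hk hij]
        have : 0 ≤ 2 * |a i| * |a j| := by positivity
        linarith
      · rw [if_neg hk]
        have hb := abs_le.mp (h2 i hi j hj hk)
        have e : a i * a j * c₂ i j
            = Nr * (a i * μ i) * (a j * μ j) + (a i * a j) * (c₂ i j - Nr * μ i * μ j) := by ring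
        rw [e]
        have : (a i * a j) * (c₂ i j - Nr * μ i * μ j) ≤ |a i * a j| * 2 := by
          calc (a i * a j) * (c₂ i j - Nr * μ i * μ j)
              ≤ |(a i * a j) * (c₂ i j - Nr * μ i * μ j)| := le_abs_self _
            _ = |a i * a j| * |c₂ i j - Nr * μ i * μ j| := abs_mul _ _
            _ ≤ |a i * a j| * 2 :=
                mul_le_mul_of_nonneg_left (abs_le.mpr hb) (abs_nonneg _)
        rw [abs_mul] at this
        linarith
  have hsumT : ∑ i ∈ P, ∑ j ∈ P, T i j
      = ∑ i ∈ P, (Nr * a i ^ 2 * μ i + a i ^ 2) + Nr * W ^ 2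
        - Nr * ∑ i ∈ P, ∑ j ∈ P,
            (if key i = key j then (a i * μ i) * (a j * μ j) else 0)
        + 2 * (∑ i ∈ P, |a i|) ^ 2 := by
    simp only [hT, Finset.sum_add_distrib, Finset.sum_sub_distrib]
    have e1 : ∑ i ∈ P, ∑ j ∈ P, (if i = j then Nr * a i ^ 2 * μ i + a i ^ 2 else 0)
        = ∑ i ∈ P, (Nr * a i ^ 2 * μ i + a i ^ 2) := by
      refine Finset.sum_congr rfl fun i hi => ?_
      rw [Finset.sum_ite_eq, if_pos hi]
    have e2 : ∑ i ∈ P, ∑ j ∈ P, Nr * (a i * μ i) * (a j * μ j) = Nr * W ^ 2 := by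
      rw [hW, sq, Finset.sum_mul_sum, Finset.mul_sum]
      refine Finset.sum_congr rfl fun i _ => ?_
      rw [Finset.mul_sum]
      refine Finset.sum_congr rfl fun j _ => ?_
      ring
    have e3 : ∑ i ∈ P, ∑ j ∈ P,
        (if key i = key j then Nr * (a i * μ i) * (a j * μ j) else 0)
        = Nr * ∑ i ∈ P, ∑ j ∈ P,
            (if key i = key j then (a i * μ i) * (a j * μ j) else 0) := by
      rw [Finset.mul_sum]
      refine Finset.sum_congr rfl fun i _ => ?_
      rw [Finset.mul_sum]
      refine Finset.sum_congr rfl fun j _ => ?_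
      split_ifs <;> ring
    have e4 : ∑ i ∈ P, ∑ j ∈ P, 2 * |a i| * |a j| = 2 * (∑ i ∈ P, |a i|) ^ 2 := by
      rw [sq, Finset.sum_mul_sum, Finset.mul_sum]
      refine Finset.sum_congr rfl fun i _ => ?_
      rw [Finset.mul_sum]
      refine Finset.sum_congr rfl fun j _ => ?_
      ring
    rw [e1, e2, e3, e4, Finset.sum_add_distrib]
  have hSS := sum_sum_ite_key_nonneg P key (fun i => a i * μ i)
  have hquad : ∑ i ∈ P, ∑ j ∈ P, a i * a j * c₂ i j
      ≤ ∑ i ∈ P, (Nr * a i ^ 2 * μ i + a i ^ 2) + Nr * W ^ 2 + 2 * (∑ i ∈ P, |a i|) ^ 2 := by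
    calc ∑ i ∈ P, ∑ j ∈ P, a i * a j * c₂ i j ≤ ∑ i ∈ P, ∑ j ∈ P, T i j :=
          Finset.sum_le_sum fun i hi => Finset.sum_le_sum fun j hj => hkey i hi j hj
      _ = _ := hsumT
      _ ≤ _ := by nlinarith [mul_nonneg hNr hSS]
  have hlin : |∑ i ∈ P, a i * c i - Nr * W| ≤ ∑ i ∈ P, |a i| := by
    have e : ∑ i ∈ P, a i * c i - Nr * W = ∑ i ∈ P, a i * (c i - Nr * μ i) := by
      rw [hW, Finset.mul_sum, ← Finset.sum_sub_distrib]
      refine Finset.sum_congr rfl fun i _ => ?_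
      ring
    rw [e]
    refine (Finset.abs_sum_le_sum_abs _ _).trans (Finset.sum_le_sum fun i hi => ?_)
    rw [abs_mul]
    calc |a i| * |c i - Nr * μ i| ≤ |a i| * 1 :=
          mul_le_mul_of_nonneg_left (h1 i hi) (abs_nonneg _)
      _ = |a i| := mul_one _
  have hsplit : ∑ i ∈ P, (Nr * a i ^ 2 * μ i + a i ^ 2)
      = Nr * ∑ i ∈ P, a i ^ 2 * μ i + ∑ i ∈ P, a i ^ 2 := by
    rw [Finset.sum_add_distrib, Finset.mul_sum]
    refine congrArg₂ (· + ·) (Finset.sum_congr rfl fun i _ => by ring) rfl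
  -- `-2W ∑ a c ≤ -2 N W² + 2|W| ∑|a|`
  have hcross : -(2 * W * ∑ i ∈ P, a i * c i) ≤ -(2 * Nr * W ^ 2) + 2 * |W| * ∑ i ∈ P, |a i| := by
    have e : -(2 * W * ∑ i ∈ P, a i * c i)
        = -(2 * Nr * W ^ 2) + (-(2 * W)) * (∑ i ∈ P, a i * c i - Nr * W) := by ring
    rw [e]
    have : (-(2 * W)) * (∑ i ∈ P, a i * c i - Nr * W) ≤ 2 * |W| * ∑ i ∈ P, |a i| := by
      calc (-(2 * W)) * (∑ i ∈ P, a i * c i - Nr * W)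
          ≤ |(-(2 * W)) * (∑ i ∈ P, a i * c i - Nr * W)| := le_abs_self _
        _ = 2 * |W| * |∑ i ∈ P, a i * c i - Nr * W| := by
            rw [abs_mul, abs_neg, abs_mul, abs_two]
        _ ≤ 2 * |W| * ∑ i ∈ P, |a i| :=
            mul_le_mul_of_nonneg_left hlin (by positivity)
    linarith
  rw [hsplit] at hquad
  linarith

/-! ### The Turán–Kubilius inequality -/

-- the proof is one long computation sharing a large set-up; raise the heartbeat budget for it
set_option maxHeartbeats 1000000 in
/-- **The Turán–Kubilius inequality** (Turán 1934, Kubilius 1956; Elliott 1985, Ch. 1,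
Lemma (1.5) with `σ = 0`, and the Remark after Lemma (1.4), p. 25: "the standard Turán–Kubilius
inequality `∑_{n ≤ x} |f(n) − E(x)|² ≤ c₁ x D(x)²`"). For every real additive `f` and every `N`,
`∑_{n ≤ N} (f(n) − E(N))² ≤ 69 · N · D(N)²`, where (Elliott's notation, p. 23)
`E(N) = ∑_{q ≤ N} f(q) q⁻¹ (1 − 1/p)` and `D(N)² = ∑_{q ≤ N} f(q)²/q`, the sums running over the
prime powers `q = p^k ≤ N` (`p = q.minFac`). The constant `69` is the crude outcome of the proof
below (Turán's method as in Elliott's proof of Lemma (1.5): cut at `√N`, expand the variance of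
`w(n) = ∑_{q ≤ √N, q ∥ n} f(q)` with exact-divisor counts, at most one exact prime-power divisor
`> √N`, and `∑_{√N < q ≤ N} 1/q ≤ 16` for `E(N) − W`); no attempt is made at the optimal constant.
TODO(general form): the weights `n^{-σ}`, `0 ≤ σ < 1`, of Lemma (1.5), and the weights `ρ(n)`
of Lemma (1.3), are not treated. [cite: Elliott1985, Ch. 1, Lemma (1.5)] -/
theorem turanKubilius (f : ℕ → ℝ) (hf : IsAdditiveArith f) (N : ℕ) :
    ∑ n ∈ Finset.Ioc 0 N,
        (f n - ∑ q ∈ (Finset.Ioc 0 N).filter IsPrimePow,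
            f q / q * (1 - 1 / (q.minFac : ℝ))) ^ 2
      ≤ 69 * N * ∑ q ∈ (Finset.Ioc 0 N).filter IsPrimePow, f q ^ 2 / q := by
  classical
  set PP := (Finset.Ioc 0 N).filter IsPrimePow with hPP
  set y := Nat.sqrt N with hy
  set P₁ := PP.filter (fun q => q ≤ y) with hP₁
  set P₂ := PP.filter (fun q => ¬ q ≤ y) with hP₂
  set X : ℕ → ℕ → Prop := fun q n => n.factorization q.minFac = q.factorization q.minFac with hX
  set m : ℕ → ℝ := fun q => 1 / q * (1 - 1 / (q.minFac : ℝ)) with hm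
  set Dsq := ∑ q ∈ PP, f q ^ 2 / q with hDsq
  set W := ∑ q ∈ P₁, f q * m q with hW
  set w : ℕ → ℝ := fun n => ∑ q ∈ P₁, if X q n then f q else 0 with hw
  set u : ℕ → ℝ := fun n => ∑ q ∈ P₂, if X q n then f q else 0 with hu
  -- basic facts
  have hPPmem : ∀ q ∈ PP, IsPrimePow q ∧ 0 < q ∧ q ≤ N := fun q hq => by
    simp only [hPP, Finset.mem_filter, Finset.mem_Ioc] at hq
    exact ⟨hq.2, hq.1.1, hq.1.2⟩
  have hP₁sub : P₁ ⊆ PP := Finset.filter_subset _ _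
  have hP₂sub : P₂ ⊆ PP := Finset.filter_subset _ _
  have hDsq0 : 0 ≤ Dsq := Finset.sum_nonneg fun q _ => by positivity
  have hNR : (0 : ℝ) ≤ N := Nat.cast_nonneg _
  have hyy : y * y ≤ N := hy ▸ Nat.sqrt_le N
  have hm_le : ∀ q ∈ PP, 0 ≤ m q ∧ m q ≤ 1 / q := by
    intro q hq
    obtain ⟨hp, -, -⟩ := primePow_spec (hPPmem q hq).1
    have hp2 : (2 : ℝ) ≤ q.minFac := by exact_mod_cast hp.two_le
    have h1 : (0 : ℝ) ≤ 1 - 1 / (q.minFac : ℝ) := by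
      rw [sub_nonneg, div_le_one (by linarith)]; linarith
    have h2 : 1 - 1 / (q.minFac : ℝ) ≤ 1 := by
      have : (0 : ℝ) ≤ 1 / (q.minFac : ℝ) := by positivity
      linarith
    have hq0 : (0 : ℝ) ≤ 1 / q := by positivity
    exact ⟨mul_nonneg hq0 h1, by nlinarith⟩
  -- exact division implies division
  have hXdvd : ∀ q ∈ PP, ∀ n, X q n → q ∣ n := by
    intro q hq n hXq
    obtain ⟨-, -, e⟩ := primePow_spec (hPPmem q hq).1
    simp only [hX] at hXq
    rw [← e, ← hXq]
    exact Nat.ordProj_dvd n _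
  -- the decomposition `f = w + u` on `(0, N]`
  have hdecomp : ∀ n ∈ Finset.Ioc 0 N, f n = w n + u n := by
    intro n hn
    rw [Finset.mem_Ioc] at hn
    have hn0 : n ≠ 0 := by omega
    have h := eq_sum_filter_exact hf hn0 hn.2
    rw [← hPP, Finset.sum_filter] at h
    rw [h, ← Finset.sum_filter_add_sum_filter_not PP (fun q => q ≤ y)]
  -- Step (i): the variance of `w`
  have hstep1 : ∑ n ∈ Finset.Ioc 0 N, (w n - W) ^ 2 ≤ 6 * N * Dsq := by
    set ind : ℕ → ℕ → ℝ := fun q n => if X q n then 1 else 0 with hind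
    set c : ℕ → ℝ := fun q => ∑ n ∈ Finset.Ioc 0 N, ind q n with hc
    set c₂ : ℕ → ℕ → ℝ := fun q q' => ∑ n ∈ Finset.Ioc 0 N, ind q n * ind q' n with hc₂
    have hwind : ∀ n, w n = ∑ q ∈ P₁, f q * ind q n := fun n =>
      Finset.sum_congr rfl fun q _ => by
        simp only [hind]
        split_ifs <;> simp
    -- expansions
    have hsum_w : ∑ n ∈ Finset.Ioc 0 N, w n = ∑ q ∈ P₁, f q * c q := by
      simp only [hwind]
      rw [Finset.sum_comm]
      refine Finset.sum_congr rfl fun q _ => ?_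
      simp only [hc]
      rw [Finset.mul_sum]
    have hsum_w2 : ∑ n ∈ Finset.Ioc 0 N, (w n) ^ 2
        = ∑ q ∈ P₁, ∑ q' ∈ P₁, f q * f q' * c₂ q q' := by
      simp only [hwind, sq, Finset.sum_mul_sum]
      rw [Finset.sum_comm]
      refine Finset.sum_congr rfl fun q _ => ?_
      rw [Finset.sum_comm]
      refine Finset.sum_congr rfl fun q' _ => ?_
      simp only [hc₂]
      rw [Finset.mul_sum]
      refine Finset.sum_congr rfl fun n _ => ?_
      ring
    have hexp : ∑ n ∈ Finset.Ioc 0 N, (w n - W) ^ 2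
        = ∑ q ∈ P₁, ∑ q' ∈ P₁, f q * f q' * c₂ q q'
          - 2 * W * (∑ q ∈ P₁, f q * c q) + N * W ^ 2 := by
      have e : ∀ n, (w n - W) ^ 2 = (w n) ^ 2 - 2 * W * w n + W ^ 2 := fun n => by ring
      simp only [e]
      rw [Finset.sum_add_distrib, Finset.sum_sub_distrib, hsum_w2, ← Finset.mul_sum, hsum_w,
        Finset.sum_const, Nat.card_Ioc, Nat.sub_zero, nsmul_eq_mul]
    -- the counting hypotheses
    have h1 : ∀ q ∈ P₁, |c q - N * m q| ≤ 1 := by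
      intro q hq
      have hqP := hP₁sub hq
      obtain ⟨hp, hk, e⟩ := primePow_spec (hPPmem q hqP).1
      have hc' : c q = (((Finset.Ioc 0 N).filter
          (fun n => n.factorization q.minFac = q.factorization q.minFac)).card : ℝ) := by
        simp only [hc, hind, hX]
        rw [Finset.sum_boole]
      have hqe : (q : ℝ) = (q.minFac : ℝ) ^ (q.factorization q.minFac) := by
        exact_mod_cast e.symm
      have hmq : (N : ℝ) * m q
          = N * (1 / (q.minFac : ℝ) ^ (q.factorization q.minFac) * (1 - 1 / q.minFac)) := by
        simp only [hm]
        rw [hqe]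
      rw [hc', hmq]
      exact card_exact_sub_le_one N hp _
    have h2 : ∀ q ∈ P₁, ∀ q' ∈ P₁, q.minFac ≠ q'.minFac → |c₂ q q' - N * m q * m q'| ≤ 2 := by
      intro q hq q' hq' hne
      have hqP := hP₁sub hq
      have hqP' := hP₁sub hq'
      obtain ⟨hp, hk, e⟩ := primePow_spec (hPPmem q hqP).1
      obtain ⟨hp', hk', e'⟩ := primePow_spec (hPPmem q' hqP').1
      have hc₂' : c₂ q q' = (((Finset.Ioc 0 N).filter
          (fun n => n.factorization q.minFac = q.factorization q.minFac ∧
            n.factorization q'.minFac = q'.factorization q'.minFac)).card : ℝ) := by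
        simp only [hc₂, hind, hX]
        simp_rw [ite_zero_mul_ite_zero, one_mul]
        rw [Finset.sum_boole]
      have hqe : (q : ℝ) = (q.minFac : ℝ) ^ (q.factorization q.minFac) := by
        exact_mod_cast e.symm
      have hqe' : (q' : ℝ) = (q'.minFac : ℝ) ^ (q'.factorization q'.minFac) := by
        exact_mod_cast e'.symm
      have hmq : (N : ℝ) * m q * m q'
          = N * (1 / (q.minFac : ℝ) ^ (q.factorization q.minFac) * (1 - 1 / q.minFac))
            * (1 / (q'.minFac : ℝ) ^ (q'.factorization q'.minFac) * (1 - 1 / q'.minFac)) := by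
        simp only [hm]
        rw [hqe, hqe']
      rw [hc₂', hmq]
      exact card_exact_pair_sub_le_two N hp hp' hne _ _
    have h3 : ∀ q ∈ P₁, ∀ q' ∈ P₁, q.minFac = q'.minFac → q ≠ q' → c₂ q q' = 0 := by
      intro q hq q' hq' hpeq hne
      obtain ⟨hp, hk, e⟩ := primePow_spec (hPPmem q (hP₁sub hq)).1
      obtain ⟨hp', hk', e'⟩ := primePow_spec (hPPmem q' (hP₁sub hq')).1
      simp only [hc₂]
      refine Finset.sum_eq_zero fun n _ => ?_
      simp only [hind]
      by_cases hXq : X q n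
      · by_cases hXq' : X q' n
        · exfalso
          apply hne
          simp only [hX] at hXq hXq'
          rw [← e, ← e', ← hXq, ← hXq', hpeq]
        · simp [hXq']
      · simp [hXq]
    have h4 : ∀ q ∈ P₁, c₂ q q = c q := by
      intro q _
      simp only [hc₂, hc]
      refine Finset.sum_congr rfl fun n _ => ?_
      simp only [hind]
      split_ifs <;> simp
    have hvar := variance_abstract P₁ f m c c₂ Nat.minFac hNR h1 h2 h3 h4
    rw [← hW] at hvar
    rw [hexp]
    -- the four crude bounds
    have hcardP₁ : (P₁.card : ℝ) ≤ y := by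
      have : P₁ ⊆ Finset.Ioc 0 y := by
        intro q hq
        simp only [hP₁, Finset.mem_filter] at hq
        exact Finset.mem_Ioc.mpr ⟨(hPPmem q hq.1).2.1, hq.2⟩
      have := Finset.card_le_card this
      rw [Nat.card_Ioc, Nat.sub_zero] at this
      exact_mod_cast this
    have hyR : (y : ℝ) * y ≤ N := by exact_mod_cast hyy
    have hy0 : (0 : ℝ) ≤ y := Nat.cast_nonneg _
    have hDsq₁ : ∑ q ∈ P₁, f q ^ 2 / q ≤ Dsq :=
      Finset.sum_le_sum_of_subset_of_nonneg hP₁sub fun q _ _ => by positivity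
    have hD₁0 : 0 ≤ ∑ q ∈ P₁, f q ^ 2 / q := Finset.sum_nonneg fun q _ => by positivity
    have hb1 : ∑ q ∈ P₁, f q ^ 2 * m q ≤ Dsq := by
      refine le_trans (Finset.sum_le_sum fun q hq => ?_) hDsq₁
      obtain ⟨-, hm1⟩ := hm_le q (hP₁sub hq)
      calc f q ^ 2 * m q ≤ f q ^ 2 * (1 / q) := mul_le_mul_of_nonneg_left hm1 (sq_nonneg _)
        _ = f q ^ 2 / q := by ring
    have hb2 : ∑ q ∈ P₁, f q ^ 2 ≤ N * Dsq := by
      calc ∑ q ∈ P₁, f q ^ 2 ≤ ∑ q ∈ P₁, y * (f q ^ 2 / q) := by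
            refine Finset.sum_le_sum fun q hq => ?_
            simp only [hP₁, Finset.mem_filter] at hq
            have hq0 : (0 : ℝ) < q := by exact_mod_cast (hPPmem q hq.1).2.1
            have hqy : (q : ℝ) ≤ y := by exact_mod_cast hq.2
            calc f q ^ 2 = q * (f q ^ 2 / q) := by field_simp
              _ ≤ y * (f q ^ 2 / q) := mul_le_mul_of_nonneg_right hqy (by positivity)
        _ = y * ∑ q ∈ P₁, f q ^ 2 / q := by rw [Finset.mul_sum]
        _ ≤ N * Dsq := by
            apply mul_le_mul _ hDsq₁ hD₁0 hNR
            exact_mod_cast (hy ▸ Nat.sqrt_le_self N : y ≤ N)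
    -- Cauchy–Schwarz twice
    have hcs1 : (∑ q ∈ P₁, |f q|) ^ 2 ≤ (∑ q ∈ P₁, f q ^ 2 / q) * ((y : ℝ) * y) := by
      have hcs := Finset.sum_mul_sq_le_sq_mul_sq P₁ (fun q => |f q| / Real.sqrt q)
        (fun q => Real.sqrt q)
      have e1 : ∀ q ∈ P₁, |f q| / Real.sqrt q * Real.sqrt q = |f q| := by
        intro q hq
        have hq0 : (0 : ℝ) < q := by exact_mod_cast (hPPmem q (hP₁sub hq)).2.1
        exact div_mul_cancel₀ _ (Real.sqrt_pos.mpr hq0).ne'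
      have e2 : ∀ q ∈ P₁, (|f q| / Real.sqrt q) ^ 2 = f q ^ 2 / q := by
        intro q _
        rw [div_pow, sq_abs, Real.sq_sqrt (by positivity)]
      have e3 : ∀ q ∈ P₁, Real.sqrt q ^ 2 = (q : ℝ) := fun q _ => Real.sq_sqrt (by positivity)
      rw [Finset.sum_congr rfl e1, Finset.sum_congr rfl e2, Finset.sum_congr rfl e3] at hcs
      refine hcs.trans (mul_le_mul_of_nonneg_left ?_ hD₁0)
      calc ∑ q ∈ P₁, (q : ℝ) ≤ ∑ q ∈ P₁, (y : ℝ) := by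
            refine Finset.sum_le_sum fun q hq => ?_
            simp only [hP₁, Finset.mem_filter] at hq
            exact_mod_cast hq.2
        _ = P₁.card * y := by rw [Finset.sum_const, nsmul_eq_mul]
        _ ≤ y * y := mul_le_mul_of_nonneg_right hcardP₁ hy0
    have hcs2 : W ^ 2 ≤ (∑ q ∈ P₁, f q ^ 2 / q) * y := by
      have hWabs : |W| ≤ ∑ q ∈ P₁, |f q| / q := by
        rw [hW]
        refine (Finset.abs_sum_le_sum_abs _ _).trans (Finset.sum_le_sum fun q hq => ?_)
        obtain ⟨hm0, hm1⟩ := hm_le q (hP₁sub hq)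
        rw [abs_mul, abs_of_nonneg hm0]
        calc |f q| * m q ≤ |f q| * (1 / q) := mul_le_mul_of_nonneg_left hm1 (abs_nonneg _)
          _ = |f q| / q := by ring
      have hcs := Finset.sum_mul_sq_le_sq_mul_sq P₁ (fun q => |f q| / Real.sqrt q)
        (fun q => 1 / Real.sqrt q)
      have e1 : ∀ q ∈ P₁, |f q| / Real.sqrt q * (1 / Real.sqrt q) = |f q| / q := by
        intro q hq
        have hq0 : (0 : ℝ) < q := by exact_mod_cast (hPPmem q (hP₁sub hq)).2.1
        have hs : Real.sqrt q ≠ 0 := (Real.sqrt_pos.mpr hq0).ne'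
        rw [div_mul_div_comm, mul_one, Real.mul_self_sqrt hq0.le]
      have e2 : ∀ q ∈ P₁, (|f q| / Real.sqrt q) ^ 2 = f q ^ 2 / q := by
        intro q _
        rw [div_pow, sq_abs, Real.sq_sqrt (by positivity)]
      have e3 : ∀ q ∈ P₁, (1 / Real.sqrt q) ^ 2 = 1 / (q : ℝ) := fun q _ => by
        rw [div_pow, one_pow, Real.sq_sqrt (by positivity)]
      rw [Finset.sum_congr rfl e1, Finset.sum_congr rfl e2, Finset.sum_congr rfl e3] at hcs
      have hrecip : ∑ q ∈ P₁, 1 / (q : ℝ) ≤ y := by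
        calc ∑ q ∈ P₁, 1 / (q : ℝ) ≤ ∑ q ∈ P₁, (1 : ℝ) := by
              refine Finset.sum_le_sum fun q hq => ?_
              have hq1 : (1 : ℝ) ≤ q := by exact_mod_cast (hPPmem q (hP₁sub hq)).2.1
              exact (div_le_one (by linarith)).mpr hq1
          _ = P₁.card := by rw [Finset.sum_const, nsmul_eq_mul, mul_one]
          _ ≤ y := hcardP₁
      calc W ^ 2 = |W| ^ 2 := (sq_abs W).symm
        _ ≤ (∑ q ∈ P₁, |f q| / q) ^ 2 := pow_le_pow_left₀ (abs_nonneg _) hWabs 2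
        _ ≤ (∑ q ∈ P₁, f q ^ 2 / q) * ∑ q ∈ P₁, 1 / (q : ℝ) := hcs
        _ ≤ (∑ q ∈ P₁, f q ^ 2 / q) * y := mul_le_mul_of_nonneg_left hrecip hD₁0
    have hb3 : (∑ q ∈ P₁, |f q|) ^ 2 ≤ N * Dsq := by
      calc (∑ q ∈ P₁, |f q|) ^ 2 ≤ (∑ q ∈ P₁, f q ^ 2 / q) * ((y : ℝ) * y) := hcs1
        _ ≤ Dsq * N := mul_le_mul hDsq₁ hyR (by positivity) hDsq0
        _ = N * Dsq := mul_comm _ _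
    have hb4 : |W| * ∑ q ∈ P₁, |f q| ≤ N * Dsq := by
      have hA : 0 ≤ |W| * ∑ q ∈ P₁, |f q| :=
        mul_nonneg (abs_nonneg _) (Finset.sum_nonneg fun q _ => abs_nonneg _)
      have hB : 0 ≤ (N : ℝ) * Dsq := mul_nonneg hNR hDsq0
      have hy3 : (y : ℝ) * (y * y) ≤ (N : ℝ) * N := by
        have : y * (y * y) ≤ N * N := by
          rcases Nat.eq_zero_or_pos y with h0 | hpos
          · simp [h0]
          · calc y * (y * y) ≤ (y * y) * (y * y) :=
                  Nat.mul_le_mul_right _ (Nat.le_mul_of_pos_left y hpos)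
              _ ≤ N * N := Nat.mul_le_mul hyy hyy
        exact_mod_cast this
      refine (sq_le_sq₀ hA hB).mp ?_
      calc (|W| * ∑ q ∈ P₁, |f q|) ^ 2 = W ^ 2 * (∑ q ∈ P₁, |f q|) ^ 2 := by
            rw [mul_pow, sq_abs]
        _ ≤ ((∑ q ∈ P₁, f q ^ 2 / q) * y) * ((∑ q ∈ P₁, f q ^ 2 / q) * ((y : ℝ) * y)) :=
            mul_le_mul hcs2 hcs1 (sq_nonneg _) (by positivity)
        _ = (∑ q ∈ P₁, f q ^ 2 / q) ^ 2 * (y * (y * y)) := by ring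
        _ ≤ Dsq ^ 2 * ((N : ℝ) * N) :=
            mul_le_mul (pow_le_pow_left₀ hD₁0 hDsq₁ 2) hy3 (by positivity) (by positivity)
        _ = ((N : ℝ) * Dsq) ^ 2 := by ring
    have hNb1 := mul_le_mul_of_nonneg_left hb1 hNR
    nlinarith [hvar, hNb1, hb2, hb3, hb4]
  -- Step (ii): at most one large exact prime-power divisor
  have hstep2 : ∑ n ∈ Finset.Ioc 0 N, (u n) ^ 2 ≤ N * Dsq := by
    have hcard : ∀ n ∈ Finset.Ioc 0 N, (P₂.filter (fun q => X q n)).card ≤ 1 := by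
      intro n hn
      rw [Finset.mem_Ioc] at hn
      refine Finset.card_le_one.mpr fun q₁ hq₁ q₂ hq₂ => ?_
      simp only [hP₂, Finset.mem_filter, not_le] at hq₁ hq₂
      obtain ⟨⟨hq₁P, hq₁y⟩, hX₁⟩ := hq₁
      obtain ⟨⟨hq₂P, hq₂y⟩, hX₂⟩ := hq₂
      obtain ⟨hp₁, hk₁, e₁⟩ := primePow_spec (hPPmem q₁ hq₁P).1
      obtain ⟨hp₂, hk₂, e₂⟩ := primePow_spec (hPPmem q₂ hq₂P).1
      by_cases hpeq : q₁.minFac = q₂.minFac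
      · simp only [hX] at hX₁ hX₂
        rw [← e₁, ← e₂, ← hX₁, ← hX₂, hpeq]
      · exfalso
        have hd₁ := hXdvd q₁ hq₁P n hX₁
        have hd₂ := hXdvd q₂ hq₂P n hX₂
        have hcop : Nat.Coprime q₁ q₂ := by
          rw [← e₁, ← e₂]
          exact Nat.Coprime.pow _ _ ((Nat.coprime_primes hp₁ hp₂).mpr hpeq)
        have hdvd : q₁ * q₂ ∣ n := Nat.Coprime.mul_dvd_of_dvd_of_dvd hcop hd₁ hd₂
        have hle : q₁ * q₂ ≤ n := Nat.le_of_dvd (by omega) hdvd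
        have hlt : N < (y + 1) * (y + 1) := hy ▸ Nat.lt_succ_sqrt N
        have hge : (y + 1) * (y + 1) ≤ q₁ * q₂ := Nat.mul_le_mul hq₁y hq₂y
        omega
    have hu_sq : ∀ n ∈ Finset.Ioc 0 N, (u n) ^ 2 ≤ ∑ q ∈ P₂, if X q n then f q ^ 2 else 0 := by
      intro n hn
      have hu' : u n = ∑ q ∈ P₂.filter (fun q => X q n), f q := by
        simp only [hu, Finset.sum_filter]
      rw [hu', ← Finset.sum_filter]
      calc (∑ q ∈ P₂.filter (fun q => X q n), f q) ^ 2
          ≤ (P₂.filter (fun q => X q n)).card * ∑ q ∈ P₂.filter (fun q => X q n), f q ^ 2 :=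
            sq_sum_le_card_mul_sum_sq
        _ ≤ 1 * ∑ q ∈ P₂.filter (fun q => X q n), f q ^ 2 := by
            apply mul_le_mul_of_nonneg_right _ (Finset.sum_nonneg fun q _ => sq_nonneg _)
            exact_mod_cast hcard n hn
        _ = _ := one_mul _
    calc ∑ n ∈ Finset.Ioc 0 N, (u n) ^ 2
        ≤ ∑ n ∈ Finset.Ioc 0 N, ∑ q ∈ P₂, (if X q n then f q ^ 2 else 0) :=
          Finset.sum_le_sum hu_sq
      _ = ∑ q ∈ P₂, ∑ n ∈ Finset.Ioc 0 N, (if X q n then f q ^ 2 else 0) := Finset.sum_comm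
      _ = ∑ q ∈ P₂, f q ^ 2 * (((Finset.Ioc 0 N).filter (fun n => X q n)).card : ℝ) := by
          refine Finset.sum_congr rfl fun q _ => ?_
          rw [← Finset.sum_filter, Finset.sum_const, nsmul_eq_mul, mul_comm]
      _ ≤ ∑ q ∈ P₂, f q ^ 2 * ((N : ℝ) / q) := by
          refine Finset.sum_le_sum fun q hq => ?_
          apply mul_le_mul_of_nonneg_left _ (sq_nonneg _)
          have hqP := hP₂sub hq
          have hsub : (Finset.Ioc 0 N).filter (fun n => X q n)
              ⊆ (Finset.Ioc 0 N).filter (fun n => q ∣ n) := by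
            intro n hn
            simp only [Finset.mem_filter] at hn ⊢
            exact ⟨hn.1, hXdvd q hqP n hn.2⟩
          calc (((Finset.Ioc 0 N).filter (fun n => X q n)).card : ℝ)
              ≤ ((Finset.Ioc 0 N).filter (fun n => q ∣ n)).card := by
                exact_mod_cast Finset.card_le_card hsub
            _ = ((N / q : ℕ) : ℝ) := by rw [Nat.Ioc_filter_dvd_card_eq_div]
            _ ≤ (N : ℝ) / q := Nat.cast_div_le
      _ = N * ∑ q ∈ P₂, f q ^ 2 / q := by
          rw [Finset.mul_sum]
          refine Finset.sum_congr rfl fun q _ => ?_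
          ring
      _ ≤ N * Dsq :=
          mul_le_mul_of_nonneg_left
            (Finset.sum_le_sum_of_subset_of_nonneg hP₂sub fun q _ _ => by positivity) hNR
  -- Step (iii): `E − W` is small
  have hstep3 : (∑ q ∈ PP, f q / q * (1 - 1 / (q.minFac : ℝ)) - W) ^ 2 ≤ 16 * Dsq := by
    have e1 : ∑ q ∈ P₁, f q / q * (1 - 1 / (q.minFac : ℝ)) = ∑ q ∈ P₁, f q * m q :=
      Finset.sum_congr rfl fun q _ => by simp only [hm]; ring
    have e2 : ∑ q ∈ P₂, f q / q * (1 - 1 / (q.minFac : ℝ)) = ∑ q ∈ P₂, f q * m q :=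
      Finset.sum_congr rfl fun q _ => by simp only [hm]; ring
    have hEW : ∑ q ∈ PP, f q / q * (1 - 1 / (q.minFac : ℝ)) - W = ∑ q ∈ P₂, f q * m q := by
      rw [hW, ← Finset.sum_filter_add_sum_filter_not PP (fun q => q ≤ y), ← hP₁, ← hP₂, e1, e2]
      ring
    rw [hEW]
    -- Cauchy–Schwarz
    have hcs := Finset.sum_mul_sq_le_sq_mul_sq P₂ (fun q => f q / Real.sqrt q)
      (fun q => Real.sqrt q * m q)
    have hprod : ∀ q ∈ P₂, f q / Real.sqrt q * (Real.sqrt q * m q) = f q * m q := by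
      intro q hq
      have hq0 : (0 : ℝ) < q := by exact_mod_cast (hPPmem q (hP₂sub hq)).2.1
      have hs : Real.sqrt q ≠ 0 := (Real.sqrt_pos.mpr hq0).ne'
      field_simp
    have hF : ∀ q ∈ P₂, (f q / Real.sqrt q) ^ 2 = f q ^ 2 / q := by
      intro q hq
      have hq0 : (0 : ℝ) ≤ q := by positivity
      rw [div_pow, Real.sq_sqrt hq0]
    have hG : ∀ q ∈ P₂, (Real.sqrt q * m q) ^ 2 ≤ 1 / q := by
      intro q hq
      have hqP := hP₂sub hq
      have hq0 : (0 : ℝ) < q := by exact_mod_cast (hPPmem q hqP).2.1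
      obtain ⟨hm0, hm1⟩ := hm_le q hqP
      rw [mul_pow, Real.sq_sqrt hq0.le]
      calc (q : ℝ) * m q ^ 2 = (q * m q) * m q := by ring
        _ ≤ 1 * m q := by
            apply mul_le_mul_of_nonneg_right _ hm0
            calc (q : ℝ) * m q ≤ q * (1 / q) := mul_le_mul_of_nonneg_left hm1 hq0.le
              _ = 1 := by field_simp
        _ = m q := one_mul _
        _ ≤ 1 / q := hm1
    rw [Finset.sum_congr rfl hprod, Finset.sum_congr rfl hF] at hcs
    have hP₂eq : P₂ = PP.filter (fun q => Nat.sqrt N < q) := by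
      rw [hP₂]
      exact Finset.filter_congr fun q _ => by rw [hy, not_le]
    have h16 : ∑ q ∈ P₂, (Real.sqrt q * m q) ^ 2 ≤ 16 :=
      (Finset.sum_le_sum hG).trans (hP₂eq ▸ sum_inv_primePow_large_le N)
    have hsub : ∑ q ∈ P₂, f q ^ 2 / q ≤ Dsq :=
      Finset.sum_le_sum_of_subset_of_nonneg hP₂sub fun q _ _ => by positivity
    have h0 : 0 ≤ ∑ q ∈ P₂, f q ^ 2 / q := Finset.sum_nonneg fun q _ => by positivity
    calc (∑ q ∈ P₂, f q * m q) ^ 2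
        ≤ (∑ q ∈ P₂, f q ^ 2 / q) * ∑ q ∈ P₂, (Real.sqrt q * m q) ^ 2 := hcs
      _ ≤ Dsq * 16 := mul_le_mul hsub h16 (Finset.sum_nonneg fun q _ => sq_nonneg _) hDsq0
      _ = 16 * Dsq := mul_comm _ _
  -- assembly
  set E := ∑ q ∈ PP, f q / q * (1 - 1 / (q.minFac : ℝ)) with hE
  calc ∑ n ∈ Finset.Ioc 0 N, (f n - E) ^ 2
      ≤ ∑ n ∈ Finset.Ioc 0 N, 3 * ((w n - W) ^ 2 + (u n) ^ 2 + (E - W) ^ 2) := by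
        refine Finset.sum_le_sum fun n hn => ?_
        rw [hdecomp n hn]
        nlinarith [sq_nonneg (w n - W - u n), sq_nonneg (w n - W + (E - W)),
          sq_nonneg (u n + (E - W))]
    _ = 3 * (∑ n ∈ Finset.Ioc 0 N, (w n - W) ^ 2 + ∑ n ∈ Finset.Ioc 0 N, (u n) ^ 2
          + N * (E - W) ^ 2) := by
        rw [← Finset.mul_sum]
        congr 1
        rw [Finset.sum_add_distrib, Finset.sum_add_distrib, Finset.sum_const, Nat.card_Ioc,
          Nat.sub_zero, nsmul_eq_mul]
    _ ≤ 3 * (6 * N * Dsq + N * Dsq + N * (16 * Dsq)) := by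
        have := mul_le_mul_of_nonneg_left hstep3 hNR
        nlinarith
    _ = 69 * N * Dsq := by ring

/-! ### Arbitrary coefficients on the prime powers, and the dual inequality (Elliott Ch. 5) -/

/-- The additive function with prescribed values `g(p^k)` on the prime powers:
`n ↦ ∑_{p ∣ n} g(p^{v_p(n)})` is additive. [folklore] -/
theorem isAdditiveArith_sum_primeFactors (g : ℕ → ℝ) :
    IsAdditiveArith (fun n => ∑ p ∈ n.primeFactors, g (p ^ n.factorization p)) := by
  intro r s hr hs hrs
  have hr0 : r ≠ 0 := hr.ne'
  have hs0 : s ≠ 0 := hs.ne'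
  simp only
  rw [Nat.Coprime.primeFactors_mul hrs, Finset.sum_union hrs.disjoint_primeFactors]
  congr 1
  · refine Finset.sum_congr rfl fun p hp => ?_
    rw [Nat.factorization_mul hr0 hs0, Finsupp.add_apply,
      Nat.factorization_eq_zero_of_not_dvd (n := s) (fun h => ?_), add_zero]
    have hpp : p.Prime := Nat.prime_of_mem_primeFactors hp
    exact hpp.one_lt.ne' (Nat.eq_one_of_dvd_coprimes hrs (Nat.dvd_of_mem_primeFactors hp) h)
  · refine Finset.sum_congr rfl fun p hp => ?_
    rw [Nat.factorization_mul hr0 hs0, Finsupp.add_apply,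
      Nat.factorization_eq_zero_of_not_dvd (n := r) (fun h => ?_), zero_add]
    have hpp : p.Prime := Nat.prime_of_mem_primeFactors hp
    exact hpp.one_lt.ne' (Nat.eq_one_of_dvd_coprimes hrs h (Nat.dvd_of_mem_primeFactors hp))

/-- The additive function with prescribed values on the prime powers takes those values there.
[folklore] -/
theorem sum_primeFactors_of_isPrimePow (g : ℕ → ℝ) {q : ℕ} (hq : IsPrimePow q) :
    ∑ p ∈ q.primeFactors, g (p ^ q.factorization p) = g q := by
  obtain ⟨hp, hk, e⟩ := primePow_spec hq
  conv_lhs => rw [← e]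
  rw [Nat.primeFactors_prime_pow hk.ne' hp, Finset.sum_singleton, hp.factorization_pow,
    Finsupp.single_eq_same, e]

/-- **Turán–Kubilius for arbitrary coefficients on the prime powers.** For every `g : ℕ → ℝ` and
`N`, `∑_{n ≤ N} (∑_{q ≤ N, q ∥ n} g(q) − ∑_{q ≤ N} g(q) q⁻¹(1 − 1/p))² ≤ 69 N ∑_{q ≤ N} g(q)²/q`
(`q` over prime powers, `q ∥ n` exact division): `turanKubilius` applied to the additive function
with values `g` on the prime powers. [cite: Elliott1985, Ch. 1, Lemma (1.5)] -/
theorem turanKubilius_coeff (g : ℕ → ℝ) (N : ℕ) :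
    ∑ n ∈ Finset.Ioc 0 N,
        (∑ q ∈ ((Finset.Ioc 0 N).filter IsPrimePow).filter
            (fun q => n.factorization q.minFac = q.factorization q.minFac), g q
          - ∑ q ∈ (Finset.Ioc 0 N).filter IsPrimePow, g q / q * (1 - 1 / (q.minFac : ℝ))) ^ 2
      ≤ 69 * N * ∑ q ∈ (Finset.Ioc 0 N).filter IsPrimePow, g q ^ 2 / q := by
  set f : ℕ → ℝ := fun n => ∑ p ∈ n.primeFactors, g (p ^ n.factorization p) with hfdef
  have hf : IsAdditiveArith f := isAdditiveArith_sum_primeFactors g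
  have hfg : ∀ q ∈ (Finset.Ioc 0 N).filter IsPrimePow, f q = g q := fun q hq =>
    sum_primeFactors_of_isPrimePow g (Finset.mem_filter.mp hq).2
  have hTK := turanKubilius f hf N
  have hE : ∑ q ∈ (Finset.Ioc 0 N).filter IsPrimePow, f q / q * (1 - 1 / (q.minFac : ℝ))
      = ∑ q ∈ (Finset.Ioc 0 N).filter IsPrimePow, g q / q * (1 - 1 / (q.minFac : ℝ)) :=
    Finset.sum_congr rfl fun q hq => by rw [hfg q hq]
  have hD : ∑ q ∈ (Finset.Ioc 0 N).filter IsPrimePow, f q ^ 2 / q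
      = ∑ q ∈ (Finset.Ioc 0 N).filter IsPrimePow, g q ^ 2 / q :=
    Finset.sum_congr rfl fun q hq => by rw [hfg q hq]
  rw [hE, hD] at hTK
  refine le_trans (le_of_eq (Finset.sum_congr rfl fun n hn => ?_)) hTK
  rw [Finset.mem_Ioc] at hn
  have hn0 : n ≠ 0 := by omega
  rw [eq_sum_filter_exact hf hn0 hn.2]
  congr 2
  refine Finset.sum_congr rfl fun q hq => ?_
  exact (hfg q (Finset.mem_filter.mp hq).1).symm

/-- **The duality principle** (Elliott 1985, Ch. 5, Lemma (5.1), real case): if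
`∑_i |∑_j c_{ij} a_j|² ≤ λ ∑_j |a_j|²` for all real vectors `a`, then
`∑_j |∑_i c_{ij} b_i|² ≤ λ ∑_i |b_i|²` for all real vectors `b` ("a judicious application of
the Cauchy–Schwarz inequality": take `a = Cᵀ b`). [cite: Elliott1985, Ch. 5, Lemma (5.1)] -/
theorem duality {ι κ : Type*} (I : Finset ι) (J : Finset κ) (c : ι → κ → ℝ) {lam : ℝ}
    (hlam : 0 ≤ lam)
    (h : ∀ a : κ → ℝ, ∑ i ∈ I, (∑ j ∈ J, c i j * a j) ^ 2 ≤ lam * ∑ j ∈ J, a j ^ 2)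
    (b : ι → ℝ) :
    ∑ j ∈ J, (∑ i ∈ I, c i j * b i) ^ 2 ≤ lam * ∑ i ∈ I, b i ^ 2 := by
  obtain ⟨a, ha⟩ : ∃ a : κ → ℝ, ∀ j, a j = ∑ i ∈ I, c i j * b i := ⟨_, fun _ => rfl⟩
  have hgoal : ∑ j ∈ J, (∑ i ∈ I, c i j * b i) ^ 2 = ∑ j ∈ J, a j ^ 2 :=
    Finset.sum_congr rfl fun j _ => by rw [ha j]
  rw [hgoal]
  set S := ∑ j ∈ J, a j ^ 2 with hS
  have hS0 : 0 ≤ S := Finset.sum_nonneg fun j _ => sq_nonneg _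
  have hB0 : 0 ≤ ∑ i ∈ I, b i ^ 2 := Finset.sum_nonneg fun i _ => sq_nonneg _
  -- `S = ∑_i b_i (C a)_i`
  have hswap : S = ∑ i ∈ I, b i * (∑ j ∈ J, c i j * a j) := by
    calc S = ∑ j ∈ J, a j * ∑ i ∈ I, c i j * b i :=
          Finset.sum_congr rfl fun j _ => by rw [sq, ← ha j]
      _ = ∑ j ∈ J, ∑ i ∈ I, a j * (c i j * b i) :=
          Finset.sum_congr rfl fun j _ => Finset.mul_sum _ _ _
      _ = ∑ i ∈ I, ∑ j ∈ J, a j * (c i j * b i) := Finset.sum_comm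
      _ = ∑ i ∈ I, b i * (∑ j ∈ J, c i j * a j) := by
          refine Finset.sum_congr rfl fun i _ => ?_
          rw [Finset.mul_sum]
          exact Finset.sum_congr rfl fun j _ => by ring
  -- Cauchy–Schwarz and the hypothesis at `a`
  have hcs := Finset.sum_mul_sq_le_sq_mul_sq I b (fun i => ∑ j ∈ J, c i j * a j)
  have hSsq : S ^ 2 ≤ (∑ i ∈ I, b i ^ 2) * (lam * S) := by
    calc S ^ 2 = (∑ i ∈ I, b i * (∑ j ∈ J, c i j * a j)) ^ 2 := by rw [← hswap]
      _ ≤ (∑ i ∈ I, b i ^ 2) * ∑ i ∈ I, (∑ j ∈ J, c i j * a j) ^ 2 := hcs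
      _ ≤ (∑ i ∈ I, b i ^ 2) * (lam * S) := mul_le_mul_of_nonneg_left (h a) hB0
  rcases hS0.lt_or_eq with hSpos | hS0'
  · have : S * S ≤ (lam * ∑ i ∈ I, b i ^ 2) * S := by nlinarith
    exact le_of_mul_le_mul_right this hSpos
  · rw [← hS0']; positivity

-- shares the heavy set-up conventions of `turanKubilius`; keep the heartbeat budget generous
set_option maxHeartbeats 400000 in
/-- **The dual Turán–Kubilius inequality** (Elliott 1985, Ch. 5, Lemma (5.2) with `σ = 0`):
for all real `a_n` and every `N`,
`∑_{q ≤ N} q |∑_{n ≤ N, q ∥ n} a_n − q⁻¹(1 − 1/p) ∑_{n ≤ N} a_n|² ≤ 69 N ∑_{n ≤ N} |a_n|²`,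
`q = p^k` running over the prime powers `≤ N` (exact division `q ∥ n`). Obtained from
`turanKubilius_coeff` by the duality principle `duality` with the matrix
`c_{n,q} = √q ([q ∥ n] − q⁻¹(1 − 1/p))`. This is the inequality that "will play an important part
in our treatment of the differences of additive functions in Chapter 8" (Elliott, p. 81).
[cite: Elliott1985, Ch. 5, Lemma (5.2)] -/
theorem turanKubilius_dual (a : ℕ → ℝ) (N : ℕ) :
    ∑ q ∈ (Finset.Ioc 0 N).filter IsPrimePow,
        (q : ℝ) * (∑ n ∈ (Finset.Ioc 0 N).filter
              (fun n => n.factorization q.minFac = q.factorization q.minFac), a n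
            - 1 / q * (1 - 1 / (q.minFac : ℝ)) * ∑ n ∈ Finset.Ioc 0 N, a n) ^ 2
      ≤ 69 * N * ∑ n ∈ Finset.Ioc 0 N, a n ^ 2 := by
  classical
  set PP := (Finset.Ioc 0 N).filter IsPrimePow with hPP
  set X : ℕ → ℕ → Prop := fun q n => n.factorization q.minFac = q.factorization q.minFac with hX
  set m : ℕ → ℝ := fun q => 1 / q * (1 - 1 / (q.minFac : ℝ)) with hm
  set c : ℕ → ℕ → ℝ := fun n q => Real.sqrt q * ((if X q n then 1 else 0) - m q) with hc
  have hq0 : ∀ q ∈ PP, (0 : ℝ) < q := fun q hq => by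
    have := (Finset.mem_Ioc.mp (Finset.mem_filter.mp hq).1).1
    exact_mod_cast this
  -- the primal inequality in matrix form
  have hprimal : ∀ x : ℕ → ℝ,
      ∑ n ∈ Finset.Ioc 0 N, (∑ q ∈ PP, c n q * x q) ^ 2 ≤ 69 * N * ∑ q ∈ PP, x q ^ 2 := by
    intro x
    set g : ℕ → ℝ := fun q => Real.sqrt q * x q with hg
    have hTK := turanKubilius_coeff g N
    rw [← hPP] at hTK
    have hD : ∑ q ∈ PP, g q ^ 2 / q = ∑ q ∈ PP, x q ^ 2 := by
      refine Finset.sum_congr rfl fun q hq => ?_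
      simp only [hg]
      rw [mul_pow, Real.sq_sqrt (hq0 q hq).le]
      field_simp [(hq0 q hq).ne']
    rw [hD] at hTK
    refine le_trans (le_of_eq (Finset.sum_congr rfl fun n _ => ?_)) hTK
    congr 1
    symm
    calc (∑ q ∈ PP.filter (fun q => n.factorization q.minFac = q.factorization q.minFac), g q)
          - ∑ q ∈ PP, g q / q * (1 - 1 / (q.minFac : ℝ))
        = (∑ q ∈ PP, if n.factorization q.minFac = q.factorization q.minFac then g q else 0)
          - ∑ q ∈ PP, g q / q * (1 - 1 / (q.minFac : ℝ)) := by rw [Finset.sum_filter]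
      _ = ∑ q ∈ PP, ((if n.factorization q.minFac = q.factorization q.minFac then g q else 0)
          - g q / q * (1 - 1 / (q.minFac : ℝ))) := (Finset.sum_sub_distrib _ _).symm
      _ = ∑ q ∈ PP, c n q * x q := by
          refine Finset.sum_congr rfl fun q _ => ?_
          simp only [hc, hg, hX, hm]
          split_ifs <;> ring
  have hdual := duality (Finset.Ioc 0 N) PP c (by positivity) hprimal a
  refine le_trans (le_of_eq (Finset.sum_congr rfl fun q hq => ?_)) hdual
  -- `(∑_n c_{n,q} a_n)² = q (∑_{q ∥ n} a_n − m_q ∑ a_n)²`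
  have e : Real.sqrt q * (∑ n ∈ (Finset.Ioc 0 N).filter (fun n => X q n), a n
          - m q * ∑ n ∈ Finset.Ioc 0 N, a n) = ∑ n ∈ Finset.Ioc 0 N, c n q * a n := by
    calc Real.sqrt q * (∑ n ∈ (Finset.Ioc 0 N).filter (fun n => X q n), a n
            - m q * ∑ n ∈ Finset.Ioc 0 N, a n)
        = Real.sqrt q * ((∑ n ∈ Finset.Ioc 0 N, if X q n then a n else 0)
            - ∑ n ∈ Finset.Ioc 0 N, m q * a n) := by rw [Finset.sum_filter, Finset.mul_sum]
      _ = Real.sqrt q * ∑ n ∈ Finset.Ioc 0 N, ((if X q n then a n else 0) - m q * a n) := by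
          rw [Finset.sum_sub_distrib]
      _ = ∑ n ∈ Finset.Ioc 0 N, Real.sqrt q * ((if X q n then a n else 0) - m q * a n) := by
          rw [Finset.mul_sum]
      _ = ∑ n ∈ Finset.Ioc 0 N, c n q * a n := by
          refine Finset.sum_congr rfl fun n _ => ?_
          simp only [hc]
          split_ifs <;> ring
  rw [← e, mul_pow, Real.sq_sqrt (hq0 q hq).le]

/-! ### Divisibility by primes: the strongly additive case and the second dual inequality -/

/-- Exact prime-power divisors versus prime divisors: for `1 ≤ n ≤ N` and any `g`,
`∑_{q ≤ N, q ∥ n} g(p(q)) = ∑_{p ∣ n} g(p)` (`p(q) = q.minFac`). [folklore] -/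
theorem sum_filter_exact_minFac (g : ℕ → ℝ) {N n : ℕ} (hn : n ≠ 0) (hnN : n ≤ N) :
    ∑ q ∈ ((Finset.Ioc 0 N).filter IsPrimePow).filter
        (fun q => n.factorization q.minFac = q.factorization q.minFac), g q.minFac
      = ∑ p ∈ n.primeFactors, g p := by
  rw [filter_exact_eq_image hn hnN, Finset.sum_image (injOn_ordProj n)]
  refine Finset.sum_congr rfl fun p hp => ?_
  have hpp : p.Prime := Nat.prime_of_mem_primeFactors hp
  have hv : 0 < n.factorization p :=
    hpp.factorization_pos_of_dvd hn (Nat.dvd_of_mem_primeFactors hp)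
  rw [hpp.pow_minFac hv.ne']

/-- The prime powers `≤ N` listed as `p^k`, `p ≤ N` prime, `1 ≤ k ≤ log_p N`:
`∑_{q ≤ N prime power} h(q) = ∑_{p ≤ N} ∑_{1 ≤ k ≤ log_p N} h(p^k)`. [folklore] -/
theorem sum_primePow_eq_sum_primesLE (h : ℕ → ℝ) (N : ℕ) :
    ∑ q ∈ (Finset.Ioc 0 N).filter IsPrimePow, h q
      = ∑ p ∈ Nat.primesLE N, ∑ k ∈ Finset.Icc 1 (Nat.log p N), h (p ^ k) := by
  classical
  set S := (Nat.primesLE N).sigma (fun p => Finset.Icc 1 (Nat.log p N)) with hS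
  set φ : (Σ _ : ℕ, ℕ) → ℕ := fun x => x.1 ^ x.2 with hφ
  have hinj : Set.InjOn φ (S : Set (Σ _ : ℕ, ℕ)) := by
    rintro ⟨p, k⟩ hx ⟨p', k'⟩ hx' he
    simp only [hS, Finset.coe_sigma, Set.mem_sigma_iff, Finset.mem_coe, Nat.mem_primesLE,
      Finset.mem_Icc] at hx hx'
    simp only [hφ] at he
    have hp := hx.1.2
    have hp' := hx'.1.2
    have h1 : (p ^ k).minFac = p := hp.pow_minFac (by omega)
    have h2 : (p' ^ k').minFac = p' := hp'.pow_minFac (by omega)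
    have hpp' : p = p' := by rw [← h1, ← h2, he]
    subst hpp'
    have hkk' : k = k' := Nat.pow_right_injective hp.two_le he
    subst hkk'
    rfl
  have himage : S.image φ = (Finset.Ioc 0 N).filter IsPrimePow := by
    ext q
    simp only [Finset.mem_image, hS, Finset.mem_sigma, Nat.mem_primesLE, Finset.mem_Icc,
      Finset.mem_filter, Finset.mem_Ioc, hφ]
    constructor
    · rintro ⟨⟨p, k⟩, ⟨⟨hpN, hp⟩, hk1, hkK⟩, rfl⟩
      have hN0 : N ≠ 0 := by
        rintro rfl
        exact absurd hpN (by have := hp.two_le; omega)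
      refine ⟨⟨pow_pos hp.pos k, ?_⟩, ⟨p, k, hp.prime, hk1, rfl⟩⟩
      exact Nat.pow_le_of_le_log hN0 hkK
    · rintro ⟨⟨hq0, hqN⟩, hq⟩
      obtain ⟨hp, hk, e⟩ := primePow_spec hq
      refine ⟨⟨q.minFac, q.factorization q.minFac⟩,
        ⟨⟨(Nat.minFac_le hq0).trans hqN, hp⟩, hk, ?_⟩, e⟩
      exact Nat.le_log_of_pow_le hp.one_lt (e.symm ▸ hqN)
  rw [← himage, Finset.sum_image hinj, hS, Finset.sum_sigma]

/-- The number of multiples of `d` in `(0, N]` among a set of primes: `primesLE N` filtered by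
`p ∣ n` is `n.primeFactors` for `1 ≤ n ≤ N`. [folklore] -/
theorem primesLE_filter_dvd {N n : ℕ} (hn : n ≠ 0) (hnN : n ≤ N) :
    (Nat.primesLE N).filter (fun p => p ∣ n) = n.primeFactors := by
  ext p
  simp only [Finset.mem_filter, Nat.mem_primesLE, Nat.mem_primeFactors]
  constructor
  · rintro ⟨⟨-, hp⟩, hpn⟩
    exact ⟨hp, hpn, hn⟩
  · rintro ⟨hp, hpn, -⟩
    exact ⟨⟨(Nat.le_of_dvd (Nat.pos_of_ne_zero hn) hpn).trans hnN, hp⟩, hpn⟩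

/-- **Turán–Kubilius, strongly additive form** (divisibility by primes): for every real `g` on
the primes and every `N`,
`∑_{n ≤ N} (∑_{p ∣ n} g(p) − ∑_{p ≤ N} g(p)/p)² ≤ 278 · N · ∑_{p ≤ N} g(p)²/p`.
Derived from `turanKubilius_coeff` with the coefficients `q ↦ g(p(q))` on the prime powers
(the additive function with `f(p^k) = g(p)` is strongly additive): the centring constants differ by
`∑_p g(p) p^{-K_p-1}` (`p^{K_p} ≤ N < p^{K_p+1}`), whose square is at most `∑_p g(p)²/p`, and
`∑_{k ≤ K_p} p^{-k} ≤ 2/p`. [cite: Elliott1985, Ch. 1, Lemma (1.5)] -/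
theorem turanKubilius_prime (g : ℕ → ℝ) (N : ℕ) :
    ∑ n ∈ Finset.Ioc 0 N,
        (∑ p ∈ n.primeFactors, g p - ∑ p ∈ Nat.primesLE N, g p / p) ^ 2
      ≤ 278 * N * ∑ p ∈ Nat.primesLE N, g p ^ 2 / p := by
  classical
  set PP := (Finset.Ioc 0 N).filter IsPrimePow with hPP
  set G : ℕ → ℝ := fun q => g q.minFac with hG
  set A := ∑ p ∈ Nat.primesLE N, g p / p with hA
  set B := ∑ q ∈ PP, G q / q * (1 - 1 / (q.minFac : ℝ)) with hB
  set Dg := ∑ p ∈ Nat.primesLE N, g p ^ 2 / p with hDg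
  have hDg0 : 0 ≤ Dg := Finset.sum_nonneg fun p _ => by positivity
  have hNR : (0 : ℝ) ≤ N := Nat.cast_nonneg _
  have hTK := turanKubilius_coeff G N
  rw [← hPP] at hTK
  -- the left side of `hTK` is `∑_n (∑_{p ∣ n} g p − B)²`
  have hL : ∀ n ∈ Finset.Ioc 0 N,
      ∑ q ∈ PP.filter (fun q => n.factorization q.minFac = q.factorization q.minFac), G q
        = ∑ p ∈ n.primeFactors, g p := by
    intro n hn
    rw [Finset.mem_Ioc] at hn
    exact sum_filter_exact_minFac g (by omega) hn.2
  -- facts about each prime `p ≤ N`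
  have hpfacts : ∀ p ∈ Nat.primesLE N, p.Prime ∧ (2 : ℝ) ≤ p ∧ N < p ^ (Nat.log p N + 1) :=
    fun p hp => by
      have hpp := Nat.prime_of_mem_primesLE hp
      exact ⟨hpp, by exact_mod_cast hpp.two_le, Nat.lt_pow_succ_log_self hpp.one_lt N⟩
  -- `B = ∑_p g(p) (1/p − (1/p)^{K_p+1})`
  have hBeq : B = ∑ p ∈ Nat.primesLE N, g p * (1 / p - (1 / (p : ℝ)) ^ (Nat.log p N + 1)) := by
    rw [hB, sum_primePow_eq_sum_primesLE]
    refine Finset.sum_congr rfl fun p hp => ?_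
    obtain ⟨hpp, hp2, -⟩ := hpfacts p hp
    have hterm : ∀ k ∈ Finset.Icc 1 (Nat.log p N),
        G (p ^ k) / (p ^ k : ℕ) * (1 - 1 / ((p ^ k).minFac : ℝ))
          = g p * ((1 / (p : ℝ)) ^ k - (1 / (p : ℝ)) ^ (k + 1)) := by
      intro k hk
      have hk1 : k ≠ 0 := by have := (Finset.mem_Icc.mp hk).1; omega
      simp only [hG]
      rw [hpp.pow_minFac hk1]
      push_cast
      rw [pow_succ, one_div_pow]
      ring
    rw [Finset.sum_congr rfl hterm, ← Finset.mul_sum]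
    congr 1
    -- telescoping
    have htel : ∀ K : ℕ, ∑ k ∈ Finset.Icc 1 K, ((1 / (p : ℝ)) ^ k - (1 / (p : ℝ)) ^ (k + 1))
        = 1 / p - (1 / (p : ℝ)) ^ (K + 1) := by
      intro K
      induction K with
      | zero => simp
      | succ K ih =>
        rw [Finset.sum_Icc_succ_top (by omega), ih]
        ring
    exact htel _
  -- `D_G² ≤ 2 D_g²`
  have hDG : ∑ q ∈ PP, G q ^ 2 / q ≤ 2 * Dg := by
    rw [sum_primePow_eq_sum_primesLE, hDg, Finset.mul_sum]
    refine Finset.sum_le_sum fun p hp => ?_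
    obtain ⟨hpp, hp2, -⟩ := hpfacts p hp
    have hterm : ∀ k ∈ Finset.Icc 1 (Nat.log p N),
        G (p ^ k) ^ 2 / (p ^ k : ℕ) = g p ^ 2 * (1 / (p : ℝ)) ^ k := by
      intro k hk
      have hk1 : k ≠ 0 := by have := (Finset.mem_Icc.mp hk).1; omega
      simp only [hG]
      rw [hpp.pow_minFac hk1]
      push_cast
      rw [one_div_pow, div_eq_mul_one_div]
    rw [Finset.sum_congr rfl hterm, ← Finset.mul_sum]
    have h0 : (0 : ℝ) ≤ 1 / p := by positivity
    have h1 : (1 : ℝ) / p < 1 := by rw [div_lt_one (by linarith)]; linarith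
    have hgeom : ∑ k ∈ Finset.Icc 1 (Nat.log p N), (1 / (p : ℝ)) ^ k ≤ 2 / p := by
      calc ∑ k ∈ Finset.Icc 1 (Nat.log p N), (1 / (p : ℝ)) ^ k
          = ∑ k ∈ Finset.Ico 1 (Nat.log p N + 1), (1 / (p : ℝ)) ^ k := rfl
        _ ≤ (1 / (p : ℝ)) ^ 1 / (1 - 1 / p) := geom_sum_Ico_le_of_lt_one h0 h1
        _ ≤ 2 / p := by
            rw [pow_one, div_le_div_iff₀ (by rw [sub_pos]; exact h1) (by linarith)]
            have : (1 : ℝ) / p * p = 1 := by field_simp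
            nlinarith
    calc g p ^ 2 * ∑ k ∈ Finset.Icc 1 (Nat.log p N), (1 / (p : ℝ)) ^ k
        ≤ g p ^ 2 * (2 / p) := mul_le_mul_of_nonneg_left hgeom (sq_nonneg _)
      _ = 2 * (g p ^ 2 / p) := by ring
  -- `(A − B)² ≤ D_g²`
  have hAB : (A - B) ^ 2 ≤ Dg := by
    have e : A - B = ∑ p ∈ Nat.primesLE N, g p * (1 / (p : ℝ)) ^ (Nat.log p N + 1) := by
      rw [hA, hBeq, ← Finset.sum_sub_distrib]
      refine Finset.sum_congr rfl fun p _ => ?_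
      ring
    rw [e]
    have hcs := Finset.sum_mul_sq_le_sq_mul_sq (Nat.primesLE N) (fun p => g p / Real.sqrt p)
      (fun p => Real.sqrt p * (1 / (p : ℝ)) ^ (Nat.log p N + 1))
    have e1 : ∀ p ∈ Nat.primesLE N,
        g p / Real.sqrt p * (Real.sqrt p * (1 / (p : ℝ)) ^ (Nat.log p N + 1))
          = g p * (1 / (p : ℝ)) ^ (Nat.log p N + 1) := by
      intro p hp
      obtain ⟨-, hp2, -⟩ := hpfacts p hp
      have hs : Real.sqrt p ≠ 0 := (Real.sqrt_pos.mpr (by linarith)).ne'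
      field_simp
    have e2 : ∀ p ∈ Nat.primesLE N, (g p / Real.sqrt p) ^ 2 = g p ^ 2 / p := by
      intro p hp
      rw [div_pow, Real.sq_sqrt (by positivity)]
    have e3 : ∀ p ∈ Nat.primesLE N,
        (Real.sqrt p * (1 / (p : ℝ)) ^ (Nat.log p N + 1)) ^ 2 ≤ (p : ℝ) / ((N : ℝ) * N) := by
      intro p hp
      obtain ⟨hpp, hp2, hNp⟩ := hpfacts p hp
      have hp0 : (0 : ℝ) < p := by linarith
      have hpN : (p : ℝ) ≤ N := by exact_mod_cast Nat.le_of_mem_primesLE hp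
      have hN0 : (0 : ℝ) < N := by linarith
      have hNp' : (N : ℝ) ≤ (p : ℝ) ^ (Nat.log p N + 1) := by exact_mod_cast hNp.le
      have h1 : (1 / (p : ℝ)) ^ (Nat.log p N + 1) ≤ 1 / N := by
        rw [one_div_pow]
        exact one_div_le_one_div_of_le hN0 hNp'
      have h2 : ((1 / (p : ℝ)) ^ (Nat.log p N + 1)) ^ 2 ≤ (1 / (N : ℝ)) ^ 2 :=
        pow_le_pow_left₀ (by positivity) h1 2
      rw [mul_pow, Real.sq_sqrt hp0.le]
      calc (p : ℝ) * ((1 / (p : ℝ)) ^ (Nat.log p N + 1)) ^ 2 ≤ p * (1 / (N : ℝ)) ^ 2 :=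
            mul_le_mul_of_nonneg_left h2 hp0.le
        _ = p / ((N : ℝ) * N) := by
            field_simp
    have hsmall : ∑ p ∈ Nat.primesLE N,
        (Real.sqrt p * (1 / (p : ℝ)) ^ (Nat.log p N + 1)) ^ 2 ≤ 1 := by
      rcases Nat.eq_zero_or_pos N with hN0 | hNpos
      · subst hN0
        simp [Nat.primesLE_zero]
      have hNR' : (0 : ℝ) < N := by exact_mod_cast hNpos
      calc ∑ p ∈ Nat.primesLE N, (Real.sqrt p * (1 / (p : ℝ)) ^ (Nat.log p N + 1)) ^ 2
          ≤ ∑ p ∈ Nat.primesLE N, (p : ℝ) / ((N : ℝ) * N) := Finset.sum_le_sum e3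
        _ ≤ ∑ p ∈ Nat.primesLE N, (N : ℝ) / ((N : ℝ) * N) := by
            refine Finset.sum_le_sum fun p hp => ?_
            apply div_le_div_of_nonneg_right _ (by positivity)
            exact_mod_cast Nat.le_of_mem_primesLE hp
        _ = (Nat.primesLE N).card * (1 / (N : ℝ)) := by
            rw [Finset.sum_const, nsmul_eq_mul]
            congr 1
            field_simp
        _ ≤ N * (1 / (N : ℝ)) := by
            apply mul_le_mul_of_nonneg_right _ (by positivity)
            have : (Nat.primesLE N).card ≤ (Finset.Ioc 0 N).card :=
              Finset.card_le_card fun p hp =>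
                Finset.mem_Ioc.mpr ⟨(Nat.prime_of_mem_primesLE hp).pos,
                  Nat.le_of_mem_primesLE hp⟩
            rw [Nat.card_Ioc, Nat.sub_zero] at this
            exact_mod_cast this
        _ = 1 := by field_simp
    rw [Finset.sum_congr rfl e1, Finset.sum_congr rfl e2] at hcs
    calc (∑ p ∈ Nat.primesLE N, g p * (1 / (p : ℝ)) ^ (Nat.log p N + 1)) ^ 2
        ≤ Dg * ∑ p ∈ Nat.primesLE N, (Real.sqrt p * (1 / (p : ℝ)) ^ (Nat.log p N + 1)) ^ 2 :=
          hcs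
      _ ≤ Dg * 1 := mul_le_mul_of_nonneg_left hsmall hDg0
      _ = Dg := mul_one _
  -- assemble
  have hTK' : ∑ n ∈ Finset.Ioc 0 N, (∑ p ∈ n.primeFactors, g p - B) ^ 2 ≤ 69 * N * (2 * Dg) := by
    calc ∑ n ∈ Finset.Ioc 0 N, (∑ p ∈ n.primeFactors, g p - B) ^ 2
        = ∑ n ∈ Finset.Ioc 0 N,
            (∑ q ∈ PP.filter (fun q => n.factorization q.minFac = q.factorization q.minFac), G q
              - B) ^ 2 := Finset.sum_congr rfl fun n hn => by rw [hL n hn]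
      _ ≤ 69 * N * ∑ q ∈ PP, G q ^ 2 / q := hTK
      _ ≤ 69 * N * (2 * Dg) := mul_le_mul_of_nonneg_left hDG (by positivity)
  calc ∑ n ∈ Finset.Ioc 0 N, (∑ p ∈ n.primeFactors, g p - A) ^ 2
      ≤ ∑ n ∈ Finset.Ioc 0 N, (2 * (∑ p ∈ n.primeFactors, g p - B) ^ 2 + 2 * (A - B) ^ 2) := by
        refine Finset.sum_le_sum fun n _ => ?_
        nlinarith [sq_nonneg (∑ p ∈ n.primeFactors, g p - B + (A - B))]
    _ = 2 * ∑ n ∈ Finset.Ioc 0 N, (∑ p ∈ n.primeFactors, g p - B) ^ 2 + 2 * (N * (A - B) ^ 2) := by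
        rw [Finset.sum_add_distrib, ← Finset.mul_sum, ← Finset.mul_sum, Finset.sum_const,
          Nat.card_Ioc, Nat.sub_zero, nsmul_eq_mul]
    _ ≤ 2 * (69 * N * (2 * Dg)) + 2 * (N * Dg) := by
        have := mul_le_mul_of_nonneg_left hAB hNR
        nlinarith
    _ = 278 * N * Dg := by ring

-- shares the conventions of `turanKubilius_dual`
set_option maxHeartbeats 400000 in
/-- **The dual Turán–Kubilius inequality, divisibility by primes** (Elliott 1985, Ch. 5, second
inequality of Lemma (5.2), `σ = 0`): for all real `a_n` and every `N`,
`∑_{p ≤ N} p |∑_{n ≤ N, p ∣ n} a_n − p⁻¹ ∑_{n ≤ N} a_n|² ≤ 278 N ∑_{n ≤ N} a_n²`. From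
`turanKubilius_prime` by `duality` with the matrix `c_{n,p} = √p ([p ∣ n] − 1/p)`.
[cite: Elliott1985, Ch. 5, Lemma (5.2)] -/
theorem turanKubilius_dual_prime (a : ℕ → ℝ) (N : ℕ) :
    ∑ p ∈ Nat.primesLE N,
        (p : ℝ) * (∑ n ∈ (Finset.Ioc 0 N).filter (fun n => p ∣ n), a n
            - 1 / p * ∑ n ∈ Finset.Ioc 0 N, a n) ^ 2
      ≤ 278 * N * ∑ n ∈ Finset.Ioc 0 N, a n ^ 2 := by
  classical
  set c : ℕ → ℕ → ℝ := fun n p => Real.sqrt p * ((if p ∣ n then 1 else 0) - 1 / p) with hc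
  have hp0 : ∀ p ∈ Nat.primesLE N, (0 : ℝ) < p := fun p hp => by
    exact_mod_cast (Nat.prime_of_mem_primesLE hp).pos
  have hprimal : ∀ x : ℕ → ℝ,
      ∑ n ∈ Finset.Ioc 0 N, (∑ p ∈ Nat.primesLE N, c n p * x p) ^ 2
        ≤ 278 * N * ∑ p ∈ Nat.primesLE N, x p ^ 2 := by
    intro x
    set g : ℕ → ℝ := fun p => Real.sqrt p * x p with hg
    have hTK := turanKubilius_prime g N
    have hD : ∑ p ∈ Nat.primesLE N, g p ^ 2 / p = ∑ p ∈ Nat.primesLE N, x p ^ 2 := by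
      refine Finset.sum_congr rfl fun p hp => ?_
      simp only [hg]
      rw [mul_pow, Real.sq_sqrt (hp0 p hp).le]
      field_simp [(hp0 p hp).ne']
    rw [hD] at hTK
    refine le_trans (le_of_eq (Finset.sum_congr rfl fun n hn => ?_)) hTK
    rw [Finset.mem_Ioc] at hn
    congr 1
    symm
    calc ∑ p ∈ n.primeFactors, g p - ∑ p ∈ Nat.primesLE N, g p / p
        = (∑ p ∈ (Nat.primesLE N).filter (fun p => p ∣ n), g p)
            - ∑ p ∈ Nat.primesLE N, g p / p := by
          rw [primesLE_filter_dvd (by omega) hn.2]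
      _ = (∑ p ∈ Nat.primesLE N, if p ∣ n then g p else 0)
            - ∑ p ∈ Nat.primesLE N, g p / p := by rw [Finset.sum_filter]
      _ = ∑ p ∈ Nat.primesLE N, ((if p ∣ n then g p else 0) - g p / p) :=
          (Finset.sum_sub_distrib _ _).symm
      _ = ∑ p ∈ Nat.primesLE N, c n p * x p := by
          refine Finset.sum_congr rfl fun p _ => ?_
          simp only [hc, hg]
          split_ifs <;> ring
  have hdual := duality (Finset.Ioc 0 N) (Nat.primesLE N) c (by positivity) hprimal a
  refine le_trans (le_of_eq (Finset.sum_congr rfl fun p hp => ?_)) hdual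
  have e : Real.sqrt p * (∑ n ∈ (Finset.Ioc 0 N).filter (fun n => p ∣ n), a n
          - 1 / p * ∑ n ∈ Finset.Ioc 0 N, a n) = ∑ n ∈ Finset.Ioc 0 N, c n p * a n := by
    calc Real.sqrt p * (∑ n ∈ (Finset.Ioc 0 N).filter (fun n => p ∣ n), a n
            - 1 / p * ∑ n ∈ Finset.Ioc 0 N, a n)
        = Real.sqrt p * ((∑ n ∈ Finset.Ioc 0 N, if p ∣ n then a n else 0)
            - ∑ n ∈ Finset.Ioc 0 N, 1 / (p : ℝ) * a n) := by rw [Finset.sum_filter, Finset.mul_sum]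
      _ = Real.sqrt p * ∑ n ∈ Finset.Ioc 0 N, ((if p ∣ n then a n else 0) - 1 / (p : ℝ) * a n) := by
          rw [Finset.sum_sub_distrib]
      _ = ∑ n ∈ Finset.Ioc 0 N, Real.sqrt p * ((if p ∣ n then a n else 0) - 1 / (p : ℝ) * a n) := by
          rw [Finset.mul_sum]
      _ = ∑ n ∈ Finset.Ioc 0 N, c n p * a n := by
          refine Finset.sum_congr rfl fun n _ => ?_
          simp only [hc]
          split_ifs <;> ring
  rw [← e, mul_pow, Real.sq_sqrt (hp0 p hp).le]

/-! ### Centring at `A(N) = ∑ f(q)/q` -/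

/-- **Turán–Kubilius with the simpler centring `A(N) = ∑_{q ≤ N} f(q)/q`** (the form in most
textbooks): for every real additive `f` and every `N`,
`∑_{n ≤ N} (f(n) − ∑_{q ≤ N} f(q)/q)² ≤ 140 · N · ∑_{q ≤ N} f(q)²/q`.
From `turanKubilius`: `E(N) − A(N) = −∑_q f(q)/(q p)` and, by Cauchy–Schwarz,
`(E − A)² ≤ D² ∑_{p^k ≤ N} p^{-k-2} ≤ D²`. [cite: Elliott1985, Ch. 1, Lemma (1.5)] -/
theorem turanKubilius_centred (f : ℕ → ℝ) (hf : IsAdditiveArith f) (N : ℕ) :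
    ∑ n ∈ Finset.Ioc 0 N,
        (f n - ∑ q ∈ (Finset.Ioc 0 N).filter IsPrimePow, f q / q) ^ 2
      ≤ 140 * N * ∑ q ∈ (Finset.Ioc 0 N).filter IsPrimePow, f q ^ 2 / q := by
  classical
  set PP := (Finset.Ioc 0 N).filter IsPrimePow with hPP
  set E := ∑ q ∈ PP, f q / q * (1 - 1 / (q.minFac : ℝ)) with hE
  set A := ∑ q ∈ PP, f q / q with hA
  set Dsq := ∑ q ∈ PP, f q ^ 2 / q with hDsq
  have hDsq0 : 0 ≤ Dsq := Finset.sum_nonneg fun q _ => by positivity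
  have hNR : (0 : ℝ) ≤ N := Nat.cast_nonneg _
  have hTK := turanKubilius f hf N
  rw [← hPP] at hTK
  have hq0 : ∀ q ∈ PP, (0 : ℝ) < q := fun q hq => by
    exact_mod_cast (Finset.mem_Ioc.mp (Finset.mem_filter.mp hq).1).1
  -- `E − A = −∑ f(q)/(q p)`
  have hEA : E - A = -∑ q ∈ PP, f q / q * (1 / (q.minFac : ℝ)) := by
    rw [hE, hA, ← Finset.sum_sub_distrib, ← Finset.sum_neg_distrib]
    refine Finset.sum_congr rfl fun q _ => ?_
    ring
  -- Cauchy–Schwarz: `(E − A)² ≤ Dsq · ∑_q 1/(q p²)`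
  have hcs := Finset.sum_mul_sq_le_sq_mul_sq PP (fun q => f q / Real.sqrt q)
    (fun q => 1 / (Real.sqrt q * q.minFac))
  have e1 : ∀ q ∈ PP, f q / Real.sqrt q * (1 / (Real.sqrt q * q.minFac))
      = f q / q * (1 / (q.minFac : ℝ)) := by
    intro q hq
    have hs : Real.sqrt q ≠ 0 := (Real.sqrt_pos.mpr (hq0 q hq)).ne'
    have hp0 : (q.minFac : ℝ) ≠ 0 := by
      have := (primePow_spec (Finset.mem_filter.mp hq).2).1.pos
      positivity
    rw [div_mul_div_comm, mul_one, ← mul_assoc, Real.mul_self_sqrt (hq0 q hq).le]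
    field_simp
  have e2 : ∀ q ∈ PP, (f q / Real.sqrt q) ^ 2 = f q ^ 2 / q := by
    intro q hq
    rw [div_pow, Real.sq_sqrt (hq0 q hq).le]
  have e3 : ∀ q ∈ PP,
      (1 / (Real.sqrt q * q.minFac)) ^ 2 = 1 / ((q : ℝ) * (q.minFac : ℝ) ^ 2) := by
    intro q hq
    rw [div_pow, one_pow, mul_pow, Real.sq_sqrt (hq0 q hq).le]
  rw [Finset.sum_congr rfl e1, Finset.sum_congr rfl e2, Finset.sum_congr rfl e3] at hcs
  -- `∑_{p^k ≤ N} 1/(p^k p²) ≤ ∑_p 2/p³ ≤ ∑_p 1/(p(p−1)) ≤ 1`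
  have htail : ∑ q ∈ PP, 1 / ((q : ℝ) * (q.minFac : ℝ) ^ 2) ≤ 1 := by
    rw [hPP, sum_primePow_eq_sum_primesLE]
    refine le_trans (Finset.sum_le_sum fun p hp => ?_)
      (Literature.NumberTheory.LFunctions.MertensBound.sum_inv_prime_mul_pred_le_one N)
    have hpp := Nat.prime_of_mem_primesLE hp
    have hp2 : (2 : ℝ) ≤ p := by exact_mod_cast hpp.two_le
    have hterm : ∀ k ∈ Finset.Icc 1 (Nat.log p N),
        1 / (((p ^ k : ℕ) : ℝ) * (((p ^ k).minFac : ℕ) : ℝ) ^ 2)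
          = (1 / (p : ℝ)) ^ 2 * (1 / (p : ℝ)) ^ k := by
      intro k hk
      have hk1 : k ≠ 0 := by have := (Finset.mem_Icc.mp hk).1; omega
      rw [hpp.pow_minFac hk1]
      push_cast
      rw [one_div_pow, one_div_pow]
      field_simp
    rw [Finset.sum_congr rfl hterm, ← Finset.mul_sum]
    have h0 : (0 : ℝ) ≤ 1 / p := by positivity
    have h1 : (1 : ℝ) / p < 1 := by rw [div_lt_one (by linarith)]; linarith
    have hgeom : ∑ k ∈ Finset.Icc 1 (Nat.log p N), (1 / (p : ℝ)) ^ k ≤ 2 / p := by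
      calc ∑ k ∈ Finset.Icc 1 (Nat.log p N), (1 / (p : ℝ)) ^ k
          = ∑ k ∈ Finset.Ico 1 (Nat.log p N + 1), (1 / (p : ℝ)) ^ k := rfl
        _ ≤ (1 / (p : ℝ)) ^ 1 / (1 - 1 / p) := geom_sum_Ico_le_of_lt_one h0 h1
        _ ≤ 2 / p := by
            rw [pow_one, div_le_div_iff₀ (by rw [sub_pos]; exact h1) (by linarith)]
            have : (1 : ℝ) / p * p = 1 := by field_simp
            nlinarith
    calc (1 / (p : ℝ)) ^ 2 * ∑ k ∈ Finset.Icc 1 (Nat.log p N), (1 / (p : ℝ)) ^ k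
        ≤ (1 / (p : ℝ)) ^ 2 * (2 / p) := mul_le_mul_of_nonneg_left hgeom (by positivity)
      _ ≤ 1 / (p * (p - 1)) := by
          rw [div_pow, one_pow, div_mul_div_comm, one_mul,
            div_le_div_iff₀ (by positivity) (by nlinarith)]
          nlinarith
  have hEA2 : (E - A) ^ 2 ≤ Dsq := by
    rw [hEA, neg_sq]
    calc (∑ q ∈ PP, f q / q * (1 / (q.minFac : ℝ))) ^ 2
        ≤ Dsq * ∑ q ∈ PP, 1 / ((q : ℝ) * (q.minFac : ℝ) ^ 2) := hcs
      _ ≤ Dsq * 1 := mul_le_mul_of_nonneg_left htail hDsq0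
      _ = Dsq := mul_one _
  calc ∑ n ∈ Finset.Ioc 0 N, (f n - A) ^ 2
      ≤ ∑ n ∈ Finset.Ioc 0 N, (2 * (f n - E) ^ 2 + 2 * (E - A) ^ 2) := by
        refine Finset.sum_le_sum fun n _ => ?_
        nlinarith [sq_nonneg (f n - E - (E - A))]
    _ = 2 * ∑ n ∈ Finset.Ioc 0 N, (f n - E) ^ 2 + 2 * (N * (E - A) ^ 2) := by
        rw [Finset.sum_add_distrib, ← Finset.mul_sum, ← Finset.mul_sum, Finset.sum_const,
          Nat.card_Ioc, Nat.sub_zero, nsmul_eq_mul]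
    _ ≤ 2 * (69 * N * Dsq) + 2 * (N * Dsq) := by
        have := mul_le_mul_of_nonneg_left hEA2 hNR
        nlinarith
    _ = 140 * N * Dsq := by ring

/-! ### The weighted inequality (Lemma (1.5), `0 ≤ σ < 1`) — auxiliary lemmas -/

/-- Mertens in a window, prime powers: for `2 ≤ M ≤ N`,
`∑_{M < q ≤ N, q prime power} 1/q ≤ log log N − log log M + 15`. [folklore] -/
theorem sum_inv_primePow_window_le {M N : ℕ} (hM : 2 ≤ M) (hMN : M ≤ N) :
    ∑ q ∈ ((Finset.Ioc 0 N).filter IsPrimePow).filter (fun q => M < q), (1 : ℝ) / q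
      ≤ Real.log (Real.log N) - Real.log (Real.log M) + 15 := by
  classical
  set S := ((Finset.Ioc 0 N).filter IsPrimePow).filter (fun q => M < q) with hS
  have hN2 : 2 ≤ N := hM.trans hMN
  have hMR : (2 : ℝ) ≤ M := by exact_mod_cast hM
  rw [← Finset.sum_filter_add_sum_filter_not S Nat.Prime]
  have hB : ∑ q ∈ S.filter (fun q => ¬ q.Prime), (1 : ℝ) / q ≤ 1 := by
    refine le_trans (Finset.sum_le_sum_of_subset_of_nonneg ?_ fun q _ _ => by positivity)
      (sum_inv_properPrimePow_le_one N)
    intro q hq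
    simp only [hS, Finset.mem_filter] at hq ⊢
    exact ⟨hq.1.1, hq.2⟩
  have hA : ∑ q ∈ S.filter Nat.Prime, (1 : ℝ) / q
      ≤ ∑ p ∈ Nat.primesLE N, (1 : ℝ) / p - ∑ p ∈ Nat.primesLE M, (1 : ℝ) / p := by
    have hsplit : Nat.primesLE N = Nat.primesLE M ∪ S.filter Nat.Prime := by
      ext p
      simp only [Finset.mem_union, Nat.mem_primesLE, hS, Finset.mem_filter, Finset.mem_Ioc]
      constructor
      · rintro ⟨hpN, hp⟩
        by_cases h : p ≤ M
        · exact Or.inl ⟨h, hp⟩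
        · exact Or.inr ⟨⟨⟨⟨hp.pos, hpN⟩, hp.isPrimePow⟩, by omega⟩, hp⟩
      · rintro (⟨hpM, hp⟩ | ⟨⟨⟨⟨-, hpN⟩, -⟩, -⟩, hp⟩)
        · exact ⟨hpM.trans hMN, hp⟩
        · exact ⟨hpN, hp⟩
    have hdisj : Disjoint (Nat.primesLE M) (S.filter Nat.Prime) := by
      rw [Finset.disjoint_left]
      intro p hp hp'
      simp only [Nat.mem_primesLE] at hp
      simp only [hS, Finset.mem_filter] at hp'
      omega
    rw [hsplit, Finset.sum_union hdisj]
    linarith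
  have hupper := Literature.NumberTheory.LFunctions.MertensBound.sum_inv_prime_le N hN2
  have hlower' :=
    Literature.NumberTheory.LFunctions.MertensBound.loglog_sub_loglog_le_sum_inv_prime
      (P := 2) (Q := (M : ℝ)) le_rfl hMR
  have hlower : Real.log (Real.log M) - Real.log (Real.log 2) - 6 / Real.log 2
      ≤ ∑ p ∈ Nat.primesLE M, (1 : ℝ) / p := by
    refine hlower'.trans (Finset.sum_le_sum_of_subset_of_nonneg ?_ fun p _ _ => by positivity)
    intro p hp
    simp only [Finset.mem_filter, Finset.mem_Ioc, Nat.floor_natCast] at hp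
    exact Nat.mem_primesLE.mpr ⟨hp.1.2, hp.2⟩
  have hlog2 : 0.6931471803 < Real.log 2 := Real.log_two_gt_d9
  have hlog2' : Real.log 2 < 0.6931471808 := Real.log_two_lt_d9
  have hloglog2 : Real.log (Real.log 2) ≤ 0 := Real.log_nonpos (by linarith) (by linarith)
  have h6 : 6 / Real.log 2 < 8.7 := by rw [div_lt_iff₀ (by linarith)]; linarith
  linarith

/-- All prime powers: for `N ≥ 2`, `∑_{q ≤ N, q prime power} 1/q ≤ log log N + 5`. [folklore] -/
theorem sum_inv_primePow_le {N : ℕ} (hN : 2 ≤ N) :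
    ∑ q ∈ (Finset.Ioc 0 N).filter IsPrimePow, (1 : ℝ) / q ≤ Real.log (Real.log N) + 5 := by
  classical
  set S := (Finset.Ioc 0 N).filter IsPrimePow with hS
  rw [← Finset.sum_filter_add_sum_filter_not S Nat.Prime]
  have hB : ∑ q ∈ S.filter (fun q => ¬ q.Prime), (1 : ℝ) / q ≤ 1 :=
    sum_inv_properPrimePow_le_one N
  have hA : ∑ q ∈ S.filter Nat.Prime, (1 : ℝ) / q ≤ Real.log (Real.log N) + 4 := by
    have hset : S.filter Nat.Prime = Nat.primesLE N := by
      ext p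
      simp only [hS, Finset.mem_filter, Finset.mem_Ioc, Nat.mem_primesLE]
      constructor
      · rintro ⟨⟨⟨-, hpN⟩, -⟩, hp⟩; exact ⟨hpN, hp⟩
      · rintro ⟨hpN, hp⟩; exact ⟨⟨⟨hp.pos, hpN⟩, hp.isPrimePow⟩, hp⟩
    rw [hset]
    exact Literature.NumberTheory.LFunctions.MertensBound.sum_inv_prime_le N hN
  linarith

/-- Dyadic decomposition of `(0, N]`: for every `J`,
`∑_{n ≤ N} h(n) = ∑_{j < J} ∑_{N/2^{j+1} < n ≤ N/2^j} h(n) + ∑_{n ≤ N/2^J} h(n)`. [folklore] -/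
theorem sum_Ioc_dyadic (h : ℕ → ℝ) (N : ℕ) :
    ∀ J : ℕ, ∑ n ∈ Finset.Ioc 0 N, h n
      = ∑ j ∈ Finset.range J, ∑ n ∈ Finset.Ioc (N / 2 ^ (j + 1)) (N / 2 ^ j), h n
        + ∑ n ∈ Finset.Ioc 0 (N / 2 ^ J), h n := by
  intro J
  induction J with
  | zero => simp
  | succ J ih =>
    rw [ih, Finset.sum_range_succ, add_assoc]
    congr 1
    have hle : N / 2 ^ (J + 1) ≤ N / 2 ^ J :=
      Nat.div_le_div_left (Nat.pow_le_pow_right (by norm_num) (Nat.le_succ J)) (by positivity)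
    rw [← Finset.sum_Ioc_consecutive h (Nat.zero_le _) hle, add_comm]

/-- **Partial variance against the full centring.** For `M ≤ N` and real additive `f`,
`∑_{n ≤ M} (f(n) − E(N))² ≤ 138 M D(N)² + 2 M D(N)² ∑_{M < q ≤ N} 1/q`:
Turán–Kubilius on `(0, M]` plus `(E(N) − E(M))² ≤ D(N)² ∑_{M<q≤N} 1/q` (Cauchy–Schwarz).
[cite: Elliott1985, Ch. 1, Lemma (1.5)] -/
theorem partialVariance_le (f : ℕ → ℝ) (hf : IsAdditiveArith f) {M N : ℕ} (hMN : M ≤ N) :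
    ∑ n ∈ Finset.Ioc 0 M,
        (f n - ∑ q ∈ (Finset.Ioc 0 N).filter IsPrimePow, f q / q * (1 - 1 / (q.minFac : ℝ))) ^ 2
      ≤ 138 * M * ∑ q ∈ (Finset.Ioc 0 N).filter IsPrimePow, f q ^ 2 / q
        + 2 * M * (∑ q ∈ (Finset.Ioc 0 N).filter IsPrimePow, f q ^ 2 / q)
          * ∑ q ∈ ((Finset.Ioc 0 N).filter IsPrimePow).filter (fun q => M < q), (1 : ℝ) / q := by
  classical
  set PPN := (Finset.Ioc 0 N).filter IsPrimePow with hPPN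
  set PPM := (Finset.Ioc 0 M).filter IsPrimePow with hPPM
  set EN := ∑ q ∈ PPN, f q / q * (1 - 1 / (q.minFac : ℝ)) with hEN
  set EM := ∑ q ∈ PPM, f q / q * (1 - 1 / (q.minFac : ℝ)) with hEM
  set DN := ∑ q ∈ PPN, f q ^ 2 / q with hDN
  set W := ∑ q ∈ PPN.filter (fun q => M < q), (1 : ℝ) / q with hW
  have hDN0 : 0 ≤ DN := Finset.sum_nonneg fun q _ => by positivity
  have hMR : (0 : ℝ) ≤ M := Nat.cast_nonneg _
  have hq0 : ∀ q ∈ PPN, (0 : ℝ) < q := fun q hq => by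
    exact_mod_cast (Finset.mem_Ioc.mp (Finset.mem_filter.mp hq).1).1
  -- `PP M` is the part of `PP N` below `M`
  have hsplit : PPM = PPN.filter (fun q => ¬ M < q) := by
    ext q
    simp only [hPPM, hPPN, Finset.mem_filter, Finset.mem_Ioc, not_lt]
    constructor
    · rintro ⟨⟨hq0, hqM⟩, hq⟩; exact ⟨⟨⟨hq0, hqM.trans hMN⟩, hq⟩, hqM⟩
    · rintro ⟨⟨⟨hq0, -⟩, hq⟩, hqM⟩; exact ⟨⟨hq0, hqM⟩, hq⟩
  have hsubM : PPM ⊆ PPN := by rw [hsplit]; exact Finset.filter_subset _ _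
  -- Turán–Kubilius on `(0, M]`
  have hTK := turanKubilius f hf M
  rw [← hPPM] at hTK
  have hDM : ∑ q ∈ PPM, f q ^ 2 / q ≤ DN :=
    Finset.sum_le_sum_of_subset_of_nonneg hsubM fun q _ _ => by positivity
  -- `E(N) − E(M) = ∑_{M < q ≤ N} f(q) m(q)`
  have hEdiff : EN - EM = ∑ q ∈ PPN.filter (fun q => M < q), f q / q * (1 - 1 / (q.minFac : ℝ)) := by
    rw [hEN, hEM, hsplit, ← Finset.sum_filter_add_sum_filter_not PPN (fun q => M < q)]
    ring
  -- Cauchy–Schwarz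
  have hcs := Finset.sum_mul_sq_le_sq_mul_sq (PPN.filter (fun q => M < q))
    (fun q => f q / Real.sqrt q) (fun q => Real.sqrt q * (1 / q * (1 - 1 / (q.minFac : ℝ))))
  have e1 : ∀ q ∈ PPN.filter (fun q => M < q),
      f q / Real.sqrt q * (Real.sqrt q * (1 / q * (1 - 1 / (q.minFac : ℝ))))
        = f q / q * (1 - 1 / (q.minFac : ℝ)) := by
    intro q hq
    have hs : Real.sqrt q ≠ 0 := (Real.sqrt_pos.mpr (hq0 q (Finset.mem_filter.mp hq).1)).ne'
    field_simp
  have e2 : ∀ q ∈ PPN.filter (fun q => M < q), (f q / Real.sqrt q) ^ 2 = f q ^ 2 / q := by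
    intro q hq
    rw [div_pow, Real.sq_sqrt (hq0 q (Finset.mem_filter.mp hq).1).le]
  have e3 : ∀ q ∈ PPN.filter (fun q => M < q),
      (Real.sqrt q * (1 / q * (1 - 1 / (q.minFac : ℝ)))) ^ 2 ≤ 1 / q := by
    intro q hq
    have hqP := (Finset.mem_filter.mp hq).1
    have hq0' := hq0 q hqP
    obtain ⟨hp, -, -⟩ := primePow_spec (Finset.mem_filter.mp hqP).2
    have hp2 : (2 : ℝ) ≤ q.minFac := by exact_mod_cast hp.two_le
    have h1 : (0 : ℝ) ≤ 1 - 1 / (q.minFac : ℝ) := by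
      rw [sub_nonneg, div_le_one (by linarith)]; linarith
    have h2 : 1 - 1 / (q.minFac : ℝ) ≤ 1 := by
      have : (0 : ℝ) ≤ 1 / (q.minFac : ℝ) := by positivity
      linarith
    rw [mul_pow, Real.sq_sqrt hq0'.le]
    have hqq : (q : ℝ) * (1 / (q : ℝ)) ^ 2 = 1 / (q : ℝ) := by field_simp
    calc (q : ℝ) * (1 / (q : ℝ) * (1 - 1 / (q.minFac : ℝ))) ^ 2
        = ((q : ℝ) * (1 / (q : ℝ)) ^ 2) * (1 - 1 / (q.minFac : ℝ)) ^ 2 := by ring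
      _ = 1 / (q : ℝ) * (1 - 1 / (q.minFac : ℝ)) ^ 2 := by rw [hqq]
      _ ≤ 1 / (q : ℝ) * 1 := by
          apply mul_le_mul_of_nonneg_left _ (by positivity)
          nlinarith
      _ = 1 / (q : ℝ) := mul_one _
  rw [Finset.sum_congr rfl e1, Finset.sum_congr rfl e2] at hcs
  have hDW : ∑ q ∈ PPN.filter (fun q => M < q), f q ^ 2 / q ≤ DN :=
    Finset.sum_le_sum_of_subset_of_nonneg (Finset.filter_subset _ _) fun q _ _ => by positivity
  have hEdiff2 : (EN - EM) ^ 2 ≤ DN * W := by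
    rw [hEdiff]
    calc (∑ q ∈ PPN.filter (fun q => M < q), f q / q * (1 - 1 / (q.minFac : ℝ))) ^ 2
        ≤ (∑ q ∈ PPN.filter (fun q => M < q), f q ^ 2 / q)
            * ∑ q ∈ PPN.filter (fun q => M < q),
                (Real.sqrt q * (1 / q * (1 - 1 / (q.minFac : ℝ)))) ^ 2 := hcs
      _ ≤ DN * W :=
          mul_le_mul hDW (Finset.sum_le_sum e3) (Finset.sum_nonneg fun q _ => sq_nonneg _) hDN0
  -- assemble
  calc ∑ n ∈ Finset.Ioc 0 M, (f n - EN) ^ 2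
      ≤ ∑ n ∈ Finset.Ioc 0 M, (2 * (f n - EM) ^ 2 + 2 * (EN - EM) ^ 2) := by
        refine Finset.sum_le_sum fun n _ => ?_
        nlinarith [sq_nonneg (f n - EM + (EN - EM))]
    _ = 2 * ∑ n ∈ Finset.Ioc 0 M, (f n - EM) ^ 2 + 2 * (M * (EN - EM) ^ 2) := by
        rw [Finset.sum_add_distrib, ← Finset.mul_sum, ← Finset.mul_sum, Finset.sum_const,
          Nat.card_Ioc, Nat.sub_zero, nsmul_eq_mul]
    _ ≤ 2 * (69 * M * DN) + 2 * (M * (DN * W)) := by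
        have h1 : ∑ n ∈ Finset.Ioc 0 M, (f n - EM) ^ 2 ≤ 69 * M * DN :=
          hTK.trans (mul_le_mul_of_nonneg_left hDM (by positivity))
        have h2 := mul_le_mul_of_nonneg_left hEdiff2 hMR
        linarith
    _ = 138 * M * DN + 2 * M * DN * W := by ring

-- one long computation; generous heartbeats
set_option maxHeartbeats 1000000 in
/-- **The weighted Turán–Kubilius inequality** (Elliott 1985, Ch. 1, Lemma (1.5)): for
`0 ≤ σ < 1` there is `C = C(σ)` such that for every real additive `f` and every `N`,
`∑_{n ≤ N} n^{-σ} (f(n) − E(N))² ≤ C · N^{1−σ} · D(N)²` ("the implied constant depends only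
upon `σ`"). Not Elliott's proof (a rerun of Turán's method with the weights `n^{-σ}`) but a
dyadic derivation from the case `σ = 0`: on the block `N/2^{j+1} < n ≤ N/2^j` the weight is
`≤ (N/2^{j+1})^{-σ}`, and `∑_{n ≤ M} (f(n) − E(N))² ≤ M D(N)² (138 + 2 ∑_{M<q≤N} 1/q)`
(`partialVariance_le`), the window sum being `≤ log(log N/log M) + 15 ≤ log(2/(1−σ)) + 15` as long
as `M ≥ N^{(1−σ)/2}` (`sum_inv_primePow_window_le`); the deeper blocks contribute
`O_σ((log N)² N^{(1−σ)/2} D²)`. The constant produced is crude and explicit in `σ`.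
[cite: Elliott1985, Ch. 1, Lemma (1.5)] -/
theorem turanKubilius_weighted {σ : ℝ} (hσ0 : 0 ≤ σ) (hσ1 : σ < 1) :
    ∃ C : ℝ, 0 < C ∧ ∀ (f : ℕ → ℝ), IsAdditiveArith f → ∀ N : ℕ,
      ∑ n ∈ Finset.Ioc 0 N, (n : ℝ) ^ (-σ) *
          (f n - ∑ q ∈ (Finset.Ioc 0 N).filter IsPrimePow,
              f q / q * (1 - 1 / (q.minFac : ℝ))) ^ 2
        ≤ C * (N : ℝ) ^ (1 - σ) * ∑ q ∈ (Finset.Ioc 0 N).filter IsPrimePow, f q ^ 2 / q := by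
  classical
  -- the constants
  set θ : ℝ := (1 - σ) / 2 with hθ
  have hθ0 : 0 < θ := by rw [hθ]; linarith
  have hθ1 : θ ≤ 1 := by rw [hθ]; linarith
  set T : ℝ := max 3 ((2 : ℝ) ^ (1 / θ)) with hT
  have hT3 : (3 : ℝ) ≤ T := le_max_left _ _
  have hT0 : 0 < T := by linarith
  set r : ℝ := (2 : ℝ) ^ (σ - 1) with hr
  have hr0 : 0 < r := Real.rpow_pos_of_pos two_pos _
  have hr1 : r < 1 := Real.rpow_lt_one_of_one_lt_of_neg one_lt_two (by linarith)
  set G : ℝ := r / (1 - r) with hG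
  have hG0 : 0 < G := div_pos hr0 (by linarith)
  have hlogθ : 0 ≤ Real.log (1 / θ) :=
    Real.log_nonneg (by rw [le_div_iff₀ hθ0]; linarith)
  set K₁ : ℝ := 168 + 2 * Real.log (1 / θ) with hK₁
  have hK₁0 : 0 < K₁ := by rw [hK₁]; linarith
  set K₂ : ℝ := 7200 / θ ^ 2 with hK₂
  have hK₂0 : 0 < K₂ := by positivity
  have hTσ : 0 < T ^ σ := Real.rpow_pos_of_pos hT0 _
  refine ⟨69 * T ^ σ + 2 * K₁ * G + K₂ + 1, by positivity, ?_⟩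
  intro f hf N
  set PP := (Finset.Ioc 0 N).filter IsPrimePow with hPP
  set E := ∑ q ∈ PP, f q / q * (1 - 1 / (q.minFac : ℝ)) with hE
  set Dsq := ∑ q ∈ PP, f q ^ 2 / q with hDsq
  have hDsq0 : 0 ≤ Dsq := Finset.sum_nonneg fun q _ => by positivity
  have hNR : (0 : ℝ) ≤ N := Nat.cast_nonneg _
  -- weights
  have hw0 : ∀ n : ℕ, 0 ≤ (n : ℝ) ^ (-σ) := fun n => Real.rpow_nonneg (Nat.cast_nonneg _) _
  have hw1 : ∀ n ∈ Finset.Ioc 0 N, (n : ℝ) ^ (-σ) ≤ 1 := fun n hn =>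
    Real.rpow_le_one_of_one_le_of_nonpos (by exact_mod_cast (Finset.mem_Ioc.mp hn).1)
      (by linarith)
  -- partial variances `A(M) ≤ 138 M Dsq + 2 M Dsq W(M)`
  have hA : ∀ M : ℕ, M ≤ N → ∑ n ∈ Finset.Ioc 0 M, (f n - E) ^ 2
      ≤ 138 * M * Dsq + 2 * M * Dsq * ∑ q ∈ PP.filter (fun q => M < q), (1 : ℝ) / q :=
    fun M hM => partialVariance_le f hf hM
  have hpow1 : (N : ℝ) ^ (1 - σ) * (N : ℝ) ^ σ = N := by
    rcases Nat.eq_zero_or_pos N with h0 | hpos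
    · subst h0
      simp [Real.zero_rpow (by linarith : (1 : ℝ) - σ ≠ 0)]
    · rw [← Real.rpow_add (by exact_mod_cast hpos)]
      norm_num
  have hNpow0 : 0 ≤ (N : ℝ) ^ (1 - σ) := Real.rpow_nonneg hNR _
  by_cases hsmall : (N : ℝ) < T
  · -- small `N`: `∑ ≤ A(N) ≤ 69 N Dsq ≤ 69 T^σ N^{1−σ} Dsq`
    have hTK := turanKubilius f hf N
    rw [← hPP] at hTK
    have h1 : ∑ n ∈ Finset.Ioc 0 N, (n : ℝ) ^ (-σ) * (f n - E) ^ 2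
        ≤ ∑ n ∈ Finset.Ioc 0 N, (f n - E) ^ 2 := by
      refine Finset.sum_le_sum fun n hn => ?_
      calc (n : ℝ) ^ (-σ) * (f n - E) ^ 2 ≤ 1 * (f n - E) ^ 2 :=
            mul_le_mul_of_nonneg_right (hw1 n hn) (sq_nonneg _)
        _ = (f n - E) ^ 2 := one_mul _
    have h2 : (N : ℝ) ≤ T ^ σ * (N : ℝ) ^ (1 - σ) := by
      have : (N : ℝ) ^ σ ≤ T ^ σ := Real.rpow_le_rpow hNR hsmall.le hσ0
      calc (N : ℝ) = (N : ℝ) ^ (1 - σ) * (N : ℝ) ^ σ := hpow1.symm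
        _ ≤ (N : ℝ) ^ (1 - σ) * T ^ σ := mul_le_mul_of_nonneg_left this hNpow0
        _ = T ^ σ * (N : ℝ) ^ (1 - σ) := mul_comm _ _
    calc ∑ n ∈ Finset.Ioc 0 N, (n : ℝ) ^ (-σ) * (f n - E) ^ 2
        ≤ 69 * N * Dsq := h1.trans hTK
      _ ≤ 69 * (T ^ σ * (N : ℝ) ^ (1 - σ)) * Dsq := by
          apply mul_le_mul_of_nonneg_right _ hDsq0
          linarith
      _ ≤ (69 * T ^ σ + 2 * K₁ * G + K₂ + 1) * (N : ℝ) ^ (1 - σ) * Dsq := by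
          have : 0 ≤ (2 * K₁ * G + K₂ + 1) * ((N : ℝ) ^ (1 - σ) * Dsq) := by positivity
          nlinarith
  -- large `N`
  push Not at hsmall
  have hN3 : (3 : ℝ) ≤ N := hT3.trans hsmall
  have hN0 : (0 : ℝ) < N := by linarith
  have hN2 : 2 ≤ N := by exact_mod_cast (show (2 : ℝ) ≤ N by linarith)
  have hlogN : 1 ≤ Real.log N := by
    rw [Real.le_log_iff_exp_le hN0]
    have := Real.exp_one_lt_d9
    linarith
  have hloglogN : 0 ≤ Real.log (Real.log N) := Real.log_nonneg hlogN
  have hNθ2 : (2 : ℝ) ≤ (N : ℝ) ^ θ := by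
    have h1 : (2 : ℝ) ^ (1 / θ) ≤ N := (le_max_right _ _).trans hsmall
    have h2 : ((2 : ℝ) ^ (1 / θ)) ^ θ ≤ (N : ℝ) ^ θ :=
      Real.rpow_le_rpow (by positivity) h1 hθ0.le
    rwa [← Real.rpow_mul (by norm_num), one_div_mul_cancel hθ0.ne', Real.rpow_one] at h2
  have hNθ0 : 0 < (N : ℝ) ^ θ := by linarith
  -- `x_j^{1−σ} = N^{1−σ} r^{j+1}` for `x_j = N / 2^{j+1}`
  have hxpow : ∀ j : ℕ, ((N : ℝ) / 2 ^ (j + 1)) ^ (1 - σ) = (N : ℝ) ^ (1 - σ) * r ^ (j + 1) := by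
    intro j
    rw [div_eq_mul_inv, Real.mul_rpow hN0.le (by positivity), Real.inv_rpow (by positivity)]
    congr 1
    rw [← Real.rpow_natCast (2 : ℝ) (j + 1), ← Real.rpow_mul (by norm_num),
      ← Real.rpow_neg (by norm_num), hr, ← Real.rpow_natCast, ← Real.rpow_mul (by norm_num)]
    congr 1
    push_cast
    ring
  -- the dyadic decomposition, with empty tail
  set J := Nat.log 2 N + 1 with hJ
  have htail : N / 2 ^ J = 0 := Nat.div_eq_of_lt (Nat.lt_pow_succ_log_self one_lt_two N)
  rw [sum_Ioc_dyadic _ N J, htail, Finset.Ioc_self, Finset.sum_empty, add_zero]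
  -- block bounds
  have hWall : ∑ q ∈ PP, (1 : ℝ) / q ≤ Real.log (Real.log N) + 5 := sum_inv_primePow_le hN2
  have hblock : ∀ j : ℕ, ∑ n ∈ Finset.Ioc (N / 2 ^ (j + 1)) (N / 2 ^ j), (n : ℝ) ^ (-σ) * (f n - E) ^ 2
      ≤ 2 * K₁ * Dsq * (N : ℝ) ^ (1 - σ) * r ^ (j + 1)
        + (N : ℝ) ^ θ * Dsq * (148 + 2 * Real.log (Real.log N)) := by
    intro j
    set Mj := N / 2 ^ j with hMj
    have hMjN : Mj ≤ N := Nat.div_le_self N _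
    have hsub : Finset.Ioc (N / 2 ^ (j + 1)) Mj ⊆ Finset.Ioc 0 Mj :=
      Finset.Ioc_subset_Ioc_left (Nat.zero_le _)
    have hAj := hA Mj hMjN
    have hterm1 : 0 ≤ 2 * K₁ * Dsq * (N : ℝ) ^ (1 - σ) * r ^ (j + 1) := by positivity
    have hterm2 : 0 ≤ (N : ℝ) ^ θ * Dsq * (148 + 2 * Real.log (Real.log N)) := by positivity
    have hMjR : (0 : ℝ) ≤ Mj := Nat.cast_nonneg _
    have hWj0 : 0 ≤ ∑ q ∈ PP.filter (fun q => Mj < q), (1 : ℝ) / q :=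
      Finset.sum_nonneg fun q _ => by positivity
    by_cases hdeep : (Mj : ℝ) < (N : ℝ) ^ θ
    · -- deep block: weight ≤ 1, `A(Mj) ≤ Mj Dsq (148 + 2 log log N) ≤ N^θ Dsq (…)`
      have hWj : ∑ q ∈ PP.filter (fun q => Mj < q), (1 : ℝ) / q ≤ Real.log (Real.log N) + 5 :=
        le_trans (Finset.sum_le_sum_of_subset_of_nonneg (Finset.filter_subset _ _)
          fun q _ _ => by positivity) hWall
      calc ∑ n ∈ Finset.Ioc (N / 2 ^ (j + 1)) Mj, (n : ℝ) ^ (-σ) * (f n - E) ^ 2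
          ≤ ∑ n ∈ Finset.Ioc (N / 2 ^ (j + 1)) Mj, (f n - E) ^ 2 := by
            refine Finset.sum_le_sum fun n hn => ?_
            have hn' : n ∈ Finset.Ioc 0 N := by
              rw [Finset.mem_Ioc] at hn ⊢
              exact ⟨(Nat.zero_le _).trans_lt hn.1, hn.2.trans hMjN⟩
            calc (n : ℝ) ^ (-σ) * (f n - E) ^ 2 ≤ 1 * (f n - E) ^ 2 :=
                  mul_le_mul_of_nonneg_right (hw1 n hn') (sq_nonneg _)
              _ = (f n - E) ^ 2 := one_mul _
        _ ≤ ∑ n ∈ Finset.Ioc 0 Mj, (f n - E) ^ 2 :=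
            Finset.sum_le_sum_of_subset_of_nonneg hsub fun n _ _ => sq_nonneg _
        _ ≤ 138 * Mj * Dsq + 2 * Mj * Dsq * ∑ q ∈ PP.filter (fun q => Mj < q), (1 : ℝ) / q := hAj
        _ ≤ 138 * Mj * Dsq + 2 * Mj * Dsq * (Real.log (Real.log N) + 5) := by
            have := mul_le_mul_of_nonneg_left hWj (show 0 ≤ 2 * (Mj : ℝ) * Dsq by positivity)
            linarith
        _ = Mj * (Dsq * (148 + 2 * Real.log (Real.log N))) := by ring
        _ ≤ (N : ℝ) ^ θ * (Dsq * (148 + 2 * Real.log (Real.log N))) :=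
            mul_le_mul_of_nonneg_right hdeep.le (by positivity)
        _ = (N : ℝ) ^ θ * Dsq * (148 + 2 * Real.log (Real.log N)) := by ring
        _ ≤ _ := le_add_of_nonneg_left hterm1
    · -- shallow block
      push Not at hdeep
      have hMj2R : (2 : ℝ) ≤ Mj := hNθ2.trans hdeep
      have hMj2 : 2 ≤ Mj := by exact_mod_cast hMj2R
      have hMj0 : (0 : ℝ) < Mj := by linarith
      -- the window sum is bounded
      have hWj : ∑ q ∈ PP.filter (fun q => Mj < q), (1 : ℝ) / q ≤ Real.log (1 / θ) + 15 := by
        have h1 := sum_inv_primePow_window_le hMj2 hMjN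
        rw [← hPP] at h1
        have hlogMj : θ * Real.log N ≤ Real.log Mj := by
          rw [← Real.log_rpow hN0]
          exact Real.log_le_log hNθ0 hdeep
        have hlogMj0 : 0 < Real.log Mj := Real.log_pos (by linarith)
        have h2 : Real.log (Real.log N) - Real.log (Real.log Mj) ≤ Real.log (1 / θ) := by
          rw [← Real.log_div (by linarith) hlogMj0.ne']
          apply Real.log_le_log (div_pos (by linarith) hlogMj0)
          rw [div_le_iff₀ hlogMj0, one_div, le_inv_mul_iff₀ hθ0]
          exact hlogMj
        linarith
      -- the weight on the block
      set x : ℝ := (N : ℝ) / 2 ^ (j + 1) with hx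
      have hx0 : 0 < x := by positivity
      have hxn : ∀ n ∈ Finset.Ioc (N / 2 ^ (j + 1)) Mj, (n : ℝ) ^ (-σ) ≤ x ^ (-σ) := by
        intro n hn
        have hn1 : N / 2 ^ (j + 1) + 1 ≤ n := (Finset.mem_Ioc.mp hn).1
        have hlt : x < n := by
          have h1 := (natDiv_bounds N (show 0 < 2 ^ (j + 1) by positivity)).1
          have h2 : ((N / 2 ^ (j + 1) : ℕ) : ℝ) + 1 ≤ n := by exact_mod_cast hn1
          push_cast at h1
          rw [hx]
          linarith
        exact Real.rpow_le_rpow_of_nonpos hx0 hlt.le (by linarith)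
      have hMjx : (Mj : ℝ) ≤ 2 * x := by
        rw [hx, hMj]
        have hc := Nat.cast_div_le (m := N) (n := 2 ^ j) (α := ℝ)
        push_cast at hc
        calc ((N / 2 ^ j : ℕ) : ℝ) ≤ (N : ℝ) / 2 ^ j := hc
          _ = 2 * ((N : ℝ) / 2 ^ (j + 1)) := by field_simp; ring
      have hxσ : x ^ (-σ) * x = x ^ (1 - σ) := by
        calc x ^ (-σ) * x = x ^ (-σ) * x ^ (1 : ℝ) := by rw [Real.rpow_one]
          _ = x ^ (-σ + 1) := (Real.rpow_add hx0 _ _).symm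
          _ = x ^ (1 - σ) := by ring_nf
      calc ∑ n ∈ Finset.Ioc (N / 2 ^ (j + 1)) Mj, (n : ℝ) ^ (-σ) * (f n - E) ^ 2
          ≤ ∑ n ∈ Finset.Ioc (N / 2 ^ (j + 1)) Mj, x ^ (-σ) * (f n - E) ^ 2 :=
            Finset.sum_le_sum fun n hn => mul_le_mul_of_nonneg_right (hxn n hn) (sq_nonneg _)
        _ = x ^ (-σ) * ∑ n ∈ Finset.Ioc (N / 2 ^ (j + 1)) Mj, (f n - E) ^ 2 := by
            rw [Finset.mul_sum]
        _ ≤ x ^ (-σ) * ∑ n ∈ Finset.Ioc 0 Mj, (f n - E) ^ 2 :=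
            mul_le_mul_of_nonneg_left
              (Finset.sum_le_sum_of_subset_of_nonneg hsub fun n _ _ => sq_nonneg _)
              (Real.rpow_nonneg hx0.le _)
        _ ≤ x ^ (-σ) * (138 * Mj * Dsq + 2 * Mj * Dsq * (Real.log (1 / θ) + 15)) := by
            apply mul_le_mul_of_nonneg_left _ (Real.rpow_nonneg hx0.le _)
            have := mul_le_mul_of_nonneg_left hWj (show 0 ≤ 2 * (Mj : ℝ) * Dsq by positivity)
            linarith
        _ = x ^ (-σ) * Mj * (Dsq * K₁) := by rw [hK₁]; ring
        _ ≤ x ^ (-σ) * (2 * x) * (Dsq * K₁) := by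
            apply mul_le_mul_of_nonneg_right _ (by positivity)
            exact mul_le_mul_of_nonneg_left hMjx (Real.rpow_nonneg hx0.le _)
        _ = 2 * K₁ * Dsq * x ^ (1 - σ) := by rw [← hxσ]; ring
        _ = 2 * K₁ * Dsq * (N : ℝ) ^ (1 - σ) * r ^ (j + 1) := by rw [hx, hxpow j]; ring
        _ ≤ _ := le_add_of_nonneg_right hterm2
  -- sum the block bounds
  have hgeom : ∑ j ∈ Finset.range J, r ^ (j + 1) ≤ G := by
    have h1 : ∑ j ∈ Finset.range J, r ^ (j + 1) = ∑ i ∈ Finset.Ico 1 (J + 1), r ^ i := by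
      rw [Finset.sum_Ico_eq_sum_range]
      refine Finset.sum_congr (by simp) fun j _ => ?_
      rw [add_comm]
    rw [h1, hG]
    calc ∑ i ∈ Finset.Ico 1 (J + 1), r ^ i ≤ r ^ 1 / (1 - r) := geom_sum_Ico_le_of_lt_one hr0.le hr1
      _ = r / (1 - r) := by rw [pow_one]
  -- `J (148 + 2 log log N) ≤ K₂ N^θ`
  have hJ_bound : (J : ℝ) * (148 + 2 * Real.log (Real.log N)) ≤ K₂ * (N : ℝ) ^ θ := by
    have hlog2 : 0.6931471803 < Real.log 2 := Real.log_two_gt_d9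
    -- `J ≤ 3 log N`
    have hJL : (J : ℝ) ≤ 3 * Real.log N := by
      have h1 : ((Nat.log 2 N : ℕ) : ℝ) * Real.log 2 ≤ Real.log N := by
        rw [← Real.log_pow]
        apply Real.log_le_log (by positivity)
        exact_mod_cast Nat.pow_log_le_self 2 (by omega : N ≠ 0)
      have h2 : ((Nat.log 2 N : ℕ) : ℝ) ≤ Real.log N / Real.log 2 := by
        rw [le_div_iff₀ (by linarith)]; exact h1
      have h3 : Real.log N / Real.log 2 ≤ 1.45 * Real.log N := by
        rw [div_le_iff₀ (by linarith)]; nlinarith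
      have : (J : ℝ) = (Nat.log 2 N : ℕ) + 1 := by rw [hJ]; push_cast; ring
      rw [this]
      linarith
    -- `log log N ≤ log N`
    have hll : Real.log (Real.log N) ≤ Real.log N :=
      (Real.log_le_sub_one_of_pos (by linarith)).trans (by linarith)
    -- `log N ≤ (4/θ) N^{θ/4}` and hence `(log N)² ≤ (16/θ²) N^θ`
    have hLpow : Real.log N ≤ 4 / θ * (N : ℝ) ^ (θ / 4) := by
      have h1 : Real.log ((N : ℝ) ^ (θ / 4)) ≤ (N : ℝ) ^ (θ / 4) - 1 :=
        Real.log_le_sub_one_of_pos (Real.rpow_pos_of_pos hN0 _)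
      rw [Real.log_rpow hN0] at h1
      rw [div_mul_eq_mul_div, le_div_iff₀ hθ0]
      nlinarith [Real.rpow_nonneg hN0.le (θ / 4)]
    have hL2 : Real.log N ^ 2 ≤ 16 / θ ^ 2 * (N : ℝ) ^ θ := by
      have h1 : Real.log N ^ 2 ≤ (4 / θ * (N : ℝ) ^ (θ / 4)) ^ 2 :=
        pow_le_pow_left₀ (by linarith) hLpow 2
      have h2 : ((N : ℝ) ^ (θ / 4)) ^ 2 = (N : ℝ) ^ (θ / 2) := by
        rw [← Real.rpow_natCast, ← Real.rpow_mul hN0.le]; norm_num; ring_nf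
      have h3 : (N : ℝ) ^ (θ / 2) ≤ (N : ℝ) ^ θ :=
        Real.rpow_le_rpow_of_exponent_le (by linarith) (by linarith)
      calc Real.log N ^ 2 ≤ (4 / θ * (N : ℝ) ^ (θ / 4)) ^ 2 := h1
        _ = 16 / θ ^ 2 * (N : ℝ) ^ (θ / 2) := by rw [mul_pow, h2]; ring
        _ ≤ 16 / θ ^ 2 * (N : ℝ) ^ θ := mul_le_mul_of_nonneg_left h3 (by positivity)
    calc (J : ℝ) * (148 + 2 * Real.log (Real.log N))
        ≤ (3 * Real.log N) * (150 * Real.log N) := by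
          apply mul_le_mul hJL _ (by positivity) (by positivity)
          linarith
      _ = 450 * Real.log N ^ 2 := by ring
      _ ≤ 450 * (16 / θ ^ 2 * (N : ℝ) ^ θ) := by nlinarith
      _ = K₂ * (N : ℝ) ^ θ := by rw [hK₂]; ring
  have hθθ : (N : ℝ) ^ θ * (N : ℝ) ^ θ = (N : ℝ) ^ (1 - σ) := by
    rw [← Real.rpow_add hN0]; congr 1; rw [hθ]; ring
  calc ∑ j ∈ Finset.range J, ∑ n ∈ Finset.Ioc (N / 2 ^ (j + 1)) (N / 2 ^ j),
          (n : ℝ) ^ (-σ) * (f n - E) ^ 2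
      ≤ ∑ j ∈ Finset.range J, (2 * K₁ * Dsq * (N : ℝ) ^ (1 - σ) * r ^ (j + 1)
          + (N : ℝ) ^ θ * Dsq * (148 + 2 * Real.log (Real.log N))) :=
        Finset.sum_le_sum fun j _ => hblock j
    _ = 2 * K₁ * Dsq * (N : ℝ) ^ (1 - σ) * ∑ j ∈ Finset.range J, r ^ (j + 1)
          + J * ((N : ℝ) ^ θ * Dsq * (148 + 2 * Real.log (Real.log N))) := by
        rw [Finset.sum_add_distrib, Finset.sum_const, Finset.card_range, nsmul_eq_mul,
          ← Finset.mul_sum]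
    _ ≤ 2 * K₁ * Dsq * (N : ℝ) ^ (1 - σ) * G + K₂ * (N : ℝ) ^ θ * ((N : ℝ) ^ θ * Dsq) := by
        have h1 := mul_le_mul_of_nonneg_left hgeom
          (show 0 ≤ 2 * K₁ * Dsq * (N : ℝ) ^ (1 - σ) by positivity)
        have h2 := mul_le_mul_of_nonneg_right hJ_bound
          (show 0 ≤ (N : ℝ) ^ θ * Dsq by positivity)
        nlinarith
    _ = (2 * K₁ * G + K₂) * (N : ℝ) ^ (1 - σ) * Dsq := by rw [← hθθ]; ring
    _ ≤ (69 * T ^ σ + 2 * K₁ * G + K₂ + 1) * (N : ℝ) ^ (1 - σ) * Dsq := by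
        have : 0 ≤ (69 * T ^ σ + 1) * ((N : ℝ) ^ (1 - σ) * Dsq) := by positivity
        nlinarith

/-- Weighted Turán–Kubilius for arbitrary coefficients on the prime powers (Lemma (1.5) "holds
for all complex numbers `f(p^k)`", real case): `turanKubilius_weighted` applied to the additive
function with values `g` on the prime powers. [cite: Elliott1985, Ch. 1, Lemma (1.5)] -/
theorem turanKubilius_weighted_coeff {σ : ℝ} (hσ0 : 0 ≤ σ) (hσ1 : σ < 1) :
    ∃ C : ℝ, 0 < C ∧ ∀ (g : ℕ → ℝ) (N : ℕ),
      ∑ n ∈ Finset.Ioc 0 N, (n : ℝ) ^ (-σ) *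
        (∑ q ∈ ((Finset.Ioc 0 N).filter IsPrimePow).filter
            (fun q => n.factorization q.minFac = q.factorization q.minFac), g q
          - ∑ q ∈ (Finset.Ioc 0 N).filter IsPrimePow, g q / q * (1 - 1 / (q.minFac : ℝ))) ^ 2
      ≤ C * (N : ℝ) ^ (1 - σ) * ∑ q ∈ (Finset.Ioc 0 N).filter IsPrimePow, g q ^ 2 / q := by
  obtain ⟨C, hC, h⟩ := turanKubilius_weighted hσ0 hσ1
  refine ⟨C, hC, fun g N => ?_⟩
  set f : ℕ → ℝ := fun n => ∑ p ∈ n.primeFactors, g (p ^ n.factorization p) with hfdef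
  have hf : IsAdditiveArith f := isAdditiveArith_sum_primeFactors g
  have hfg : ∀ q ∈ (Finset.Ioc 0 N).filter IsPrimePow, f q = g q := fun q hq =>
    sum_primeFactors_of_isPrimePow g (Finset.mem_filter.mp hq).2
  have hTK := h f hf N
  have hE : ∑ q ∈ (Finset.Ioc 0 N).filter IsPrimePow, f q / q * (1 - 1 / (q.minFac : ℝ))
      = ∑ q ∈ (Finset.Ioc 0 N).filter IsPrimePow, g q / q * (1 - 1 / (q.minFac : ℝ)) :=
    Finset.sum_congr rfl fun q hq => by rw [hfg q hq]
  have hD : ∑ q ∈ (Finset.Ioc 0 N).filter IsPrimePow, f q ^ 2 / q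
      = ∑ q ∈ (Finset.Ioc 0 N).filter IsPrimePow, g q ^ 2 / q :=
    Finset.sum_congr rfl fun q hq => by rw [hfg q hq]
  rw [hE, hD] at hTK
  refine le_trans (le_of_eq (Finset.sum_congr rfl fun n hn => ?_)) hTK
  rw [Finset.mem_Ioc] at hn
  have hn0 : n ≠ 0 := by omega
  rw [eq_sum_filter_exact hf hn0 hn.2]
  congr 3
  refine Finset.sum_congr rfl fun q hq => ?_
  exact (hfg q (Finset.mem_filter.mp hq).1).symm

-- shares the heavy set-up conventions of `turanKubilius`; keep the heartbeat budget generous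
set_option maxHeartbeats 400000 in
/-- **The weighted dual Turán–Kubilius inequality** (Elliott 1985, Ch. 5, Lemma (5.2), first
inequality, `0 ≤ σ < 1`): there is `C = C(σ)` with
`∑_{q ≤ N} q |∑_{n ≤ N, q ∥ n} a_n n^{-σ} − q⁻¹(1 − 1/p) ∑_{n ≤ N} a_n n^{-σ}|²
  ≤ C N^{1−σ} ∑_{n ≤ N} |a_n|² n^{-σ}` for all real `a_n` and all `N` (`q = p^k` over the prime
powers `≤ N`). As printed: `turanKubilius_weighted_coeff` and the duality principle with the matrix
`c(q, n) = (q/n^σ)^{1/2}([q ∥ n] − q⁻¹(1 − 1/p))`, then `b_n = n^{-σ/2} a_n`.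
[cite: Elliott1985, Ch. 5, Lemma (5.2)] -/
theorem turanKubilius_weighted_dual {σ : ℝ} (hσ0 : 0 ≤ σ) (hσ1 : σ < 1) :
    ∃ C : ℝ, 0 < C ∧ ∀ (a : ℕ → ℝ) (N : ℕ),
      ∑ q ∈ (Finset.Ioc 0 N).filter IsPrimePow,
        (q : ℝ) * (∑ n ∈ (Finset.Ioc 0 N).filter
              (fun n => n.factorization q.minFac = q.factorization q.minFac),
                a n * (n : ℝ) ^ (-σ)
            - 1 / q * (1 - 1 / (q.minFac : ℝ)) * ∑ n ∈ Finset.Ioc 0 N, a n * (n : ℝ) ^ (-σ)) ^ 2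
      ≤ C * (N : ℝ) ^ (1 - σ) * ∑ n ∈ Finset.Ioc 0 N, a n ^ 2 * (n : ℝ) ^ (-σ) := by
  classical
  obtain ⟨C, hC, h⟩ := turanKubilius_weighted_coeff hσ0 hσ1
  refine ⟨C, hC, fun a N => ?_⟩
  set PP := (Finset.Ioc 0 N).filter IsPrimePow with hPP
  set X : ℕ → ℕ → Prop := fun q n => n.factorization q.minFac = q.factorization q.minFac with hX
  set m : ℕ → ℝ := fun q => 1 / q * (1 - 1 / (q.minFac : ℝ)) with hm
  set w : ℕ → ℝ := fun n => (n : ℝ) ^ (-σ / 2) with hw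
  set c : ℕ → ℕ → ℝ := fun n q => Real.sqrt q * w n * ((if X q n then 1 else 0) - m q) with hc
  have hq0 : ∀ q ∈ PP, (0 : ℝ) < q := fun q hq => by
    have := (Finset.mem_Ioc.mp (Finset.mem_filter.mp hq).1).1
    exact_mod_cast this
  have hww : ∀ n ∈ Finset.Ioc 0 N, w n * w n = (n : ℝ) ^ (-σ) := by
    intro n hn
    have hn0 : (0 : ℝ) < n := by exact_mod_cast (Finset.mem_Ioc.mp hn).1
    simp only [hw]
    rw [← Real.rpow_add hn0]
    ring_nf
  have hlam : 0 ≤ C * (N : ℝ) ^ (1 - σ) :=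
    mul_nonneg hC.le (Real.rpow_nonneg (Nat.cast_nonneg _) _)
  -- the primal inequality in matrix form
  have hprimal : ∀ x : ℕ → ℝ, ∑ n ∈ Finset.Ioc 0 N, (∑ q ∈ PP, c n q * x q) ^ 2
      ≤ C * (N : ℝ) ^ (1 - σ) * ∑ q ∈ PP, x q ^ 2 := by
    intro x
    set g : ℕ → ℝ := fun q => Real.sqrt q * x q with hg
    have hTK := h g N
    rw [← hPP] at hTK
    have hD : ∑ q ∈ PP, g q ^ 2 / q = ∑ q ∈ PP, x q ^ 2 := by
      refine Finset.sum_congr rfl fun q hq => ?_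
      simp only [hg]
      rw [mul_pow, Real.sq_sqrt (hq0 q hq).le]
      field_simp [(hq0 q hq).ne']
    rw [hD] at hTK
    refine le_trans (le_of_eq (Finset.sum_congr rfl fun n hn => ?_)) hTK
    have e1 : (∑ q ∈ PP.filter (fun q => n.factorization q.minFac = q.factorization q.minFac), g q)
          - ∑ q ∈ PP, g q / q * (1 - 1 / (q.minFac : ℝ))
        = ∑ q ∈ PP, ((if X q n then 1 else 0) - m q) * g q := by
      calc (∑ q ∈ PP.filter (fun q => n.factorization q.minFac = q.factorization q.minFac), g q)
            - ∑ q ∈ PP, g q / q * (1 - 1 / (q.minFac : ℝ))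
          = (∑ q ∈ PP, if n.factorization q.minFac = q.factorization q.minFac then g q else 0)
            - ∑ q ∈ PP, g q / q * (1 - 1 / (q.minFac : ℝ)) := by rw [Finset.sum_filter]
        _ = ∑ q ∈ PP, ((if n.factorization q.minFac = q.factorization q.minFac then g q else 0)
            - g q / q * (1 - 1 / (q.minFac : ℝ))) := (Finset.sum_sub_distrib _ _).symm
        _ = ∑ q ∈ PP, ((if X q n then 1 else 0) - m q) * g q := by
            refine Finset.sum_congr rfl fun q _ => ?_
            simp only [hX, hm]
            split_ifs <;> ring
    rw [e1]
    calc (∑ q ∈ PP, c n q * x q) ^ 2 = (w n * ∑ q ∈ PP, ((if X q n then 1 else 0) - m q) * g q) ^ 2 := by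
          congr 1
          rw [Finset.mul_sum]
          refine Finset.sum_congr rfl fun q _ => ?_
          simp only [hc, hg]
          ring
      _ = (n : ℝ) ^ (-σ) * (∑ q ∈ PP, ((if X q n then 1 else 0) - m q) * g q) ^ 2 := by
          rw [mul_pow, sq (w n), hww n hn]
  have hdual := duality (Finset.Ioc 0 N) PP c hlam hprimal (fun n => a n * w n)
  have hB : ∑ n ∈ Finset.Ioc 0 N, (a n * w n) ^ 2 = ∑ n ∈ Finset.Ioc 0 N, a n ^ 2 * (n : ℝ) ^ (-σ) :=
    Finset.sum_congr rfl fun n hn => by rw [mul_pow, sq (w n), hww n hn]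
  rw [hB] at hdual
  refine le_trans (le_of_eq (Finset.sum_congr rfl fun q hq => ?_)) hdual
  -- `(∑_n c_{n,q} a_n w_n)² = q (∑_{q ∥ n} a_n n^{-σ} − m_q ∑ a_n n^{-σ})²`
  have e : Real.sqrt q * (∑ n ∈ (Finset.Ioc 0 N).filter (fun n => X q n), a n * (n : ℝ) ^ (-σ)
          - m q * ∑ n ∈ Finset.Ioc 0 N, a n * (n : ℝ) ^ (-σ))
        = ∑ n ∈ Finset.Ioc 0 N, c n q * (a n * w n) := by
    calc Real.sqrt q * (∑ n ∈ (Finset.Ioc 0 N).filter (fun n => X q n), a n * (n : ℝ) ^ (-σ)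
            - m q * ∑ n ∈ Finset.Ioc 0 N, a n * (n : ℝ) ^ (-σ))
        = Real.sqrt q * ((∑ n ∈ Finset.Ioc 0 N, if X q n then a n * (n : ℝ) ^ (-σ) else 0)
            - ∑ n ∈ Finset.Ioc 0 N, m q * (a n * (n : ℝ) ^ (-σ))) := by
          rw [Finset.sum_filter, Finset.mul_sum]
      _ = Real.sqrt q * ∑ n ∈ Finset.Ioc 0 N,
            ((if X q n then a n * (n : ℝ) ^ (-σ) else 0) - m q * (a n * (n : ℝ) ^ (-σ))) := by
          rw [Finset.sum_sub_distrib]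
      _ = ∑ n ∈ Finset.Ioc 0 N, Real.sqrt q *
            ((if X q n then a n * (n : ℝ) ^ (-σ) else 0) - m q * (a n * (n : ℝ) ^ (-σ))) := by
          rw [Finset.mul_sum]
      _ = ∑ n ∈ Finset.Ioc 0 N, c n q * (a n * w n) := by
          refine Finset.sum_congr rfl fun n hn => ?_
          simp only [hc]
          rw [← hww n hn]
          split_ifs <;> ring
  rw [← e, mul_pow, Real.sq_sqrt (hq0 q hq).le]

/-! ### The weights `n^{-σ}`: divisibility by primes (second inequality of Lemma (5.2)) -/

/-- `∑_{n ≤ N} n^{-σ} ≤ N^{1−σ}/(1 − σ)` in the form `(1 − σ) ∑_{n ≤ N} n^{-σ} ≤ N^{1−σ}`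
(`0 ≤ σ ≤ 1`): telescoping with Bernoulli's inequality
`(1 − 1/n)^{1−σ} ≤ 1 − (1 − σ)/n`. [folklore] -/
theorem sum_rpow_neg_le {σ : ℝ} (hσ0 : 0 ≤ σ) (hσ1 : σ ≤ 1) (N : ℕ) :
    (1 - σ) * ∑ n ∈ Finset.Ioc 0 N, (n : ℝ) ^ (-σ) ≤ (N : ℝ) ^ (1 - σ) := by
  induction N with
  | zero =>
    simp only [Finset.Ioc_self, Finset.sum_empty, mul_zero]
    positivity
  | succ N ih =>
    rw [Finset.sum_Ioc_succ_top (Nat.zero_le _), mul_add]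
    have hn : (0 : ℝ) < (N : ℝ) + 1 := by positivity
    have hs : (-1 : ℝ) ≤ -1 / ((N : ℝ) + 1) := by
      rw [neg_div, neg_le_neg_iff, div_le_one hn]; linarith
    have hs' : (0 : ℝ) ≤ 1 + -1 / ((N : ℝ) + 1) := by linarith
    have hB := rpow_one_add_le_one_add_mul_self hs (p := 1 - σ) (by linarith) (by linarith)
    have e1 : ((N : ℝ) + 1) ^ (1 - σ) * (1 + -1 / ((N : ℝ) + 1)) ^ (1 - σ)
        = (N : ℝ) ^ (1 - σ) := by
      rw [← Real.mul_rpow hn.le hs']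
      congr 1
      field_simp
      ring
    have e2 : ((N : ℝ) + 1) ^ (1 - σ) * (1 + (1 - σ) * (-1 / ((N : ℝ) + 1)))
        = ((N : ℝ) + 1) ^ (1 - σ) - (1 - σ) * ((N : ℝ) + 1) ^ (-σ) := by
      have : ((N : ℝ) + 1) ^ (-σ) = ((N : ℝ) + 1) ^ (1 - σ) / ((N : ℝ) + 1) := by
        rw [← Real.rpow_sub_one hn.ne']; ring_nf
      rw [this]
      field_simp
      ring
    have key := mul_le_mul_of_nonneg_left hB (Real.rpow_nonneg hn.le (1 - σ))
    rw [e1, e2] at key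
    push_cast
    linarith

/-- For real `g` on the primes, the prime-power coefficients `q ↦ g(p(q))` satisfy
`∑_{q ≤ N} g(p(q))²/q ≤ 2 ∑_{p ≤ N} g(p)²/p` (`∑_{k ≥ 1} p^{-k} ≤ 2/p`). [folklore] -/
theorem sum_sq_minFac_div_le (g : ℕ → ℝ) (N : ℕ) :
    ∑ q ∈ (Finset.Ioc 0 N).filter IsPrimePow, g q.minFac ^ 2 / q
      ≤ 2 * ∑ p ∈ Nat.primesLE N, g p ^ 2 / p := by
  rw [sum_primePow_eq_sum_primesLE, Finset.mul_sum]
  refine Finset.sum_le_sum fun p hp => ?_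
  have hpp := Nat.prime_of_mem_primesLE hp
  have hp2 : (2 : ℝ) ≤ p := by exact_mod_cast hpp.two_le
  have hterm : ∀ k ∈ Finset.Icc 1 (Nat.log p N),
      g (p ^ k).minFac ^ 2 / (p ^ k : ℕ) = g p ^ 2 * (1 / (p : ℝ)) ^ k := by
    intro k hk
    have hk1 : k ≠ 0 := by have := (Finset.mem_Icc.mp hk).1; omega
    rw [hpp.pow_minFac hk1]
    push_cast
    rw [one_div_pow, div_eq_mul_one_div]
  rw [Finset.sum_congr rfl hterm, ← Finset.mul_sum]
  have h0 : (0 : ℝ) ≤ 1 / p := by positivity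
  have h1 : (1 : ℝ) / p < 1 := by rw [div_lt_one (by linarith)]; linarith
  have hgeom : ∑ k ∈ Finset.Icc 1 (Nat.log p N), (1 / (p : ℝ)) ^ k ≤ 2 / p := by
    calc ∑ k ∈ Finset.Icc 1 (Nat.log p N), (1 / (p : ℝ)) ^ k
        = ∑ k ∈ Finset.Ico 1 (Nat.log p N + 1), (1 / (p : ℝ)) ^ k := rfl
      _ ≤ (1 / (p : ℝ)) ^ 1 / (1 - 1 / p) := geom_sum_Ico_le_of_lt_one h0 h1
      _ ≤ 2 / p := by
          rw [pow_one, div_le_div_iff₀ (by rw [sub_pos]; exact h1) (by linarith)]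
          have : (1 : ℝ) / p * p = 1 := by field_simp
          nlinarith
  calc g p ^ 2 * ∑ k ∈ Finset.Icc 1 (Nat.log p N), (1 / (p : ℝ)) ^ k
      ≤ g p ^ 2 * (2 / p) := mul_le_mul_of_nonneg_left hgeom (sq_nonneg _)
    _ = 2 * (g p ^ 2 / p) := by ring

/-- The two centrings for a strongly additive function differ by little:
`(∑_{p ≤ N} g(p)/p − ∑_{q ≤ N} g(p(q)) q⁻¹(1 − 1/p(q)))² ≤ ∑_{p ≤ N} g(p)²/p`
(the difference is `∑_p g(p) p^{-K_p-1}` with `p^{K_p} ≤ N < p^{K_p+1}`; Cauchy–Schwarz).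
[folklore] -/
theorem centring_prime_sub_sq_le (g : ℕ → ℝ) (N : ℕ) :
    (∑ p ∈ Nat.primesLE N, g p / p
      - ∑ q ∈ (Finset.Ioc 0 N).filter IsPrimePow, g q.minFac / q * (1 - 1 / (q.minFac : ℝ))) ^ 2
      ≤ ∑ p ∈ Nat.primesLE N, g p ^ 2 / p := by
  classical
  set Dg := ∑ p ∈ Nat.primesLE N, g p ^ 2 / p with hDg
  have hDg0 : 0 ≤ Dg := Finset.sum_nonneg fun p _ => by positivity
  have hpfacts : ∀ p ∈ Nat.primesLE N, p.Prime ∧ (2 : ℝ) ≤ p ∧ N < p ^ (Nat.log p N + 1) :=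
    fun p hp => by
      have hpp := Nat.prime_of_mem_primesLE hp
      exact ⟨hpp, by exact_mod_cast hpp.two_le, Nat.lt_pow_succ_log_self hpp.one_lt N⟩
  have hBeq : ∑ q ∈ (Finset.Ioc 0 N).filter IsPrimePow, g q.minFac / q * (1 - 1 / (q.minFac : ℝ))
      = ∑ p ∈ Nat.primesLE N, g p * (1 / p - (1 / (p : ℝ)) ^ (Nat.log p N + 1)) := by
    rw [sum_primePow_eq_sum_primesLE]
    refine Finset.sum_congr rfl fun p hp => ?_
    obtain ⟨hpp, hp2, -⟩ := hpfacts p hp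
    have hterm : ∀ k ∈ Finset.Icc 1 (Nat.log p N),
        g (p ^ k).minFac / (p ^ k : ℕ) * (1 - 1 / ((p ^ k).minFac : ℝ))
          = g p * ((1 / (p : ℝ)) ^ k - (1 / (p : ℝ)) ^ (k + 1)) := by
      intro k hk
      have hk1 : k ≠ 0 := by have := (Finset.mem_Icc.mp hk).1; omega
      rw [hpp.pow_minFac hk1]
      push_cast
      rw [pow_succ, one_div_pow]
      ring
    rw [Finset.sum_congr rfl hterm, ← Finset.mul_sum]
    congr 1
    have htel : ∀ K : ℕ, ∑ k ∈ Finset.Icc 1 K, ((1 / (p : ℝ)) ^ k - (1 / (p : ℝ)) ^ (k + 1))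
        = 1 / p - (1 / (p : ℝ)) ^ (K + 1) := by
      intro K
      induction K with
      | zero => simp
      | succ K ih =>
        rw [Finset.sum_Icc_succ_top (by omega), ih]
        ring
    exact htel _
  have e : ∑ p ∈ Nat.primesLE N, g p / p
      - ∑ q ∈ (Finset.Ioc 0 N).filter IsPrimePow, g q.minFac / q * (1 - 1 / (q.minFac : ℝ))
      = ∑ p ∈ Nat.primesLE N, g p * (1 / (p : ℝ)) ^ (Nat.log p N + 1) := by
    rw [hBeq, ← Finset.sum_sub_distrib]
    refine Finset.sum_congr rfl fun p _ => ?_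
    ring
  rw [e]
  have hcs := Finset.sum_mul_sq_le_sq_mul_sq (Nat.primesLE N) (fun p => g p / Real.sqrt p)
    (fun p => Real.sqrt p * (1 / (p : ℝ)) ^ (Nat.log p N + 1))
  have e1 : ∀ p ∈ Nat.primesLE N,
      g p / Real.sqrt p * (Real.sqrt p * (1 / (p : ℝ)) ^ (Nat.log p N + 1))
        = g p * (1 / (p : ℝ)) ^ (Nat.log p N + 1) := by
    intro p hp
    obtain ⟨-, hp2, -⟩ := hpfacts p hp
    have hs : Real.sqrt p ≠ 0 := (Real.sqrt_pos.mpr (by linarith)).ne'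
    field_simp
  have e2 : ∀ p ∈ Nat.primesLE N, (g p / Real.sqrt p) ^ 2 = g p ^ 2 / p := by
    intro p hp
    rw [div_pow, Real.sq_sqrt (by positivity)]
  have e3 : ∀ p ∈ Nat.primesLE N,
      (Real.sqrt p * (1 / (p : ℝ)) ^ (Nat.log p N + 1)) ^ 2 ≤ (p : ℝ) / ((N : ℝ) * N) := by
    intro p hp
    obtain ⟨hpp, hp2, hNp⟩ := hpfacts p hp
    have hp0 : (0 : ℝ) < p := by linarith
    have hpN : (p : ℝ) ≤ N := by exact_mod_cast Nat.le_of_mem_primesLE hp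
    have hN0 : (0 : ℝ) < N := by linarith
    have hNp' : (N : ℝ) ≤ (p : ℝ) ^ (Nat.log p N + 1) := by exact_mod_cast hNp.le
    have h1 : (1 / (p : ℝ)) ^ (Nat.log p N + 1) ≤ 1 / N := by
      rw [one_div_pow]
      exact one_div_le_one_div_of_le hN0 hNp'
    have h2 : ((1 / (p : ℝ)) ^ (Nat.log p N + 1)) ^ 2 ≤ (1 / (N : ℝ)) ^ 2 :=
      pow_le_pow_left₀ (by positivity) h1 2
    rw [mul_pow, Real.sq_sqrt hp0.le]
    calc (p : ℝ) * ((1 / (p : ℝ)) ^ (Nat.log p N + 1)) ^ 2 ≤ p * (1 / (N : ℝ)) ^ 2 :=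
          mul_le_mul_of_nonneg_left h2 hp0.le
      _ = p / ((N : ℝ) * N) := by
          field_simp
  have hsmall : ∑ p ∈ Nat.primesLE N,
      (Real.sqrt p * (1 / (p : ℝ)) ^ (Nat.log p N + 1)) ^ 2 ≤ 1 := by
    rcases Nat.eq_zero_or_pos N with hN0 | hNpos
    · subst hN0
      simp [Nat.primesLE_zero]
    have hNR' : (0 : ℝ) < N := by exact_mod_cast hNpos
    calc ∑ p ∈ Nat.primesLE N, (Real.sqrt p * (1 / (p : ℝ)) ^ (Nat.log p N + 1)) ^ 2
        ≤ ∑ p ∈ Nat.primesLE N, (p : ℝ) / ((N : ℝ) * N) := Finset.sum_le_sum e3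
      _ ≤ ∑ p ∈ Nat.primesLE N, (N : ℝ) / ((N : ℝ) * N) := by
          refine Finset.sum_le_sum fun p hp => ?_
          apply div_le_div_of_nonneg_right _ (by positivity)
          exact_mod_cast Nat.le_of_mem_primesLE hp
      _ = (Nat.primesLE N).card * (1 / (N : ℝ)) := by
          rw [Finset.sum_const, nsmul_eq_mul]
          congr 1
          field_simp
      _ ≤ N * (1 / (N : ℝ)) := by
          apply mul_le_mul_of_nonneg_right _ (by positivity)
          have : (Nat.primesLE N).card ≤ (Finset.Ioc 0 N).card :=
            Finset.card_le_card fun p hp =>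
              Finset.mem_Ioc.mpr ⟨(Nat.prime_of_mem_primesLE hp).pos,
                Nat.le_of_mem_primesLE hp⟩
          rw [Nat.card_Ioc, Nat.sub_zero] at this
          exact_mod_cast this
      _ = 1 := by field_simp
  rw [Finset.sum_congr rfl e1, Finset.sum_congr rfl e2] at hcs
  calc (∑ p ∈ Nat.primesLE N, g p * (1 / (p : ℝ)) ^ (Nat.log p N + 1)) ^ 2
      ≤ Dg * ∑ p ∈ Nat.primesLE N, (Real.sqrt p * (1 / (p : ℝ)) ^ (Nat.log p N + 1)) ^ 2 :=
        hcs
    _ ≤ Dg * 1 := mul_le_mul_of_nonneg_left hsmall hDg0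
    _ = Dg := mul_one _

/-- **Weighted Turán–Kubilius, strongly additive form**: for `0 ≤ σ < 1` there is `C(σ)` with
`∑_{n ≤ N} n^{-σ} (∑_{p ∣ n} g(p) − ∑_{p ≤ N} g(p)/p)² ≤ C(σ) N^{1−σ} ∑_{p ≤ N} g(p)²/p` for every
real `g` and every `N` (the form (3) of the remarks after Lemma (1.5), with weights).
From `turanKubilius_weighted_coeff` with the coefficients `q ↦ g(p(q))`, `centring_prime_sub_sq_le`,
`sum_sq_minFac_div_le` and `sum_rpow_neg_le`. [cite: Elliott1985, Ch. 1, Lemma (1.5)] -/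
theorem turanKubilius_weighted_prime {σ : ℝ} (hσ0 : 0 ≤ σ) (hσ1 : σ < 1) :
    ∃ C : ℝ, 0 < C ∧ ∀ (g : ℕ → ℝ) (N : ℕ),
      ∑ n ∈ Finset.Ioc 0 N, (n : ℝ) ^ (-σ) *
          (∑ p ∈ n.primeFactors, g p - ∑ p ∈ Nat.primesLE N, g p / p) ^ 2
        ≤ C * (N : ℝ) ^ (1 - σ) * ∑ p ∈ Nat.primesLE N, g p ^ 2 / p := by
  classical
  obtain ⟨C, hC, h⟩ := turanKubilius_weighted_coeff hσ0 hσ1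
  have h1σ : 0 < 1 - σ := by linarith
  refine ⟨4 * C + 2 / (1 - σ), by positivity, fun g N => ?_⟩
  set PP := (Finset.Ioc 0 N).filter IsPrimePow with hPP
  set G : ℕ → ℝ := fun q => g q.minFac with hG
  set A := ∑ p ∈ Nat.primesLE N, g p / p with hA
  set B := ∑ q ∈ PP, G q / q * (1 - 1 / (q.minFac : ℝ)) with hB
  set Dg := ∑ p ∈ Nat.primesLE N, g p ^ 2 / p with hDg
  have hDg0 : 0 ≤ Dg := Finset.sum_nonneg fun p _ => by positivity
  have hNpow0 : 0 ≤ (N : ℝ) ^ (1 - σ) := Real.rpow_nonneg (Nat.cast_nonneg _) _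
  have hw0 : ∀ n : ℕ, 0 ≤ (n : ℝ) ^ (-σ) := fun n => Real.rpow_nonneg (Nat.cast_nonneg _) _
  have hTK := h G N
  rw [← hPP] at hTK
  have hL : ∀ n ∈ Finset.Ioc 0 N,
      ∑ q ∈ PP.filter (fun q => n.factorization q.minFac = q.factorization q.minFac), G q
        = ∑ p ∈ n.primeFactors, g p := by
    intro n hn
    rw [Finset.mem_Ioc] at hn
    exact sum_filter_exact_minFac g (by omega) hn.2
  have hDG : ∑ q ∈ PP, G q ^ 2 / q ≤ 2 * Dg := sum_sq_minFac_div_le g N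
  have hAB : (A - B) ^ 2 ≤ Dg := centring_prime_sub_sq_le g N
  have hS : (1 - σ) * ∑ n ∈ Finset.Ioc 0 N, (n : ℝ) ^ (-σ) ≤ (N : ℝ) ^ (1 - σ) :=
    sum_rpow_neg_le hσ0 hσ1.le N
  have hS' : ∑ n ∈ Finset.Ioc 0 N, (n : ℝ) ^ (-σ) ≤ (N : ℝ) ^ (1 - σ) / (1 - σ) := by
    rw [le_div_iff₀ h1σ]; linarith
  have hTK' : ∑ n ∈ Finset.Ioc 0 N, (n : ℝ) ^ (-σ) * (∑ p ∈ n.primeFactors, g p - B) ^ 2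
      ≤ C * (N : ℝ) ^ (1 - σ) * (2 * Dg) := by
    calc ∑ n ∈ Finset.Ioc 0 N, (n : ℝ) ^ (-σ) * (∑ p ∈ n.primeFactors, g p - B) ^ 2
        = ∑ n ∈ Finset.Ioc 0 N, (n : ℝ) ^ (-σ) *
            (∑ q ∈ PP.filter (fun q => n.factorization q.minFac = q.factorization q.minFac), G q
              - B) ^ 2 := Finset.sum_congr rfl fun n hn => by rw [hL n hn]
      _ ≤ C * (N : ℝ) ^ (1 - σ) * ∑ q ∈ PP, G q ^ 2 / q := hTK
      _ ≤ C * (N : ℝ) ^ (1 - σ) * (2 * Dg) := mul_le_mul_of_nonneg_left hDG (by positivity)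
  calc ∑ n ∈ Finset.Ioc 0 N, (n : ℝ) ^ (-σ) * (∑ p ∈ n.primeFactors, g p - A) ^ 2
      ≤ ∑ n ∈ Finset.Ioc 0 N, (n : ℝ) ^ (-σ) *
          (2 * (∑ p ∈ n.primeFactors, g p - B) ^ 2 + 2 * (A - B) ^ 2) := by
        refine Finset.sum_le_sum fun n _ => mul_le_mul_of_nonneg_left ?_ (hw0 n)
        nlinarith [sq_nonneg (∑ p ∈ n.primeFactors, g p - B + (A - B))]
    _ = 2 * ∑ n ∈ Finset.Ioc 0 N, (n : ℝ) ^ (-σ) * (∑ p ∈ n.primeFactors, g p - B) ^ 2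
          + 2 * (A - B) ^ 2 * ∑ n ∈ Finset.Ioc 0 N, (n : ℝ) ^ (-σ) := by
        rw [Finset.mul_sum, Finset.mul_sum, ← Finset.sum_add_distrib]
        refine Finset.sum_congr rfl fun n _ => ?_
        ring
    _ ≤ 2 * (C * (N : ℝ) ^ (1 - σ) * (2 * Dg)) + 2 * Dg * ((N : ℝ) ^ (1 - σ) / (1 - σ)) := by
        have h1 := mul_le_mul hAB hS' (Finset.sum_nonneg fun n _ => hw0 n) hDg0
        nlinarith
    _ = (4 * C + 2 / (1 - σ)) * (N : ℝ) ^ (1 - σ) * Dg := by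
        field_simp
        ring

-- shares the conventions of `turanKubilius_dual`
set_option maxHeartbeats 400000 in
/-- **The weighted dual Turán–Kubilius inequality, divisibility by primes** (Elliott 1985,
Ch. 5, Lemma (5.2), second inequality, `0 ≤ σ < 1`): there is `C(σ)` with
`∑_{p ≤ N} p |∑_{n ≤ N, p ∣ n} a_n n^{-σ} − p⁻¹ ∑_{n ≤ N} a_n n^{-σ}|² ≤ C(σ) N^{1−σ} ∑_{n ≤ N} a_n² n^{-σ}`
for all real `a_n` and all `N`. From `turanKubilius_weighted_prime` by `duality` with the matrix
`c(p, n) = (p/n^σ)^{1/2}([p ∣ n] − 1/p)` ("by duality from the form (3)", p. 82).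
[cite: Elliott1985, Ch. 5, Lemma (5.2)] -/
theorem turanKubilius_weighted_dual_prime {σ : ℝ} (hσ0 : 0 ≤ σ) (hσ1 : σ < 1) :
    ∃ C : ℝ, 0 < C ∧ ∀ (a : ℕ → ℝ) (N : ℕ),
      ∑ p ∈ Nat.primesLE N,
        (p : ℝ) * (∑ n ∈ (Finset.Ioc 0 N).filter (fun n => p ∣ n), a n * (n : ℝ) ^ (-σ)
            - 1 / p * ∑ n ∈ Finset.Ioc 0 N, a n * (n : ℝ) ^ (-σ)) ^ 2
      ≤ C * (N : ℝ) ^ (1 - σ) * ∑ n ∈ Finset.Ioc 0 N, a n ^ 2 * (n : ℝ) ^ (-σ) := by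
  classical
  obtain ⟨C, hC, h⟩ := turanKubilius_weighted_prime hσ0 hσ1
  refine ⟨C, hC, fun a N => ?_⟩
  set w : ℕ → ℝ := fun n => (n : ℝ) ^ (-σ / 2) with hw
  set c : ℕ → ℕ → ℝ := fun n p => Real.sqrt p * w n * ((if p ∣ n then 1 else 0) - 1 / p) with hc
  have hp0 : ∀ p ∈ Nat.primesLE N, (0 : ℝ) < p := fun p hp => by
    exact_mod_cast (Nat.prime_of_mem_primesLE hp).pos
  have hww : ∀ n ∈ Finset.Ioc 0 N, w n * w n = (n : ℝ) ^ (-σ) := by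
    intro n hn
    have hn0 : (0 : ℝ) < n := by exact_mod_cast (Finset.mem_Ioc.mp hn).1
    simp only [hw]
    rw [← Real.rpow_add hn0]
    ring_nf
  have hlam : 0 ≤ C * (N : ℝ) ^ (1 - σ) :=
    mul_nonneg hC.le (Real.rpow_nonneg (Nat.cast_nonneg _) _)
  have hprimal : ∀ x : ℕ → ℝ,
      ∑ n ∈ Finset.Ioc 0 N, (∑ p ∈ Nat.primesLE N, c n p * x p) ^ 2
        ≤ C * (N : ℝ) ^ (1 - σ) * ∑ p ∈ Nat.primesLE N, x p ^ 2 := by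
    intro x
    set g : ℕ → ℝ := fun p => Real.sqrt p * x p with hg
    have hTK := h g N
    have hD : ∑ p ∈ Nat.primesLE N, g p ^ 2 / p = ∑ p ∈ Nat.primesLE N, x p ^ 2 := by
      refine Finset.sum_congr rfl fun p hp => ?_
      simp only [hg]
      rw [mul_pow, Real.sq_sqrt (hp0 p hp).le]
      field_simp [(hp0 p hp).ne']
    rw [hD] at hTK
    refine le_trans (le_of_eq (Finset.sum_congr rfl fun n hn => ?_)) hTK
    have hn' := Finset.mem_Ioc.mp hn
    have e1 : ∑ p ∈ n.primeFactors, g p - ∑ p ∈ Nat.primesLE N, g p / p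
        = ∑ p ∈ Nat.primesLE N, ((if p ∣ n then 1 else 0) - 1 / p) * g p := by
      calc ∑ p ∈ n.primeFactors, g p - ∑ p ∈ Nat.primesLE N, g p / p
          = (∑ p ∈ (Nat.primesLE N).filter (fun p => p ∣ n), g p)
              - ∑ p ∈ Nat.primesLE N, g p / p := by
            rw [primesLE_filter_dvd (by omega) hn'.2]
        _ = (∑ p ∈ Nat.primesLE N, if p ∣ n then g p else 0)
              - ∑ p ∈ Nat.primesLE N, g p / p := by rw [Finset.sum_filter]
        _ = ∑ p ∈ Nat.primesLE N, ((if p ∣ n then g p else 0) - g p / p) :=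
            (Finset.sum_sub_distrib _ _).symm
        _ = ∑ p ∈ Nat.primesLE N, ((if p ∣ n then 1 else 0) - 1 / p) * g p := by
            refine Finset.sum_congr rfl fun p _ => ?_
            split_ifs <;> ring
    rw [e1]
    calc (∑ p ∈ Nat.primesLE N, c n p * x p) ^ 2
        = (w n * ∑ p ∈ Nat.primesLE N, ((if p ∣ n then 1 else 0) - 1 / p) * g p) ^ 2 := by
          congr 1
          rw [Finset.mul_sum]
          refine Finset.sum_congr rfl fun p _ => ?_
          simp only [hc, hg]
          ring
      _ = (n : ℝ) ^ (-σ) * (∑ p ∈ Nat.primesLE N, ((if p ∣ n then 1 else 0) - 1 / p) * g p) ^ 2 := by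
          rw [mul_pow, sq (w n), hww n hn]
  have hdual := duality (Finset.Ioc 0 N) (Nat.primesLE N) c hlam hprimal (fun n => a n * w n)
  have hB : ∑ n ∈ Finset.Ioc 0 N, (a n * w n) ^ 2
      = ∑ n ∈ Finset.Ioc 0 N, a n ^ 2 * (n : ℝ) ^ (-σ) :=
    Finset.sum_congr rfl fun n hn => by rw [mul_pow, sq (w n), hww n hn]
  rw [hB] at hdual
  refine le_trans (le_of_eq (Finset.sum_congr rfl fun p hp => ?_)) hdual
  have e : Real.sqrt p * (∑ n ∈ (Finset.Ioc 0 N).filter (fun n => p ∣ n), a n * (n : ℝ) ^ (-σ)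
          - 1 / p * ∑ n ∈ Finset.Ioc 0 N, a n * (n : ℝ) ^ (-σ))
        = ∑ n ∈ Finset.Ioc 0 N, c n p * (a n * w n) := by
    calc Real.sqrt p * (∑ n ∈ (Finset.Ioc 0 N).filter (fun n => p ∣ n), a n * (n : ℝ) ^ (-σ)
            - 1 / p * ∑ n ∈ Finset.Ioc 0 N, a n * (n : ℝ) ^ (-σ))
        = Real.sqrt p * ((∑ n ∈ Finset.Ioc 0 N, if p ∣ n then a n * (n : ℝ) ^ (-σ) else 0)
            - ∑ n ∈ Finset.Ioc 0 N, 1 / (p : ℝ) * (a n * (n : ℝ) ^ (-σ))) := by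
          rw [Finset.sum_filter, Finset.mul_sum]
      _ = Real.sqrt p * ∑ n ∈ Finset.Ioc 0 N,
            ((if p ∣ n then a n * (n : ℝ) ^ (-σ) else 0) - 1 / (p : ℝ) * (a n * (n : ℝ) ^ (-σ))) := by
          rw [Finset.sum_sub_distrib]
      _ = ∑ n ∈ Finset.Ioc 0 N, Real.sqrt p *
            ((if p ∣ n then a n * (n : ℝ) ^ (-σ) else 0) - 1 / (p : ℝ) * (a n * (n : ℝ) ^ (-σ))) := by
          rw [Finset.mul_sum]
      _ = ∑ n ∈ Finset.Ioc 0 N, c n p * (a n * w n) := by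
          refine Finset.sum_congr rfl fun n hn => ?_
          simp only [hc]
          rw [← hww n hn]
          split_ifs <;> ring
  rw [← e, mul_pow, Real.sq_sqrt (hp0 p hp).le]

end Literature.NumberTheory.LFunctions.TuranKubilius
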